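/-
Copyright: cell `langlands-arthur-audit` (papers/Langlands/langlands-arthur-audit), unit `pub-arthur-down-g35`
(downstream tracer, gen 35).  Eleventh file of the exact-support certificates of the downstream register (module M208 of the
cell's MODULE-MAP — CLAIMed in `lean/MODULE-MAP2.md` 2026-08-22T07:52:39Z): `DownstreamSupport.lean` … `DownstreamSupport9.lean` are full or CLOSED and
`DownstreamSupport10.lean` (sections 86–91, 82 % of the proposal cap after v4 = p321733) is CLOSED for sections; the supports of the register from tranche 89 on
(`Downstream25.lean` v2 ff.) start here, APPEND-ONLY in the same conventions and the same namespace `…Arthur2013.Downstream.Support`; this file imports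
`…DownstreamSupport10` (through it every earlier support file and the canonical readings `canon`, `canon₈`, `canon₈no`, `canon₃₃`, `canon₃₄`, `canon₃₄noC24`, `νtop`,
`μtop`, `κtop`, `κnoMok`, the countermodel lemmas) and `…Downstream25`; v1 = section 92, the supports of the eighty-ninth tranche (`Downstream25.lean` v2, this
unit: THE CITATION GRAPH, III — NEW row C226 Furusawa – Morimoto, Compositio Math. 160 (2024): control `FMggp1` (premise-free), hypothesis node `FM154gen` = their
assumption (1.5.4) SUPPLIED ⇐ the leaf `Consumers8.InnerTwists` (as printed) AND ⇐ book ∧ A5 `IshimotoGeneric` (their Remark 1.5), `FMggp2` ⇐ node, `FMrefined` ⇐ Mok ∧ C67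
∧ C24, `FMbocherer` ⇐ book ∧ `FMrefined`, `FMliu` ⇐ node ∧ `FMrefined`; NEW row C227 Shan 2025: control `ShanTheta` (premise-free); `canon₈₉W`, `canon_implications₈₉W`,
`c89_all_of`, `c₁noA5`, `eightyninth_holds_top`, `c89_node_denied_top`, `c89_rows_denied_top`, `c89_book_cm`, `c89_mok_cm`, `c89_kmsw_importDenied`, `c89_regraded`); v2 (unit `pub-arthur-down-g36`, gen 36) = section 93, the supports of the ninetieth tranche (NEW `Downstream26.lean` v1, module M210: THE CITATION
GRAPH, IV — NEW row C228 Harris – Kobayashi – Speh arXiv:2509.17007: controls `HKSlocal`, `HKSrestr` (premise-free), hypothesis node `HKSmult1` (multiplicity one in 𝒜_0(H),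
printed supplier [AIGKMS]) SUPPLIED ⇐ Mok ∧ KMSW's proved scope, `HKScoh` ⇐ node, `HKScentral` ⇐ `HKScoh` ∧ C14 `BPLZZii` ∧ C26 `BPCZii`; NEW row C229 Raum arXiv:2603.04282:
control `RaumKudla` (premise-free), node `LLmodularityIQ` ⇐ it, node `KSZ` (no supplier), node `LLhyp66` ⇐ Mok ∧ KMSW full ∧ `KSZ`, `LiLiu17` ⇐ the two nodes ∧ C19 `LiLiu`;
this file now also imports `…Downstream26`; `canon₉₀W`, `canon_implications₉₀W`, `c90_all_of`, `c₂noIINH`, `c₂noLiLiu`, `ninetieth_holds_top`, `c90_ksz_denied_top`,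
`c90_rows_denied_top`, `c90_mok_cm`, `c90_kmsw_importDenied`, `c90_sequel_cm`, `c90_regraded`); v3 (same unit) = section 94, the supports of the ninety-first tranche (`Downstream26.lean` v2: NEW row C230 Manji – Thøgersen – Wu
arXiv:2604.18433 — hypothesis node `MTWlgc` (their Hypothesis 1, no supplier), `MTWprop623` ⇐ C180 `SchmidtParamodular` ∧ C182 `SchmidtCAP`, `MTWfs` ⇐ `MTWprop623` ∧ C191
`MokGSp4`, `MTWprop723` ⇐ book ∧ C180 ∧ node, `MTWinf` ⇐ `MTWprop723` ∧ node; `canon₉₁W`, `canon_implications₉₁W`, `c91_all_of`, `ninetyfirst_holds_top`, `c91_node_denied_top`,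
`c91_book_cm`, `c91_conduits_denied_top`, `c91_unitary_independent`, `c91_regraded`); v4 (unit `pub-arthur-down-g37`, gen 37) = section 95, the supports of the ninety-second tranche (NEW `Downstream27.lean` v1, module M213 — this file
now also imports `…Downstream27`: NEW rows C231 Ruichen Xu arXiv:2410.13132 — node `RXmult1` ⇐ Mok ∧ KMSW's proved scope, `RXperiod` ⇐ node, `RXpadic` ⇐ node ∧ `RXperiod`;
C232 Loeffler – Zerbes arXiv:2106.14511 — `LZ2coh` ⇐ book ∧ A4 `GeeTaibi`, `LZ2padicL` ⇐ `LZ2coh`, `LZ2BK` ⇐ `LZ2coh` ∧ `LZ2padicL`; C233 Graham – Rockwood arXiv:2411.04559 —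
`GRetale` ⇐ `LZ2coh`, `GRpadicL` ⇐ `GRetale`; C234 Paniagua-Taboada Crelle 661 (2011) — `PTresidual` premise-free, `PThecke` ⇐ book, `PTpacket` ⇐ book; `canon₉₂W`,
`canon_implications₉₂W`, `c92_all_of`, `c₁noA4`, `ninetysecond_holds_top`, `c92_book_cm`, `c92_A4_denied_top`, `c92_mok_cm`, `c92_kmsw_importDenied`, `c92_sequel_cm`,
`c92_regraded`); v5 (same unit) = section 96, the supports of the ninety-third tranche (`Downstream27.lean` v2: NEW rows C235 Berger – Brown – Klosin
arXiv:2501.10327 — `BBKeisen` ⇐ C180 `Consumers19.SchmidtParamodular` (an anonymous strong multiplicity one for S_k(Sp_4(ℤ)) = Schmidt 2018 Cor. 2.8); C236 Anamby – Das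
arXiv:2403.17401 — `ADrank` ⇐ book ∧ C44 `Consumers21.PaulSaha` ∧ C182 `Consumers20.SchmidtCAP` ∧ C49 `Consumers21.RSYCount`; `canon₉₃W`, `canon_implications₉₃W`, `c93_all_of`,
`ninetythird_holds_top`, `c93_book_cm`, `c93_conduits_denied_top`, `c93_unitary_independent`, `c93_regraded`); v6 (unit `pub-arthur-down-g38`, gen 38) = section 97, the supports of the ninety-fourth tranche (NEW `Downstream28.lean` v1, module M215 — this file
now also imports `…Downstream28`: NEW rows C237 Katsura – Yamauchi arXiv:2606.21859 — `KYgraph` ⇐ C90 `Consumers28.VanHoften` ∧ C182 `Consumers20.SchmidtCAP`, `KYsx` ⇐ C90 ∧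
C182 ∧ C180 `Consumers19.SchmidtParamodular` ∧ C112 `Consumers30.WWYY`; C238 Horawa – Prasanna J. Eur. Math. Soc. 2025 — `HPpacket` ⇐ book ∧ A4 `GeeTaibi`, `HPaction` ⇐
`HPpacket` ∧ C87 `Consumers29.LPSZ` ∧ C192 `Consumers31.LZBlochKato`; C239 Pilloni Duke Math. J. 169 (2020) — `VPhida` premise-free, `VPeuler` ⇐ `VPhida` ∧ book ∧ A4;
`canon₉₄W`, `canon₉₄`, `canon_implications₉₄W`, `canon_implications₉₄`, `c94_all_of`, `c₂₈noC90`, `c₃₀noC112`, `ninetyfourth_holds_top`, `c94_book_cm`, `c94_conduits_denied_top`,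
`c94_unitary_independent`, `c94_regraded`); v7 (same unit) = section 98, the supports of the ninety-fifth tranche (`Downstream28.lean` v2: NEW row C240 Loeffler – Skinner – Zerbes,
J. Eur. Math. Soc. 24 (2022) — `LSZ4galois` (Theorem 10.1.3) ⇐ A7 `Consumers.XuGSp`, `LSZ4euler` ⇐ `LSZ4galois`; `canon₉₅W`, `canon₉₅`, `canon_implications₉₅W`,
`canon_implications₉₅`, `c95_all_of`, `c₁noA7`, `ninetyfifth_holds_top`, `c95_book_cm`, `c95_A7_denied_top`, `c95_unitary_independent`, `c95_regraded`).
Nothing of the first ten files is redeclared or changed.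
-/
import HarnessLib
import Literature.NumberTheory.Automorphic.Arthur2013.DownstreamSupport10
import Literature.NumberTheory.Automorphic.Arthur2013.Downstream25
import Literature.NumberTheory.Automorphic.Arthur2013.Downstream26
import Literature.NumberTheory.Automorphic.Arthur2013.Downstream27
import Literature.NumberTheory.Automorphic.Arthur2013.Downstream28

/-!
# Downstream of Arthur (2013): exact leaf support of the downstream register, eleventh file (sections ≥ 92)

**Source reproduced.**  Nothing beyond what `Downstream.lean` … `Downstream25.lean` transcribe (the downstream
authors' own sentences, cited there chunk by chunk) and what the three leaf-support modules certify
(`Arthur2013/LeafSupport.lean`, `Mok2015/LeafSupport.lean`, `KMSW2014/LeafSupport.lean`: for every leaf a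
kernel-checked countermodel of the DAG as typed).  As in the first ten files: a CANONICAL READING assigns to each
typed downstream statement the conjunction of DAG outputs its edge receives, the tranche's edges are shown to hold in
that reading for arbitrary node assignments, and the countermodels then give the « only if » half of each support —
which leaves are load-bearing for which downstream theorem, in the register AS TYPED (a statement about the cell's
transcription, not about the mathematics).  [cite: Arthur2013, §1.5 with AGIKMS2024 l.380-382 (the conditional
reading whose supports are certified)]

**v1 (section 92; unit `pub-arthur-down-g35`).**  The eighty-ninth tranche (`Downstream25.lean` v2) types THE CITATION GRAPH, III: row C226 Furusawa – Morimoto,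
Compositio Math. 160 (2024) 2115–2202 (control `FMggp1` = Theorem 1.1 (1), premise-free; hypothesis node `FM154gen` = their numbered assumption (1.5.4) « the endoscopic
classification of Arthur, i.e. [3, Conj. 9.4.2, Conj. 9.5.4] holds for G_{D°} » in the generality used, with TWO supplier edges — ⇐ the register's leaf `Consumers8.InnerTwists`
(as printed: the unwritten [A28]) and ⇐ book ∧ row A5 `Consumers.IshimotoGeneric` (the authors' Remark 1.5); `FMggp2` = Theorem 1.1 (2) ⇐ node; `FMrefined` = Theorem 1.2 ⇐
Mok ∧ row C67 `Consumers34.FurusawaMorimoto` ∧ row C24 `Consumers34.BPlocalGGP`; `FMbocherer` = Theorems 1.4 / 8.1 ⇐ book ∧ `FMrefined`; `FMliu` = Remark 1.5's completeness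
claim ⇐ node ∧ `FMrefined`) and row C227 Shan 2025 (control `ShanTheta` = Theorem 2, premise-free).  Certified with ONE reading `canon₈₉W ν μ c c₈ c₃₄` parametrised by the
ASSIGNMENTS of tranches 1 / 8 / 34 (the node := `c₈.InnerTwists ∨ (book ∧ c.IshimotoGeneric)`, so that BOTH supplier edges hold), whose edges hold for every such assignment
(`canon_implications₈₉W`): at the top WITH THE CHAPTER-9 LEAF DENIED (`canon₈no`) all seven statements hold (`eightyninth_holds_top`) — the unwritten [A28] is NOT in the
support once A5 is granted; with A5 denied too (`c₁noA5`) the node, Theorem 1.1 (2) and Remark 1.5 FAIL while Theorems 1.2 / 1.4 / 8.1 hold, and with A5 denied but the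
Chapter-9 leaf GRANTED (`canon₈`, the reading as printed) Theorem 1.1 (2) HOLDS again (`c89_node_denied_top`); with row C24 denied (§37's `canon₃₄noC24`, which denies C67
with it) Theorem 1.2, Theorems 1.4 / 8.1 and Remark 1.5 FAIL, Theorem 1.1 (2) holds (`c89_rows_denied_top`); in the book countermodel of ANY leaf (Mok, KMSW at the top) Theorem
1.1 (2) FAILS with the Chapter-9 leaf denied and HOLDS with it granted, Theorems 1.4 / 8.1 FAIL either way, Theorem 1.2 HOLDS (`c89_book_cm`); in the Mok countermodel of ANY
leaf (book, KMSW at the top) Theorems 1.2, 1.4 / 8.1 and Remark 1.5 FAIL, Theorem 1.1 (2) holds (`c89_mok_cm`); with KMSW's Mok import denied (`κnoMok`; book, Mok at the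
top) the same three FAIL through C67 / C24 (`c89_kmsw_importDenied`); the two controls hold in every reading.  In one statement (`c89_regraded`): support(`FMggp1`) =
support(`ShanTheta`) = ∅; support(`FMggp2`) = {[A28]} as printed, = book 24 (through A5) per Remark 1.5, and either suffices; support(`FMrefined`) = Mok 29 ∪ KMSW's
import-and-scope (through C67 / C24), book ∩ support = ∅; support(`FMbocherer`) = book 24 ∪ support(`FMrefined`); support(`FMliu`) = support(`FMggp2`) ∪ support(`FMrefined`).

**v2 (section 93; unit `pub-arthur-down-g36`).**  The ninetieth tranche (NEW `Downstream26.lean` v1, the twenty-sixth register file, module M210) types THE CITATION GRAPH, IV: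
row C228 Harris – Kobayashi – Speh arXiv:2509.17007 (controls `HKSlocal` = the main theorems of their Parts 1–2 and `HKSrestr` = Part 3 Thm 2.1, premise-free; hypothesis node
`HKSmult1` = « $\pi$ has multiplicity one in $ _0(H)$ », « essentially proved … [AIGKMS], and we will assume this », SUPPLIED ⇐ Mok ∧ KMSW's proved scope; `HKScoh` = Part 3 Prop. 1.5
with the period invariant Q(π) ⇐ node; `HKScentral` = Part 3 Thm 3.7 ⇐ `HKScoh` ∧ row C14 `Consumers2.BPLZZii` ∧ row C26 `Consumers2.BPCZii`) and row C229 Raum arXiv:2603.04282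
(control `RaumKudla` = Thm 1, premise-free; node `LLmodularityIQ` = Li – Liu's Hypothesis 4.5 in the imaginary quadratic setting ⇐ `RaumKudla`; node `KSZ` = the expected Kisin –
Shin – Zhu theorem, NO supplier; node `LLhyp66` = Li – Liu's Hypothesis 6.6 ⇐ Mok ∧ KMSW's starred statements in full ∧ `KSZ`; `LiLiu17` = Li – Liu's Thm 1.7 as re-stated by
Raum's Cor. 2 ⇐ `LLmodularityIQ` ∧ `LLhyp66` ∧ row C19 `Consumers2.LiLiu`).  Certified with ONE reading `canon₉₀W μ κ c₂ ksz` parametrised by the ASSIGNMENT of tranche 2 and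
the value of the Kisin – Shin – Zhu node — a reading WITHOUT the book's nodes (no book premise is typed anywhere in the tranche, so every book countermodel is covered by the
arbitrary μ, κ), whose edges hold for every such assignment (`canon_implications₉₀W`): at the top (tranche 2 canonical, `ksz := True`) all ten statements hold
(`ninetieth_holds_top`); with the Kisin – Shin – Zhu node DENIED Hypothesis 6.6 and Li – Liu's Thm 1.7 FAIL while the eight others hold (`c90_ksz_denied_top`); with rows C14 /
C26 denied (`c₂noIINH`) Thm 3.7 FAILS and Prop. 1.5 / Li – Liu hold, with row C19 denied (`c₂noLiLiu`) Li – Liu's Thm 1.7 FAILS and Hypothesis 6.6 / Thm 3.7 hold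
(`c90_rows_denied_top`); in the Mok countermodel of ANY leaf (KMSW at the top) the five unitary statements FAIL and the five controls / discharged nodes hold (`c90_mok_cm`);
with KMSW's Mok import denied (`κnoMok`: neither scope nor full) the same five FAIL (`c90_kmsw_importDenied`); and in KMSW's countermodel of ANY of the three leaves that feed
only the starred statements in full — the two unwritten sequels `KMS_A`, `KMS_B` and `AubertSS` — (Mok at the top; scope holds, full fails) C228's three statements HOLD
while Hypothesis 6.6 and Li – Liu's Thm 1.7 FAIL (`c90_sequel_cm`: KMSW's sequels are load-bearing for C229's Li – Liu statement, not for C228).  In one statement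
(`c90_regraded`): support(`HKSlocal`) = support(`HKSrestr`) = support(`RaumKudla`) = support(`LLmodularityIQ`) = ∅; support(`HKSmult1`) = support(`HKScoh`) = Mok 29 ∪
KMSW's import-and-scope; support(`HKScentral`) = the same, through the node AND through C14 / C26; support(`LLhyp66`) = Mok 29 ∪ KMSW in full (sequels included) ∪ {`KSZ`};
support(`LiLiu17`) = support(`LLhyp66`) ∪ KMSW's scope through C19; book ∩ support = ∅ for the whole tranche.

**v3 (section 94; unit `pub-arthur-down-g36`).**  The ninety-first tranche (`Downstream26.lean` v2) types NEW row C230 Manji – Thøgersen – Wu arXiv:2604.18433 (2026, PREPRINT):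
hypothesis node `MTWlgc` = their Hypothesis 1 (explicit local – global compatibility at p; no supplier in the three DAGs); `MTWprop623` = Proposition 6.2.3 ⇐ row C180
`Consumers19.SchmidtParamodular` ∧ row C182 `Consumers20.SchmidtCAP` (« By [Schmidt-Packet] and [Schmidt-CAPGSp4] »); `MTWfs` = Theorem 6.3.4 with Corollary 6.3.5 (= their Theorem
1.3.1) ⇐ `MTWprop623` ∧ row C191 `Consumers28.MokGSp4` (« By [Mok-GL2CM], … » in Proposition 6.3.2); `MTWprop723` = Proposition 7.2.3 ⇐ book (« According to Arthur's
classification ») ∧ C180 ∧ node; `MTWinf` = Theorem 7.3.4 with Corollary 7.3.5 (= their Theorem 1.3.2) ⇐ `MTWprop723` ∧ node.  Certified with ONE reading `canon₉₁W ν c₁₉ c₂₀ c₂₈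
lgc` parametrised by the ASSIGNMENTS of tranches 19 / 20 / 28 and the value of the node, whose edges hold for every such assignment (`canon_implications₉₁W`): at the top
(book, Mok and KMSW at the all-ones assignments; tranches 1 / 19 / 20 / 28 read canonically; node granted) all five statements hold (`ninetyfirst_holds_top`, through the
tranche's `ninetyfirst_of_leaves`); with the node DENIED the two finite-slope statements HOLD and the two infinite-slope statements FAIL (`c91_node_denied_top`: Hypothesis 1
is load-bearing exactly for Proposition 7.2.3 / Theorem 1.3.2); in each of the 24 book countermodels (canonical readings over it, every edge of tranches 1 / 19 / 20 / 28 / 91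
valid) ALL FOUR typed statements FAIL while the node holds (`c91_book_cm`: every book leaf is load-bearing, through the conduits for the finite-slope case, by name for the
infinite-slope case); with the conduits denied one at a time at the top — C180 (`canon₁₉noC180` / `canon₂₈noC180`), C182 (`canon₂₀no`), C191 (`canon₂₈noC191`) — the
tranche-91 edges hold and: C180 denied ⇒ all four FAIL; C182 denied ⇒ the two finite-slope statements FAIL, the two infinite-slope ones HOLD; C191 denied ⇒ Theorem 1.3.1
alone FAILS (`c91_conduits_denied_top`, reading-level separation); in every Mok countermodel (KMSW = `κnoMok`) and every KMSW countermodel, the book at the top, all four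
statements HOLD (`c91_unitary_independent`: no statement of Mok 2015 or KMSW occurs in the tranche's edges).  In one statement (`c91_regraded`): support(`MTWprop623`) =
support(`MTWfs`) = book 24 (through C180, C182, C191); support(`MTWprop723`) = support(`MTWinf`) = book 24 ∪ {`MTWlgc`}; Mok ∩ support = KMSW ∩ support = ∅.

**v4 (section 95; unit `pub-arthur-down-g37`).**  The ninety-second tranche (NEW `Downstream27.lean` v1, module M213) types NEW rows C231 Ruichen Xu arXiv:2410.13132
(PREPRINT; hypothesis node `RXmult1` = multiplicity one and the unique invariant pairing for cuspidal π on U(m,n) with cuspidal base change, « as a consequence of [Mok15,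
KMSW14] », SUPPLIED ⇐ Mok ∧ KMSW's proved scope; `RXperiod` = Thms 2.7 / 5.1 ⇐ node; `RXpadic` = Thms 3.3 / 3.5 / 3.7 ⇐ node ∧ `RXperiod`), C232 Loeffler – Zerbes
arXiv:2106.14511 (PREPRINT; `LZ2coh` = Prop. 2.7.2 « By Arthur's classification » ⇐ book ∧ row A4 `Consumers.GeeTaibi`; `LZ2padicL` = Thm 10.7.3 ⇐ `LZ2coh`; `LZ2BK` = Thm
11.7.1 ⇐ `LZ2coh` ∧ `LZ2padicL`), C233 Graham – Rockwood arXiv:2411.04559 (PREPRINT, second order: `GRetale` ⇐ `LZ2coh`, `GRpadicL` = Thms 1–3 ⇐ `GRetale`) and C234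
Paniagua-Taboada, Crelle 661 (2011) (`PTresidual` = Thms 2.8 / 3.10, premise-free; `PThecke` = Thms 4.3 / 4.4 ⇐ book; `PTpacket` = Thms 6.1 (1) / 7.1 / 7.2 ⇐ book).
Certified with ONE reading `canon₉₂W ν μ κ gt` parametrised by the value `gt` of row A4, whose edges hold for every ν, μ, κ and every tranche-1 assignment `c` with `gt =
c.GeeTaibi` (`canon_implications₉₂W`): at the top (book, Mok, KMSW at the all-ones assignments; tranche 1 read canonically) all eleven statements hold
(`ninetysecond_holds_top`, through the tranche's `ninetysecond_of_leaves`); in each of the 24 book countermodels (tranche 1 read canonically over it, every edge of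
tranches 1 / 92 valid) the five GSp_4 statements of C232 / C233 and the two conditional statements of C234 ALL FAIL while C231's three statements and C234's control HOLD
(`c92_book_cm`: every book leaf is load-bearing for C232–C234, none for C231); with row A4 DENIED at the top (`c₁noA4`, reading-level separation) the five GSp_4 statements
FAIL and C234's two book statements HOLD (`c92_A4_denied_top`: A4 is load-bearing exactly for the GSp_4 line, as typed); in the Mok countermodel of ANY leaf (book and
KMSW at the top) and with KMSW's Mok import denied (`κnoMok`) C231's three statements FAIL and the eight others HOLD (`c92_mok_cm`, `c92_kmsw_importDenied`); in KMSW's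
countermodel of each only-full leaf (the two unwritten sequels, `AubertSS`) C231's three statements HOLD — the proved scope suffices, cuspidal base change being a
generic parameter (`c92_sequel_cm`).  In one statement (`c92_regraded`): support(`RXmult1`) = support(`RXperiod`) = support(`RXpadic`) = Mok 29 ∪ KMSW's
import-and-scope (sequels NOT needed; book ∩ support = ∅); support(`LZ2coh`) = support(`LZ2padicL`) = support(`LZ2BK`) = support(`GRetale`) = support(`GRpadicL`) =
book 24 (directly and through A4); support(`PThecke`) = support(`PTpacket`) = book 24; support(`PTresidual`) = ∅; Mok ∩ support = KMSW ∩ support = ∅ for C232–C234.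

**v5 (section 96; unit `pub-arthur-down-g37`).**  The ninety-third tranche (`Downstream27.lean` v2, module M213) types NEW rows C235 Berger – Brown – Klosin
arXiv:2501.10327 (PREPRINT; `BBKeisen` = their section 7 — Lemma 7.1, Theorem 7.2, Corollaries 7.3 / 7.5, Proposition 7.4: maximality and (non-)principality of the Klingen
Eisenstein ideal of the local Hecke algebra of S_k(Sp_4(ℤ)), R ≅ 𝕋_𝔪, dim H^1_f(ℚ, ad ρ̄_φ(k−2)) > 1 — ⇐ row C180 `Consumers19.SchmidtParamodular` through an ANONYMOUS « strong
multiplicity one holds in the level one case » = Schmidt 2018 Cor. 2.8, the register's identification) and C236 Anamby – Das arXiv:2403.17401 (PREPRINT v3 2026; `ADrank` =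
Lemma 4.3 / Theorem 4.5 (4)(5) / Corollary 1.3, the rank of the inner-product matrix M_p(F), « We appeal to the classification [9] » ⇐ book ∧ row C44 `Consumers21.PaulSaha` ∧
row C182 `Consumers20.SchmidtCAP` ∧ row C49 `Consumers21.RSYCount`).  Certified with ONE reading `canon₉₃W ν c₁₉ c₂₀ c₂₁` parametrised by the assignments of tranches 19 /
20 / 21, whose edges hold for every ν and every such assignment (`canon_implications₉₃W`): at the top (book at the all-ones assignment, tranches 19 / 20 / 21 read canonically)
both statements hold (`ninetythird_holds_top`, through the tranche's `ninetythird_of_leaves`); in each of the 24 book countermodels (tranches 1 / 19 / 20 / 21 read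
canonically over it, every edge of tranches 1 / 19 / 20 / 21 / 93 valid) BOTH FAIL (`c93_book_cm`: every book leaf is load-bearing for both rows, through C180 for C235,
directly and through C44 / C182 / C49 for C236); with the conduits denied at the top (the denied readings of `DownstreamSupport2.lean`): C180 denied (`c₁₉noConduit`,
`canon₂₀free`, `canon₂₁noC180`) ⇒ both FAIL (C236 through C44, which is ⇐ C180); C182 denied (`canon₂₀noCAP`, `canon₂₁noC182`) ⇒ C235 HOLDS, C236 FAILS; C49 denied
(`canon₂₁noC49`) ⇒ C235 HOLDS, C236 FAILS (`c93_conduits_denied_top`: the conduit rows are load-bearing exactly as typed); in every Mok countermodel (KMSW = `κnoMok`) and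
every KMSW countermodel, the book at the top, BOTH HOLD (`c93_unitary_independent`: the unitary classification is not used).  In one statement (`c93_regraded`):
support(`BBKeisen`) = support(C180) = book 24; support(`ADrank`) = book 24 (directly and through C44, C182, C49); Mok ∩ support = KMSW ∩ support = ∅ for both.

**v6 (section 97; unit `pub-arthur-down-g38`, gen 38).**  The ninety-fourth tranche (NEW `Downstream28.lean` v1, module M215 — this file now also imports
`…Downstream28`) types NEW rows C237 Katsura – Yamauchi arXiv:2606.21859 (PREPRINT 2026; `KYgraph` = Theorems 4.7 / 4.9 with Proposition 4.8, the isogeny-graph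
eigenvalue bounds ⇐ row C90 `Consumers28.VanHoften` ∧ row C182 `Consumers20.SchmidtCAP`; `KYsx` = Theorem 5.1, the Sarnak – Xue type count ⇐ C90 ∧ C182 ∧ row C180
`Consumers19.SchmidtParamodular` ∧ row C112 `Consumers30.WWYY`), C238 Horawa – Prasanna, J. Eur. Math. Soc. 2025 = arXiv:2307.04115 (`HPpacket` = Lemma 2.9 with Theorem
2.12 / Corollary 2.16 « This follows from Arthur's classification » ⇐ book ∧ row A4; `HPaction` = Theorems 4.21 / 6.2 / 7.1 ⇐ `HPpacket` ∧ row C87 `Consumers29.LPSZ` ∧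
row C192 `Consumers31.LZBlochKato`) and C239 Pilloni, Duke Math. J. 169 (2020) (`VPhida` = Theorem 1.1, premise-free; `VPeuler` = Theorem 1.2 = 15.2.1 « We use here
Arthur's classification for GSp_4 as announced in [1] » ⇐ `VPhida` ∧ book ∧ A4).  Certified with ONE reading `canon₉₄W ν c c₁₉ c₂₀ c₂₈ c₂₉ c₃₀ c₃₁` parametrised by the
assignments of tranches 1 / 19 / 20 / 28 / 29 / 30 / 31, whose edges hold for every ν and every such assignment (`canon_implications₉₄W`), and its canonical instance
`canon₉₄ ν μ κ` (`canon_implications₉₄`): at the top all six statements hold (`ninetyfourth_holds_top`, through the tranche's `ninetyfourth_of_leaves`); in each of the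
24 book countermodels (tranches 1 / 19 / 20 / 28 / 29 / 30 / 31 / 94 read canonically over it, ALL their edges valid) the five dependent statements FAIL and the control
`VPhida` HOLDS (`c94_book_cm`: every book leaf is load-bearing — through C90 / C182 / C180 / C112 for C237, by name and through A4 / C87 / C192 for C238, by name and
through A4 for C239); with one conduit denied at the top (`c94_conduits_denied_top`): C90 denied (`c₂₈noC90`) ⇒ both C237 statements FAIL, C238 / C239 HOLD; C182 denied
(`canon₂₀noCAP`, `canon₃₀noC182`) ⇒ both C237 statements FAIL; C180 denied (`c₁₉noConduit`, `canon₂₀free`, `canon₃₀noC180`) ⇒ `KYgraph` HOLDS, `KYsx` FAILS; C112 alone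
denied (`c₃₀noC112`) ⇒ `KYgraph` HOLDS, `KYsx` FAILS; C87 denied (`canon₂₉noC87`, `canon₃₁no`) ⇒ `HPpacket` HOLDS, `HPaction` FAILS, C237 / C239 HOLD; A4 denied (`c₁noA4`
of section 95) ⇒ `HPpacket`, `HPaction`, `VPeuler` FAIL (C237's A4-dependence runs inside C90's own reading, section 29); in every Mok countermodel (KMSW = `κnoMok`) and
every KMSW countermodel, the book at the top, ALL SIX HOLD (`c94_unitary_independent`).  In one statement (`c94_regraded`): support(`KYgraph`) = support(`KYsx`) =
support(`HPpacket`) = support(`HPaction`) = support(`VPeuler`) = book 24 (through the conduits named); support(`VPhida`) = ∅; Mok ∩ support = KMSW ∩ support = ∅.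

**v7 (section 98; unit `pub-arthur-down-g38`, gen 38).**  The ninety-fifth tranche (`Downstream28.lean` v2) types NEW row C240 Loeffler – Skinner – Zerbes,
*Euler systems for GSp(4)*, J. Eur. Math. Soc. 24 (2022) = arXiv:1706.00201 (`LSZ4galois` = Theorem 10.1.3 « (Taylor, Weissauer, Urban, Xu) », whose proof ends « Finally,
Xu has shown in [xu18] that the common multiplicity of Π^H and Π^W is equal to 1 » ⇐ row A7 `Consumers.XuGSp`; `LSZ4euler` = Theorem 10.5.5 / Proposition 10.5.6 (v2
numbering), Theorem 11.2.3, Corollary 11.2.4, Theorem 11.3.2 ⇐ `LSZ4galois`).  Certified with ONE reading `canon₉₅W c` parametrised by the assignment of tranche 1 (both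
statements := `c.XuGSp`), whose edges hold for every such assignment (`canon_implications₉₅W`), and its canonical instance `canon₉₅ ν μ κ` (`canon_implications₉₅`): at
the top both statements hold (`ninetyfifth_holds_top`, through the tranche's `ninetyfifth_of_leaves`); in each of the 24 book countermodels (tranches 1 / 95 read
canonically over it, all their edges valid) BOTH FAIL (`c95_book_cm`: every book leaf is load-bearing, through A7); at the top with row A7 denied (`c₁noA7`) both FAIL
while row C238's `HPpacket` (typed in section 97 ⇐ book ∧ A4, as Horawa – Prasanna print it) HOLDS, and with row A4 denied (`c₁noA4` of section 95) both C240 statements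
HOLD while `HPpacket` FAILS (`c95_A7_denied_top`) — the register's two routes to the multiplicity-one clause, LSZ ⇐ Xu and HP ⇐ Gee – Taïbi, separate at the reading
level; in every Mok countermodel (KMSW = `κnoMok`) and every KMSW countermodel, the book at the top, BOTH HOLD (`c95_unitary_independent`).  In one statement
(`c95_regraded`): support(`LSZ4galois`) = support(`LSZ4euler`) = book 24 (through A7); Mok ∩ support = KMSW ∩ support = ∅.

**Deliberately not here.**  Any claim about the content or truth of a downstream statement; no new named fact (every
canonical value is written out); no Mathlib, no `axiom`, no `sorry`, no `opaque`.
-/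

set_option autoImplicit false

namespace Literature.NumberTheory.Automorphic.Arthur2013

namespace Downstream

namespace Support
/-! ## 92. Eighty-ninth tranche (v1 of this file, after `Downstream25.lean` v2; unit `pub-arthur-down-g35`): supports of THE CITATION GRAPH, III — row C226 `FMggp1`
(premise-free) / `FM154gen` (node, two suppliers) / `FMggp2` / `FMrefined` / `FMbocherer` / `FMliu`, row C227 `ShanTheta` (premise-free); see the module docstring for the
summary. -/

section Canon89

variable (ν : Nodes) (μ : Mok2015.Nodes)

/-- The parametrised canonical reading of the eighty-ninth tranche: the tranche-1 / 8 / 34 assignments `c`, `c₈`, `c₃₄` are the parameters; the node := `c₈.InnerTwists ∨ (book ∧ c.IshimotoGeneric)` (the disjunction of its two suppliers), Theorem 1.1 (2) := the node's value, Theorem 1.2 := Mok ∧ C67 ∧ C24, Theorems 1.4 / 8.1 := book ∧ that, Remark 1.5 := node ∧ Theorem 1.2, the two controls := True. [cite: FurusawaMorimoto2024SO5, Thms 1.1, 1.2, 1.4, 8.1, Rem. 1.5; Shan2025ThetaF4, Thm 2 (canonical model; bookkeeping)] -/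
abbrev canon₈₉W (c : Consumers) (c₈ : Consumers8) (c₃₄ : Consumers34) : Consumers89 where
  FMggp1 := True
  FM154gen := c₈.InnerTwists ∨ ((∀ N, ν.Everything N) ∧ c.IshimotoGeneric)
  FMggp2 := c₈.InnerTwists ∨ ((∀ N, ν.Everything N) ∧ c.IshimotoGeneric)
  FMrefined := (∀ N, μ.Everything N) ∧ c₃₄.FurusawaMorimoto ∧ c₃₄.BPlocalGGP
  FMbocherer := (∀ N, ν.Everything N) ∧ ((∀ N, μ.Everything N) ∧ c₃₄.FurusawaMorimoto ∧ c₃₄.BPlocalGGP)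
  FMliu := (c₈.InnerTwists ∨ ((∀ N, ν.Everything N) ∧ c.IshimotoGeneric)) ∧ ((∀ N, μ.Everything N) ∧ c₃₄.FurusawaMorimoto ∧ c₃₄.BPlocalGGP)
  ShanTheta := True

/-- Every eighty-ninth-tranche edge holds in the parametrised reading, for arbitrary ν, μ and EVERY assignment of tranches 1 / 8 / 34 — in particular BOTH suppliers of the node. [cite: FurusawaMorimoto2024SO5, Thms 1.1, 1.2, 1.4, 8.1, Rem. 1.5; Shan2025ThetaF4, Thm 2 (bookkeeping proved here)] -/
theorem canon_implications₈₉W (c : Consumers) (c₈ : Consumers8) (c₃₄ : Consumers34) : Implications89 ν μ c c₈ c₃₄ (canon₈₉W ν μ c c₈ c₃₄) where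
  fm1 := True.intro
  fm154ch9 := fun h => Or.inl h
  fm154ish := fun b i => Or.inr ⟨b, i⟩
  fm2 := fun h => h
  fmRefined := fun m f p => ⟨m, f, p⟩
  fmBocherer := fun b r => ⟨b, r⟩
  fmLiu := fun n r => ⟨n, r⟩
  shan := True.intro

/-- In the parametrised reading all seven statements hold as soon as the book's and Mok's outputs hold at all ranks and rows A5, C67, C24 hold — through the tranche's
bookkeeping theorems `fm2_of_book_and_A5`, `fmRefined_of_rows`, `fmBocherer_of_book_and_refined`, `fm1_inherits_nothing`, `shan_inherits_nothing`; the Chapter-9 leaf is not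
among the hypotheses. [cite: FurusawaMorimoto2024SO5, Rem. 1.5; Shan2025ThetaF4, Thm 2 (bookkeeping proved here)] -/
theorem c89_all_of (c : Consumers) (c₈ : Consumers8) (c₃₄ : Consumers34) (hν : ∀ N, ν.Everything N) (h₅ : c.IshimotoGeneric) (hμ : ∀ N, μ.Everything N)
    (h₆₇ : c₃₄.FurusawaMorimoto) (h₂₄ : c₃₄.BPlocalGGP) : ((canon₈₉W ν μ c c₈ c₃₄).FMggp1 ∧ (canon₈₉W ν μ c c₈ c₃₄).FM154gen ∧ (canon₈₉W ν μ c c₈ c₃₄).FMggp2 ∧ (canon₈₉W ν μ c c₈ c₃₄).FMrefined ∧ (canon₈₉W ν μ c c₈ c₃₄).FMbocherer ∧ (canon₈₉W ν μ c c₈ c₃₄).FMliu ∧ (canon₈₉W ν μ c c₈ c₃₄).ShanTheta) :=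
  have X := canon_implications₈₉W ν μ c c₈ c₃₄
  have h2 := fm2_of_book_and_A5 X hν h₅
  have hR := fmRefined_of_rows X hμ h₆₇ h₂₄
  ⟨fm1_inherits_nothing X, h2.1, h2.2, hR, fmBocherer_of_book_and_refined X hν hR, X.fmLiu h2.1 hR, shan_inherits_nothing X⟩

end Canon89

/-- Row A5 DENIED (`IshimotoGeneric := False`; the other tranche-1 fields as in `canon` at the top): a reading of `Consumers` used only to deny the node's second supplier; no first-tranche edge is claimed for it. [cite: Ishimoto2024, Thm 1.2 (separating model; bookkeeping)] -/
abbrev c₁noA5 : Consumers := { canon νtop μtop κtop with IshimotoGeneric := False }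

/-- At the top (every input of the three DAGs; tranches 1 / 34 read canonically) WITH THE CHAPTER-9 LEAF DENIED (`canon₈no`: the unwritten [A28] not granted) all seven
statements of the tranche hold — Furusawa – Morimoto's assumption (1.5.4), as used, comes from the book and row A5. [cite: FurusawaMorimoto2024SO5, Rem. 1.5 (p0008:L53-58) (bookkeeping proved here)] -/
theorem eightyninth_holds_top : ((canon₈₉W νtop μtop (canon νtop μtop κtop) (canon₈no νtop μtop) (canon₃₄ μtop κtop)).FMggp1 ∧ (canon₈₉W νtop μtop (canon νtop μtop κtop) (canon₈no νtop μtop) (canon₃₄ μtop κtop)).FM154gen ∧ (canon₈₉W νtop μtop (canon νtop μtop κtop) (canon₈no νtop μtop) (canon₃₄ μtop κtop)).FMggp2 ∧ (canon₈₉W νtop μtop (canon νtop μtop κtop) (canon₈no νtop μtop) (canon₃₄ μtop κtop)).FMrefined ∧ (canon₈₉W νtop μtop (canon νtop μtop κtop) (canon₈no νtop μtop) (canon₃₄ μtop κtop)).FMbocherer ∧ (canon₈₉W νtop μtop (canon νtop μtop κtop) (canon₈no νtop μtop) (canon₃₄ μtop κtop)).FMliu ∧ (canon₈₉W νtop μtop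 (canon νtop μtop κtop) (canon₈no νtop μtop) (canon₃₄ μtop κtop)).ShanTheta) :=
  have b : ∀ N, νtop.Everything N := bookInputs_top.everything
  have m : ∀ N, μtop.Everything N := mokInputs_top.everything
  have s : ∀ N, κtop.Scope N := (kmswInputs_top μtop).1.scope mokInputs_top
  c89_all_of νtop μtop (canon νtop μtop κtop) (canon₈no νtop μtop) (canon₃₄ μtop κtop) b b m ⟨m, s, ⟨m, s⟩⟩ ⟨m, s⟩

/-- THE NODE's TWO SUPPLIERS ARE EACH SUFFICIENT AND JOINTLY NECESSARY, AS TYPED: at the top (a) with row A5 DENIED (`c₁noA5`) AND the Chapter-9 leaf denied every edge holds,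
the node, Theorem 1.1 (2) and Remark 1.5 FAIL, while Theorems 1.2, 1.4 / 8.1 and the controls HOLD; (b) with A5 denied but the Chapter-9 leaf GRANTED (`canon₈`, the reading
as printed) every edge holds and the node, Theorem 1.1 (2) and Remark 1.5 HOLD. [cite: FurusawaMorimoto2024SO5, (1.5.4) (p0006:L6-9), Rem. 1.5 (separating models; bookkeeping proved here)] -/
theorem c89_node_denied_top :
    (Implications89 νtop μtop c₁noA5 (canon₈no νtop μtop) (canon₃₄ μtop κtop) (canon₈₉W νtop μtop c₁noA5 (canon₈no νtop μtop) (canon₃₄ μtop κtop)) ∧ (¬ (canon₈₉W νtop μtop c₁noA5 (canon₈no νtop μtop) (canon₃₄ μtop κtop)).FM154gen ∧ ¬ (canon₈₉W νtop μtop c₁noA5 (canon₈no νtop μtop) (canon₃₄ μtop κtop)).FMggp2 ∧ ¬ (canon₈₉W νtop μtop c₁noA5 (canon₈no νtop μtop) (canon₃₄ μtop κtop)).FMliu) ∧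
      ((canon₈₉W νtop μtop c₁noA5 (canon₈no νtop μtop) (canon₃₄ μtop κtop)).FMrefined ∧ (canon₈₉W νtop μtop c₁noA5 (canon₈no νtop μtop) (canon₃₄ μtop κtop)).FMbocherer ∧ (canon₈₉W νtop μtop c₁noA5 (canon₈no νtop μtop) (canon₃₄ μtop κtop)).FMggp1 ∧ (canon₈₉W νtop μtop c₁noA5 (canon₈no νtop μtop) (canon₃₄ μtop κtop)).ShanTheta)) ∧
      (Implications89 νtop μtop c₁noA5 (canon₈ νtop μtop κtop) (canon₃₄ μtop κtop) (canon₈₉W νtop μtop c₁noA5 (canon₈ νtop μtop κtop) (canon₃₄ μtop κtop)) ∧ (canon₈₉W νtop μtop c₁noA5 (canon₈ νtop μtop κtop) (canon₃₄ μtop κtop)).FM154gen ∧ (canon₈₉W νtop μtop c₁noA5 (canon₈ νtop μtop κtop) (canon₃₄ μtop κtop)).FMggp2 ∧ (canon₈₉W νtop μtop c₁noA5 (canon₈ νtop μtop κtop) (canon₃₄ μtop κtop)).FMliu) :=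
  have b : ∀ N, νtop.Everything N := bookInputs_top.everything
  have m : ∀ N, μtop.Everything N := mokInputs_top.everything
  have s : ∀ N, κtop.Scope N := (kmswInputs_top μtop).1.scope mokInputs_top
  have nn : ¬ (False ∨ ((∀ N, νtop.Everything N) ∧ False)) := fun h => h.elim (fun x => x) (fun y => y.2)
  have r : (∀ N, μtop.Everything N) ∧ (canon₃₄ μtop κtop).FurusawaMorimoto ∧ (canon₃₄ μtop κtop).BPlocalGGP := ⟨m, ⟨m, s, ⟨m, s⟩⟩, ⟨m, s⟩⟩
  ⟨⟨canon_implications₈₉W _ _ _ _ _, ⟨nn, nn, fun h => nn h.1⟩, ⟨r, ⟨b, r⟩, True.intro, True.intro⟩⟩,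
    ⟨canon_implications₈₉W _ _ _ _ _, Or.inl True.intro, Or.inl True.intro, ⟨Or.inl True.intro, r⟩⟩⟩

/-- ROWS C24 / C67 ARE LOAD-BEARING FOR THEOREM 1.2, AS TYPED: at the top with row C24 DENIED (§37's `canon₃₄noC24`, which denies C67 with it; Chapter-9 leaf denied, A5 granted)
every edge holds, Theorem 1.2, Theorems 1.4 / 8.1 and Remark 1.5 FAIL, Theorem 1.1 (2) and the controls HOLD. [cite: FurusawaMorimoto2024SO5, §7 (p0071:L17-24) (separating model; bookkeeping proved here)] -/
theorem c89_rows_denied_top :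
    Implications89 νtop μtop (canon νtop μtop κtop) (canon₈no νtop μtop) (canon₃₄noC24 μtop κtop) (canon₈₉W νtop μtop (canon νtop μtop κtop) (canon₈no νtop μtop) (canon₃₄noC24 μtop κtop)) ∧ (¬ (canon₈₉W νtop μtop (canon νtop μtop κtop) (canon₈no νtop μtop) (canon₃₄noC24 μtop κtop)).FMrefined ∧ ¬ (canon₈₉W νtop μtop (canon νtop μtop κtop) (canon₈no νtop μtop) (canon₃₄noC24 μtop κtop)).FMbocherer ∧ ¬ (canon₈₉W νtop μtop (canon νtop μtop κtop) (canon₈no νtop μtop) (canon₃₄noC24 μtop κtop)).FMliu) ∧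
      ((canon₈₉W νtop μtop (canon νtop μtop κtop) (canon₈no νtop μtop) (canon₃₄noC24 μtop κtop)).FMggp2 ∧ (canon₈₉W νtop μtop (canon νtop μtop κtop) (canon₈no νtop μtop) (canon₃₄noC24 μtop κtop)).FMggp1 ∧ (canon₈₉W νtop μtop (canon νtop μtop κtop) (canon₈no νtop μtop) (canon₃₄noC24 μtop κtop)).ShanTheta) :=
  have b : ∀ N, νtop.Everything N := bookInputs_top.everything
  ⟨canon_implications₈₉W _ _ _ _ _, ⟨fun h => h.2.2, fun h => h.2.2.2, fun h => h.2.2.2⟩, ⟨Or.inr ⟨b, b⟩, True.intro, True.intro⟩⟩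

/-- BOOK SIDE, EXACT SUPPORT AS TYPED: in the book countermodel of ANY leaf `l` (Mok and KMSW at the top; tranches 1 / 34 read canonically over the countermodel) every edge
is valid and (a) with the Chapter-9 leaf DENIED the node, Theorem 1.1 (2), Theorems 1.4 / 8.1 and Remark 1.5 FAIL while Theorem 1.2 and the controls HOLD; (b) with the
Chapter-9 leaf GRANTED Theorem 1.1 (2) and Remark 1.5 HOLD (as printed they rest on [A28], not on the book's leaves) while Theorems 1.4 / 8.1 still FAIL. [cite: FurusawaMorimoto2024SO5, Rem. 1.5, Rem. 8.5 (p0077:L54-55) (bookkeeping proved here)] -/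
theorem c89_book_cm (l : LeafSupport.Leaf) :
    (∀ l', l' ≠ l → (LeafSupport.mkN (LeafSupport.cm l)).leaf l') ∧ ¬ (LeafSupport.mkN (LeafSupport.cm l)).leaf l ∧
      (Implications89 (LeafSupport.mkN (LeafSupport.cm l)) μtop (canon (LeafSupport.mkN (LeafSupport.cm l)) μtop κtop) (canon₈no (LeafSupport.mkN (LeafSupport.cm l)) μtop) (canon₃₄ μtop κtop) (canon₈₉W (LeafSupport.mkN (LeafSupport.cm l)) μtop (canon (LeafSupport.mkN (LeafSupport.cm l)) μtop κtop) (canon₈no (LeafSupport.mkN (LeafSupport.cm l)) μtop) (canon₃₄ μtop κtop)) ∧ (¬ (canon₈₉W (LeafSupport.mkN (LeafSupport.cm l)) μtop (canon (LeafSupport.mkN (LeafSupport.cm l)) μtop κtop) (canon₈no (LeafSupport.mkN (LeafSupport.cm l)) μtop) (canon₃₄ μtop κtop)).FM154gen ∧ ¬ (canon₈₉W (LeafSupport.mkN (LeafSupport.cm l)) μtop (canon (LeafSupport.mkN (LeafSupport.cm l)) μtop κtop) (canon₈no (LeafSupport.mkN (LeafSupport.cm l)) μtop) (canon₃₄ μtop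 κtop)).FMggp2 ∧ ¬ (canon₈₉W (LeafSupport.mkN (LeafSupport.cm l)) μtop (canon (LeafSupport.mkN (LeafSupport.cm l)) μtop κtop) (canon₈no (LeafSupport.mkN (LeafSupport.cm l)) μtop) (canon₃₄ μtop κtop)).FMbocherer ∧ ¬ (canon₈₉W (LeafSupport.mkN (LeafSupport.cm l)) μtop (canon (LeafSupport.mkN (LeafSupport.cm l)) μtop κtop) (canon₈no (LeafSupport.mkN (LeafSupport.cm l)) μtop) (canon₃₄ μtop κtop)).FMliu) ∧
        ((canon₈₉W (LeafSupport.mkN (LeafSupport.cm l)) μtop (canon (LeafSupport.mkN (LeafSupport.cm l)) μtop κtop) (canon₈no (LeafSupport.mkN (LeafSupport.cm l)) μtop) (canon₃₄ μtop κtop)).FMrefined ∧ (canon₈₉W (LeafSupport.mkN (LeafSupport.cm l)) μtop (canon (LeafSupport.mkN (LeafSupport.cm l)) μtop κtop) (canon₈no (LeafSupport.mkN (LeafSupport.cm l)) μtop) (canon₃₄ μtop κtop)).FMggp1 ∧ (canon₈₉W (LeafSupport.mkN (LeafSupport.cm l)) μtop (canon (LeafSupport.mkN (LeafSupport.cm l))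 μtop κtop) (canon₈no (LeafSupport.mkN (LeafSupport.cm l)) μtop) (canon₃₄ μtop κtop)).ShanTheta)) ∧
      (Implications89 (LeafSupport.mkN (LeafSupport.cm l)) μtop (canon (LeafSupport.mkN (LeafSupport.cm l)) μtop κtop) (canon₈ (LeafSupport.mkN (LeafSupport.cm l)) μtop κtop) (canon₃₄ μtop κtop) (canon₈₉W (LeafSupport.mkN (LeafSupport.cm l)) μtop (canon (LeafSupport.mkN (LeafSupport.cm l)) μtop κtop) (canon₈ (LeafSupport.mkN (LeafSupport.cm l)) μtop κtop) (canon₃₄ μtop κtop)) ∧ (canon₈₉W (LeafSupport.mkN (LeafSupport.cm l)) μtop (canon (LeafSupport.mkN (LeafSupport.cm l)) μtop κtop) (canon₈ (LeafSupport.mkN (LeafSupport.cm l)) μtop κtop) (canon₃₄ μtop κtop)).FMggp2 ∧ (canon₈₉W (LeafSupport.mkN (LeafSupport.cm l)) μtop (canon (LeafSupport.mkN (LeafSupport.cm l)) μtop κtop) (canon₈ (LeafSupport.mkN (LeafSupport.cm l)) μtop κtop) (canon₃₄ μtop κtop)).FMliu ∧ ¬ (canon₈₉W (LeafSupport.mkN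 (LeafSupport.cm l)) μtop (canon (LeafSupport.mkN (LeafSupport.cm l)) μtop κtop) (canon₈ (LeafSupport.mkN (LeafSupport.cm l)) μtop κtop) (canon₃₄ μtop κtop)).FMbocherer) :=
  have cmod := LeafSupport.countermodel l
  have nb := not_B_cm l
  have m : ∀ N, μtop.Everything N := mokInputs_top.everything
  have s : ∀ N, κtop.Scope N := (kmswInputs_top μtop).1.scope mokInputs_top
  have r : (∀ N, μtop.Everything N) ∧ (canon₃₄ μtop κtop).FurusawaMorimoto ∧ (canon₃₄ μtop κtop).BPlocalGGP := ⟨m, ⟨m, s, ⟨m, s⟩⟩, ⟨m, s⟩⟩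
  have nn : ¬ (False ∨ ((∀ N, (LeafSupport.mkN (LeafSupport.cm l)).Everything N) ∧ (canon (LeafSupport.mkN (LeafSupport.cm l)) μtop κtop).IshimotoGeneric)) := fun h => h.elim (fun x => x) (fun y => nb y.1)
  ⟨cmod.2.1, cmod.2.2.1,
    ⟨canon_implications₈₉W _ _ _ _ _, ⟨nn, nn, fun h => nb h.1, fun h => nn h.1⟩, ⟨r, True.intro, True.intro⟩⟩,
    ⟨canon_implications₈₉W _ _ _ _ _, Or.inl True.intro, ⟨Or.inl True.intro, r⟩, fun h => nb h.1⟩⟩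

/-- MOK SIDE: in the Mok countermodel of ANY leaf `l` (book and KMSW at the top; tranches 1 / 34 read over it; Chapter-9 leaf denied) every edge holds, Theorem 1.2, Theorems
1.4 / 8.1 and Remark 1.5 FAIL (« by Mok [82] », and C67 / C24), Theorem 1.1 (2) and the controls HOLD. [cite: FurusawaMorimoto2024SO5, §7 (p0071:L24); Mok2012, Thm 2.5.2 (bookkeeping proved here)] -/
theorem c89_mok_cm (l : Mok2015.LeafSupport.Leaf) :
    ¬ (Mok2015.LeafSupport.mkN (Mok2015.LeafSupport.cm l)).leaf l ∧ Implications89 νtop (Mok2015.LeafSupport.mkN (Mok2015.LeafSupport.cm l)) (canon νtop (Mok2015.LeafSupport.mkN (Mok2015.LeafSupport.cm l)) κtop) (canon₈no νtop (Mok2015.LeafSupport.mkN (Mok2015.LeafSupport.cm l))) (canon₃₄ (Mok2015.LeafSupport.mkN (Mok2015.LeafSupport.cm l)) κtop) (canon₈₉W νtop (Mok2015.LeafSupport.mkN (Mok2015.LeafSupport.cm l)) (canon νtop (Mok2015.LeafSupport.mkN (Mok2015.LeafSupport.cm l)) κtop) (canon₈no νtop (Mok2015.LeafSupport.mkN (Mok2015.LeafSupport.cm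 l))) (canon₃₄ (Mok2015.LeafSupport.mkN (Mok2015.LeafSupport.cm l)) κtop)) ∧
      (¬ (canon₈₉W νtop (Mok2015.LeafSupport.mkN (Mok2015.LeafSupport.cm l)) (canon νtop (Mok2015.LeafSupport.mkN (Mok2015.LeafSupport.cm l)) κtop) (canon₈no νtop (Mok2015.LeafSupport.mkN (Mok2015.LeafSupport.cm l))) (canon₃₄ (Mok2015.LeafSupport.mkN (Mok2015.LeafSupport.cm l)) κtop)).FMrefined ∧ ¬ (canon₈₉W νtop (Mok2015.LeafSupport.mkN (Mok2015.LeafSupport.cm l)) (canon νtop (Mok2015.LeafSupport.mkN (Mok2015.LeafSupport.cm l)) κtop) (canon₈no νtop (Mok2015.LeafSupport.mkN (Mok2015.LeafSupport.cm l))) (canon₃₄ (Mok2015.LeafSupport.mkN (Mok2015.LeafSupport.cm l)) κtop)).FMbocherer ∧ ¬ (canon₈₉W νtop (Mok2015.LeafSupport.mkN (Mok2015.LeafSupport.cm l)) (canon νtop (Mok2015.LeafSupport.mkN (Mok2015.LeafSupport.cm l)) κtop) (canon₈no νtop (Mok2015.LeafSupport.mkN (Mok2015.LeafSupport.cm l)))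 (canon₃₄ (Mok2015.LeafSupport.mkN (Mok2015.LeafSupport.cm l)) κtop)).FMliu) ∧ ((canon₈₉W νtop (Mok2015.LeafSupport.mkN (Mok2015.LeafSupport.cm l)) (canon νtop (Mok2015.LeafSupport.mkN (Mok2015.LeafSupport.cm l)) κtop) (canon₈no νtop (Mok2015.LeafSupport.mkN (Mok2015.LeafSupport.cm l))) (canon₃₄ (Mok2015.LeafSupport.mkN (Mok2015.LeafSupport.cm l)) κtop)).FMggp2 ∧ (canon₈₉W νtop (Mok2015.LeafSupport.mkN (Mok2015.LeafSupport.cm l)) (canon νtop (Mok2015.LeafSupport.mkN (Mok2015.LeafSupport.cm l)) κtop) (canon₈no νtop (Mok2015.LeafSupport.mkN (Mok2015.LeafSupport.cm l))) (canon₃₄ (Mok2015.LeafSupport.mkN (Mok2015.LeafSupport.cm l)) κtop)).FMggp1 ∧ (canon₈₉W νtop (Mok2015.LeafSupport.mkN (Mok2015.LeafSupport.cm l)) (canon νtop (Mok2015.LeafSupport.mkN (Mok2015.LeafSupport.cm l)) κtop) (canon₈no νtop (Mok2015.LeafSupport.mkN (Mok2015.LeafSupport.cm l))) (canon₃₄ (Mok2015.LeafSupport.mkN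 (Mok2015.LeafSupport.cm l)) κtop)).ShanTheta) :=
  have cmod := Mok2015.LeafSupport.countermodel l
  have nm := not_M_cm l
  have b : ∀ N, νtop.Everything N := bookInputs_top.everything
  ⟨cmod.2.2.1, canon_implications₈₉W _ _ _ _ _, ⟨fun h => nm h.1, fun h => nm h.2.1, fun h => nm h.2.1⟩, ⟨Or.inr ⟨b, b⟩, True.intro, True.intro⟩⟩

/-- KMSW SIDE: with the book and Mok at the top and KMSW's Mok import DENIED (`κnoMok`: KMSW's proved scope fails at every rank) every edge holds, Theorem 1.2, Theorems 1.4 /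
8.1 and Remark 1.5 FAIL — through rows C67 / C24, which read the unitary classifications « [KMSW, Mok] » — while Theorem 1.1 (2) and the controls HOLD. [cite: FurusawaMorimoto2024SO5, §7 (p0071:L17-24); FurusawaMorimoto2024, §1.2; BeuzartPlessis2020Asterisque, Thm 1 (bookkeeping proved here)] [claim: KalethaMinguezShinWhite2014, under-review] -/
theorem c89_kmsw_importDenied :
    (∀ N, ¬ κnoMok.Scope N) ∧ Implications89 νtop μtop (canon νtop μtop κnoMok) (canon₈no νtop μtop) (canon₃₄ μtop κnoMok) (canon₈₉W νtop μtop (canon νtop μtop κnoMok) (canon₈no νtop μtop) (canon₃₄ μtop κnoMok)) ∧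
      (¬ (canon₈₉W νtop μtop (canon νtop μtop κnoMok) (canon₈no νtop μtop) (canon₃₄ μtop κnoMok)).FMrefined ∧ ¬ (canon₈₉W νtop μtop (canon νtop μtop κnoMok) (canon₈no νtop μtop) (canon₃₄ μtop κnoMok)).FMbocherer ∧ ¬ (canon₈₉W νtop μtop (canon νtop μtop κnoMok) (canon₈no νtop μtop) (canon₃₄ μtop κnoMok)).FMliu) ∧ ((canon₈₉W νtop μtop (canon νtop μtop κnoMok) (canon₈no νtop μtop) (canon₃₄ μtop κnoMok)).FMggp2 ∧ (canon₈₉W νtop μtop (canon νtop μtop κnoMok) (canon₈no νtop μtop) (canon₃₄ μtop κnoMok)).FMggp1 ∧ (canon₈₉W νtop μtop (canon νtop μtop κnoMok) (canon₈no νtop μtop) (canon₃₄ μtop κnoMok)).ShanTheta) :=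
  have ns : ∀ N, ¬ κnoMok.Scope N := κnoMok_facts.2.2.2.2.2.1
  have b : ∀ N, νtop.Everything N := bookInputs_top.everything
  ⟨ns, canon_implications₈₉W _ _ _ _ _, ⟨fun h => ns 0 (h.2.2.2 0), fun h => ns 0 (h.2.2.2.2 0), fun h => ns 0 (h.2.2.2.2 0)⟩, ⟨Or.inr ⟨b, b⟩, True.intro, True.intro⟩⟩

/-- THE EIGHTY-NINTH TRANCHE REGRADED, in one statement: (i) at the top with the Chapter-9 leaf denied all seven hold; (ii) A5 denied as well: Theorem 1.1 (2) fails —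
and holds again with the Chapter-9 leaf granted; (iii) C24 / C67 denied: Theorem 1.2 and Theorems 1.4 / 8.1 fail, Theorem 1.1 (2) holds; (iv) in the book countermodel of any
leaf Theorems 1.4 / 8.1 fail and Theorem 1.2 holds, Theorem 1.1 (2) failing without and holding with the Chapter-9 leaf; (v) in the Mok countermodel of any leaf and (vi)
with KMSW's Mok import denied Theorem 1.2 and Theorems 1.4 / 8.1 fail while Theorem 1.1 (2) holds; the controls hold throughout. [cite: FurusawaMorimoto2024SO5, Thms 1.1, 1.2, 1.4, 8.1, Rem. 1.5; Shan2025ThetaF4, Thm 2 (bookkeeping proved here)] [claim: KalethaMinguezShinWhite2014, under-review] -/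
theorem c89_regraded :
    ((canon₈₉W νtop μtop (canon νtop μtop κtop) (canon₈no νtop μtop) (canon₃₄ μtop κtop)).FMggp1 ∧ (canon₈₉W νtop μtop (canon νtop μtop κtop) (canon₈no νtop μtop) (canon₃₄ μtop κtop)).FM154gen ∧ (canon₈₉W νtop μtop (canon νtop μtop κtop) (canon₈no νtop μtop) (canon₃₄ μtop κtop)).FMggp2 ∧ (canon₈₉W νtop μtop (canon νtop μtop κtop) (canon₈no νtop μtop) (canon₃₄ μtop κtop)).FMrefined ∧ (canon₈₉W νtop μtop (canon νtop μtop κtop) (canon₈no νtop μtop) (canon₃₄ μtop κtop)).FMbocherer ∧ (canon₈₉W νtop μtop (canon νtop μtop κtop) (canon₈no νtop μtop) (canon₃₄ μtop κtop)).FMliu ∧ (canon₈₉W νtop μtop (canon νtop μtop κtop) (canon₈no νtop μtop) (canon₃₄ μtop κtop)).ShanTheta) ∧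
      (¬ (canon₈₉W νtop μtop c₁noA5 (canon₈no νtop μtop) (canon₃₄ μtop κtop)).FMggp2 ∧ (canon₈₉W νtop μtop c₁noA5 (canon₈no νtop μtop) (canon₃₄ μtop κtop)).FMrefined ∧ (canon₈₉W νtop μtop c₁noA5 (canon₈no νtop μtop) (canon₃₄ μtop κtop)).FMbocherer ∧ (canon₈₉W νtop μtop c₁noA5 (canon₈ νtop μtop κtop) (canon₃₄ μtop κtop)).FMggp2) ∧
      (¬ (canon₈₉W νtop μtop (canon νtop μtop κtop) (canon₈no νtop μtop) (canon₃₄noC24 μtop κtop)).FMrefined ∧ ¬ (canon₈₉W νtop μtop (canon νtop μtop κtop) (canon₈no νtop μtop) (canon₃₄noC24 μtop κtop)).FMbocherer ∧ (canon₈₉W νtop μtop (canon νtop μtop κtop) (canon₈no νtop μtop) (canon₃₄noC24 μtop κtop)).FMggp2) ∧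
      (∀ l : LeafSupport.Leaf, (¬ (LeafSupport.mkN (LeafSupport.cm l)).leaf l) ∧ ¬ (canon₈₉W (LeafSupport.mkN (LeafSupport.cm l)) μtop (canon (LeafSupport.mkN (LeafSupport.cm l)) μtop κtop) (canon₈no (LeafSupport.mkN (LeafSupport.cm l)) μtop) (canon₃₄ μtop κtop)).FMggp2 ∧ ¬ (canon₈₉W (LeafSupport.mkN (LeafSupport.cm l)) μtop (canon (LeafSupport.mkN (LeafSupport.cm l)) μtop κtop) (canon₈no (LeafSupport.mkN (LeafSupport.cm l)) μtop) (canon₃₄ μtop κtop)).FMbocherer ∧ (canon₈₉W (LeafSupport.mkN (LeafSupport.cm l)) μtop (canon (LeafSupport.mkN (LeafSupport.cm l)) μtop κtop) (canon₈no (LeafSupport.mkN (LeafSupport.cm l)) μtop) (canon₃₄ μtop κtop)).FMrefined ∧ (canon₈₉W (LeafSupport.mkN (LeafSupport.cm l)) μtop (canon (LeafSupport.mkN (LeafSupport.cm l)) μtop κtop) (canon₈ (LeafSupport.mkN (LeafSupport.cm l)) μtop κtop) (canon₃₄ μtop κtop)).FMggp2 ∧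
        ¬ (canon₈₉W (LeafSupport.mkN (LeafSupport.cm l)) μtop (canon (LeafSupport.mkN (LeafSupport.cm l)) μtop κtop) (canon₈ (LeafSupport.mkN (LeafSupport.cm l)) μtop κtop) (canon₃₄ μtop κtop)).FMbocherer) ∧
      (∀ l : Mok2015.LeafSupport.Leaf, (¬ (Mok2015.LeafSupport.mkN (Mok2015.LeafSupport.cm l)).leaf l) ∧ ¬ (canon₈₉W νtop (Mok2015.LeafSupport.mkN (Mok2015.LeafSupport.cm l)) (canon νtop (Mok2015.LeafSupport.mkN (Mok2015.LeafSupport.cm l)) κtop) (canon₈no νtop (Mok2015.LeafSupport.mkN (Mok2015.LeafSupport.cm l))) (canon₃₄ (Mok2015.LeafSupport.mkN (Mok2015.LeafSupport.cm l)) κtop)).FMrefined ∧ ¬ (canon₈₉W νtop (Mok2015.LeafSupport.mkN (Mok2015.LeafSupport.cm l)) (canon νtop (Mok2015.LeafSupport.mkN (Mok2015.LeafSupport.cm l)) κtop) (canon₈no νtop (Mok2015.LeafSupport.mkN (Mok2015.LeafSupport.cm l))) (canon₃₄ (Mok2015.LeafSupport.mkN (Mok2015.LeafSupport.cm l)) κtop)).FMbocherer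 ∧ (canon₈₉W νtop (Mok2015.LeafSupport.mkN (Mok2015.LeafSupport.cm l)) (canon νtop (Mok2015.LeafSupport.mkN (Mok2015.LeafSupport.cm l)) κtop) (canon₈no νtop (Mok2015.LeafSupport.mkN (Mok2015.LeafSupport.cm l))) (canon₃₄ (Mok2015.LeafSupport.mkN (Mok2015.LeafSupport.cm l)) κtop)).FMggp2) ∧
      ((∀ N, ¬ κnoMok.Scope N) ∧ ¬ (canon₈₉W νtop μtop (canon νtop μtop κnoMok) (canon₈no νtop μtop) (canon₃₄ μtop κnoMok)).FMrefined ∧ ¬ (canon₈₉W νtop μtop (canon νtop μtop κnoMok) (canon₈no νtop μtop) (canon₃₄ μtop κnoMok)).FMbocherer ∧ (canon₈₉W νtop μtop (canon νtop μtop κnoMok) (canon₈no νtop μtop) (canon₃₄ μtop κnoMok)).FMggp2) :=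
  ⟨eightyninth_holds_top,
    ⟨c89_node_denied_top.1.2.1.2.1, c89_node_denied_top.1.2.2.1, c89_node_denied_top.1.2.2.2.1, c89_node_denied_top.2.2.2.1⟩,
    ⟨c89_rows_denied_top.2.1.1, c89_rows_denied_top.2.1.2.1, c89_rows_denied_top.2.2.1⟩,
    fun l => have h := c89_book_cm l
      ⟨h.2.1, h.2.2.1.2.1.2.1, h.2.2.1.2.1.2.2.1, h.2.2.1.2.2.1, h.2.2.2.2.1, h.2.2.2.2.2.2⟩,
    fun l => have h := c89_mok_cm l
      ⟨h.1, h.2.2.1.1, h.2.2.1.2.1, h.2.2.2.1⟩,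
    ⟨c89_kmsw_importDenied.1, c89_kmsw_importDenied.2.2.1.1, c89_kmsw_importDenied.2.2.1.2.1, c89_kmsw_importDenied.2.2.2.1⟩⟩

/-! ## 93. Ninetieth tranche (v2 of this file, after NEW `Downstream26.lean` v1; unit `pub-arthur-down-g36`): supports of THE CITATION GRAPH, IV — row C228
`HKSlocal` / `HKSrestr` (premise-free) / `HKSmult1` (node) / `HKScoh` / `HKScentral`, row C229 `RaumKudla` (premise-free) / `LLmodularityIQ` (node, discharged) / `KSZ` (node) /
`LLhyp66` (node) / `LiLiu17`; see the module docstring for the summary. -/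

section Canon90

variable (μ : Mok2015.Nodes) (κ : KMSW2014.Nodes)

/-- The parametrised canonical reading of the ninetieth tranche: the tranche-2 assignment `c₂` and the value `ksz` of the Kisin – Shin – Zhu node are the parameters; the multiplicity-one node and Prop. 1.5 := Mok ∧ KMSW's scope; Thm 3.7 := that ∧ C14 ∧ C26; Hypothesis 6.6 := Mok ∧ KMSW in full ∧ ksz; Li – Liu's Thm 1.7 := that ∧ C19; the four controls / discharged node := True; no book node occurs. [cite: HarrisKobayashiSpeh2025Translation, Part 3 §3.1, Prop. 1.5, Thm 3.7; Raum2026Kudla, Thm 1, Cor. 2, Rem. 1; LiLiu2021, Thm 1.7, Hyp. 6.6 (canonical model; bookkeeping)] [claim: KalethaMinguezShinWhite2014, under-review] -/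
abbrev canon₉₀W (c₂ : Consumers2) (ksz : Prop) : Consumers90 where
  HKSlocal := True
  HKSrestr := True
  HKSmult1 := (∀ N, μ.Everything N) ∧ (∀ N, κ.Scope N)
  HKScoh := (∀ N, μ.Everything N) ∧ (∀ N, κ.Scope N)
  HKScentral := ((∀ N, μ.Everything N) ∧ (∀ N, κ.Scope N)) ∧ c₂.BPLZZii ∧ c₂.BPCZii
  RaumKudla := True
  LLmodularityIQ := True
  KSZ := ksz
  LLhyp66 := (∀ N, μ.Everything N) ∧ (∀ N, κ.Full N) ∧ ksz
  LiLiu17 := ((∀ N, μ.Everything N) ∧ (∀ N, κ.Full N) ∧ ksz) ∧ c₂.LiLiu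

/-- Every ninetieth-tranche edge holds in the parametrised reading, for arbitrary μ, κ and EVERY assignment of tranche 2 and of the Kisin – Shin – Zhu node. [cite: HarrisKobayashiSpeh2025Translation, Part 3 Thms 2.1, 3.7, Prop. 1.5; Raum2026Kudla, Thm 1, Cor. 2; LiLiu2021, Thm 1.7 (bookkeeping proved here)] [claim: KalethaMinguezShinWhite2014, under-review] -/
theorem canon_implications₉₀W (c₂ : Consumers2) (ksz : Prop) : Implications90 μ κ c₂ (canon₉₀W μ κ c₂ ksz) where
  hksLocal := True.intro
  hksRestr := True.intro
  hksMult1 := fun m s => ⟨m, s⟩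
  hksCoh := fun h => h
  hksCentral := fun h a b => ⟨h, a, b⟩
  raum := True.intro
  llMod := fun _ => True.intro
  llHyp66 := fun m f k => ⟨m, f, k⟩
  liLiu17 := fun _ h l => ⟨h, l⟩

/-- In the parametrised reading all ten statements hold as soon as Mok's outputs, KMSW's proved scope AND KMSW's starred statements in full hold at all ranks, rows C14, C26,
C19 hold and the Kisin – Shin – Zhu node holds — through the tranche's bookkeeping theorems `hksCoh_of_mok_and_scope`, `hksCentral_of_rows`, `liLiu17_of_nodes_and_row`. [cite: HarrisKobayashiSpeh2025Translation, Part 3 Thm 3.7; Raum2026Kudla, Cor. 2 (bookkeeping proved here)] [claim: KalethaMinguezShinWhite2014, under-review] -/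
theorem c90_all_of (c₂ : Consumers2) (ksz : Prop) (hμ : ∀ N, μ.Everything N) (hκ : ∀ N, κ.Scope N) (hF : ∀ N, κ.Full N) (h₁₄ : c₂.BPLZZii) (h₂₆ : c₂.BPCZii)
    (h₁₉ : c₂.LiLiu) (hk : ksz) : ((canon₉₀W μ κ c₂ ksz).HKSlocal ∧ (canon₉₀W μ κ c₂ ksz).HKSrestr ∧ (canon₉₀W μ κ c₂ ksz).HKSmult1 ∧ (canon₉₀W μ κ c₂ ksz).HKScoh ∧ (canon₉₀W μ κ c₂ ksz).HKScentral ∧ (canon₉₀W μ κ c₂ ksz).RaumKudla ∧ (canon₉₀W μ κ c₂ ksz).LLmodularityIQ ∧ (canon₉₀W μ κ c₂ ksz).KSZ ∧ (canon₉₀W μ κ c₂ ksz).LLhyp66 ∧ (canon₉₀W μ κ c₂ ksz).LiLiu17) :=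
  have X := canon_implications₉₀W μ κ c₂ ksz
  have hC := hksCoh_of_mok_and_scope X hμ hκ
  have h66 : (canon₉₀W μ κ c₂ ksz).LLhyp66 := X.llHyp66 hμ hF hk
  ⟨X.hksLocal, X.hksRestr, hC.1, hC.2, hksCentral_of_rows X hC.2 h₁₄ h₂₆, X.raum, X.llMod X.raum, hk, h66, liLiu17_of_nodes_and_row X (X.llMod X.raum) h66 h₁₉⟩

end Canon90

/-- Rows C14 AND C26 DENIED (`BPLZZii := False`, `BPCZii := False`; the other tranche-2 fields as in `canon₂` at the top): a reading of `Consumers2` used only to deny the two typed Ichino – Ikeda – N. Harris theorems; no second-tranche edge is claimed for it. [cite: BeuzartplessisEtAl2021, Thm 1.10; BeuzartplessisChaudouardZydor2022, Thm (thm:II) (separating model; bookkeeping)] -/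
abbrev c₂noIINH : Consumers2 := { canon₂ νtop μtop κtop with BPLZZii := False, BPCZii := False }

/-- Row C19 DENIED (`LiLiu := False`; the other tranche-2 fields as in `canon₂` at the top): used only to deny Li – Liu's two KMSW-scope lemmas; no second-tranche edge is claimed for it. [cite: LiLiu2021, Lemmas 3.15, 9.2 (separating model; bookkeeping)] -/
abbrev c₂noLiLiu : Consumers2 := { canon₂ νtop μtop κtop with LiLiu := False }

/-- At the top (every input of Mok's and KMSW's DAGs incl. KMSW's sequels; tranche 2 read canonically; the Kisin – Shin – Zhu node granted) all ten statements of the tranche hold. [cite: HarrisKobayashiSpeh2025Translation, Part 3 Thm 3.7; Raum2026Kudla, Cor. 2 (bookkeeping proved here)] [claim: KalethaMinguezShinWhite2014, under-review] -/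
theorem ninetieth_holds_top : ((canon₉₀W μtop κtop (canon₂ νtop μtop κtop) True).HKSlocal ∧ (canon₉₀W μtop κtop (canon₂ νtop μtop κtop) True).HKSrestr ∧ (canon₉₀W μtop κtop (canon₂ νtop μtop κtop) True).HKSmult1 ∧ (canon₉₀W μtop κtop (canon₂ νtop μtop κtop) True).HKScoh ∧ (canon₉₀W μtop κtop (canon₂ νtop μtop κtop) True).HKScentral ∧ (canon₉₀W μtop κtop (canon₂ νtop μtop κtop) True).RaumKudla ∧ (canon₉₀W μtop κtop (canon₂ νtop μtop κtop) True).LLmodularityIQ ∧ (canon₉₀W μtop κtop (canon₂ νtop μtop κtop) True).KSZ ∧ (canon₉₀W μtop κtop (canon₂ νtop μtop κtop) True).LLhyp66 ∧ (canon₉₀W μtop κtop (canon₂ νtop μtop κtop) True).LiLiu17) :=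
  have m : ∀ N, μtop.Everything N := mokInputs_top.everything
  have s : ∀ N, κtop.Scope N := (kmswInputs_top μtop).1.scope mokInputs_top
  have f : ∀ N, κtop.Full N := KMSWInputs.full mokInputs_top (kmswInputs_top μtop).1 (kmswInputs_top μtop).2
  c90_all_of μtop κtop (canon₂ νtop μtop κtop) True m s f ⟨m, s⟩ ⟨m, s⟩ s True.intro

/-- THE KISIN – SHIN – ZHU NODE IS LOAD-BEARING AS TYPED: at the top with `KSZ` DENIED every edge holds, Hypothesis 6.6 and Li – Liu's Theorem 1.7 FAIL, while C228's five statements,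
Raum's Theorem 1 and the discharged modularity node HOLD. [cite: LiLiu2021, Rem. 6.7 (« it will follow from [KSZ] ») (separating model; bookkeeping proved here)] [claim: KalethaMinguezShinWhite2014, under-review] -/
theorem c90_ksz_denied_top :
    Implications90 μtop κtop (canon₂ νtop μtop κtop) (canon₉₀W μtop κtop (canon₂ νtop μtop κtop) False) ∧ (¬ (canon₉₀W μtop κtop (canon₂ νtop μtop κtop) False).KSZ ∧ ¬ (canon₉₀W μtop κtop (canon₂ νtop μtop κtop) False).LLhyp66 ∧ ¬ (canon₉₀W μtop κtop (canon₂ νtop μtop κtop) False).LiLiu17) ∧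
      ((canon₉₀W μtop κtop (canon₂ νtop μtop κtop) False).HKSmult1 ∧ (canon₉₀W μtop κtop (canon₂ νtop μtop κtop) False).HKScoh ∧ (canon₉₀W μtop κtop (canon₂ νtop μtop κtop) False).HKScentral ∧ (canon₉₀W μtop κtop (canon₂ νtop μtop κtop) False).HKSlocal ∧ (canon₉₀W μtop κtop (canon₂ νtop μtop κtop) False).HKSrestr ∧ (canon₉₀W μtop κtop (canon₂ νtop μtop κtop) False).RaumKudla ∧ (canon₉₀W μtop κtop (canon₂ νtop μtop κtop) False).LLmodularityIQ) :=
  have m : ∀ N, μtop.Everything N := mokInputs_top.everything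
  have s : ∀ N, κtop.Scope N := (kmswInputs_top μtop).1.scope mokInputs_top
  ⟨canon_implications₉₀W _ _ _ _, ⟨fun h => h, fun h => h.2.2, fun h => h.1.2.2⟩,
    ⟨⟨m, s⟩, ⟨m, s⟩, ⟨⟨m, s⟩, ⟨m, s⟩, ⟨m, s⟩⟩, True.intro, True.intro, True.intro, True.intro⟩⟩

/-- THE TYPED ROWS ARE LOAD-BEARING: at the top (node `KSZ` granted), (a) with rows C14 / C26 DENIED (`c₂noIINH`) every edge holds, Theorem 3.7 FAILS, Prop. 1.5 and Li – Liu's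
Theorem 1.7 HOLD; (b) with row C19 DENIED (`c₂noLiLiu`) every edge holds, Li – Liu's Theorem 1.7 FAILS, Hypothesis 6.6 and Theorem 3.7 HOLD. [cite: HarrisKobayashiSpeh2025Translation, Part 3 §3.4 (« see [BPCZ] »); Raum2026Kudla, Cor. 2; LiLiu2021, Lemma 3.15 (separating models; bookkeeping proved here)] [claim: KalethaMinguezShinWhite2014, under-review] -/
theorem c90_rows_denied_top :
    (Implications90 μtop κtop c₂noIINH (canon₉₀W μtop κtop c₂noIINH True) ∧ ¬ (canon₉₀W μtop κtop c₂noIINH True).HKScentral ∧ (canon₉₀W μtop κtop c₂noIINH True).HKScoh ∧ (canon₉₀W μtop κtop c₂noIINH True).LiLiu17) ∧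
      (Implications90 μtop κtop c₂noLiLiu (canon₉₀W μtop κtop c₂noLiLiu True) ∧ ¬ (canon₉₀W μtop κtop c₂noLiLiu True).LiLiu17 ∧ (canon₉₀W μtop κtop c₂noLiLiu True).LLhyp66 ∧ (canon₉₀W μtop κtop c₂noLiLiu True).HKScentral) :=
  have m : ∀ N, μtop.Everything N := mokInputs_top.everything
  have s : ∀ N, κtop.Scope N := (kmswInputs_top μtop).1.scope mokInputs_top
  have f : ∀ N, κtop.Full N := KMSWInputs.full mokInputs_top (kmswInputs_top μtop).1 (kmswInputs_top μtop).2
  ⟨⟨canon_implications₉₀W _ _ _ _, fun h => h.2.1, ⟨m, s⟩, ⟨⟨m, f, True.intro⟩, s⟩⟩,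
    ⟨canon_implications₉₀W _ _ _ _, fun h => h.2, ⟨m, f, True.intro⟩, ⟨⟨m, s⟩, ⟨m, s⟩, ⟨m, s⟩⟩⟩⟩

/-- MOK SIDE, EXACT SUPPORT AS TYPED: in the Mok countermodel of ANY leaf `l` (KMSW at the top; tranche 2 read canonically over it; `KSZ` granted; every edge valid) the five unitary
statements — the multiplicity-one node, Prop. 1.5 / Q(π), Theorem 3.7, Hypothesis 6.6, Li – Liu's Theorem 1.7 — FAIL, and the four controls / discharged node and `KSZ` hold. [cite: HarrisKobayashiSpeh2025Translation, Part 3 §3.1 (p0043:L12); LiLiu2021, Rem. 6.7 (« 15,KMSW »); Mok2012, Thm 2.5.2 (bookkeeping proved here)] [claim: KalethaMinguezShinWhite2014, under-review] -/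
theorem c90_mok_cm (l : Mok2015.LeafSupport.Leaf) :
    ¬ (Mok2015.LeafSupport.mkN (Mok2015.LeafSupport.cm l)).leaf l ∧ Implications90 (Mok2015.LeafSupport.mkN (Mok2015.LeafSupport.cm l)) κtop (canon₂ νtop (Mok2015.LeafSupport.mkN (Mok2015.LeafSupport.cm l)) κtop) (canon₉₀W (Mok2015.LeafSupport.mkN (Mok2015.LeafSupport.cm l)) κtop (canon₂ νtop (Mok2015.LeafSupport.mkN (Mok2015.LeafSupport.cm l)) κtop) True) ∧ (¬ (canon₉₀W (Mok2015.LeafSupport.mkN (Mok2015.LeafSupport.cm l)) κtop (canon₂ νtop (Mok2015.LeafSupport.mkN (Mok2015.LeafSupport.cm l)) κtop) True).HKSmult1 ∧ ¬ (canon₉₀W (Mok2015.LeafSupport.mkN (Mok2015.LeafSupport.cm l)) κtop (canon₂ νtop (Mok2015.LeafSupport.mkN (Mok2015.LeafSupport.cm l)) κtop) True).HKScoh ∧ ¬ (canon₉₀W (Mok2015.LeafSupport.mkN (Mok2015.LeafSupport.cm l)) κtop (canon₂ νtop (Mok2015.LeafSupport.mkN (Mok2015.LeafSupport.cm l)) κtop)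 True).HKScentral ∧ ¬ (canon₉₀W (Mok2015.LeafSupport.mkN (Mok2015.LeafSupport.cm l)) κtop (canon₂ νtop (Mok2015.LeafSupport.mkN (Mok2015.LeafSupport.cm l)) κtop) True).LLhyp66 ∧ ¬ (canon₉₀W (Mok2015.LeafSupport.mkN (Mok2015.LeafSupport.cm l)) κtop (canon₂ νtop (Mok2015.LeafSupport.mkN (Mok2015.LeafSupport.cm l)) κtop) True).LiLiu17) ∧ ((canon₉₀W (Mok2015.LeafSupport.mkN (Mok2015.LeafSupport.cm l)) κtop (canon₂ νtop (Mok2015.LeafSupport.mkN (Mok2015.LeafSupport.cm l)) κtop) True).HKSlocal ∧ (canon₉₀W (Mok2015.LeafSupport.mkN (Mok2015.LeafSupport.cm l)) κtop (canon₂ νtop (Mok2015.LeafSupport.mkN (Mok2015.LeafSupport.cm l)) κtop) True).HKSrestr ∧ (canon₉₀W (Mok2015.LeafSupport.mkN (Mok2015.LeafSupport.cm l)) κtop (canon₂ νtop (Mok2015.LeafSupport.mkN (Mok2015.LeafSupport.cm l)) κtop) True).RaumKudla ∧ (canon₉₀W (Mok2015.LeafSupport.mkN (Mok2015.LeafSupport.cm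 l)) κtop (canon₂ νtop (Mok2015.LeafSupport.mkN (Mok2015.LeafSupport.cm l)) κtop) True).LLmodularityIQ ∧ (canon₉₀W (Mok2015.LeafSupport.mkN (Mok2015.LeafSupport.cm l)) κtop (canon₂ νtop (Mok2015.LeafSupport.mkN (Mok2015.LeafSupport.cm l)) κtop) True).KSZ) :=
  have cmod := Mok2015.LeafSupport.countermodel l
  have nm := not_M_cm l
  ⟨cmod.2.2.1, canon_implications₉₀W _ _ _ _, ⟨fun h => nm h.1, fun h => nm h.1, fun h => nm h.1.1, fun h => nm h.1, fun h => nm h.1.1⟩,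
    ⟨True.intro, True.intro, True.intro, True.intro, True.intro⟩⟩

/-- KMSW SIDE, THE IMPORT: with Mok at the top and KMSW's Mok import DENIED (`κnoMok`: neither the proved scope nor the full statements hold at any rank; tranche 2 read over it)
every edge holds and the same five unitary statements FAIL, the five others hold. [cite: HarrisKobayashiSpeh2025Translation, Part 3 §3.1; LiLiu2021, Rem. 6.7 (bookkeeping proved here)] [claim: KalethaMinguezShinWhite2014, under-review] -/
theorem c90_kmsw_importDenied :
    (∀ N, ¬ κnoMok.Scope N) ∧ (∀ N, ¬ κnoMok.Full N) ∧ Implications90 μtop κnoMok (canon₂ νtop μtop κnoMok) (canon₉₀W μtop κnoMok (canon₂ νtop μtop κnoMok) True) ∧ (¬ (canon₉₀W μtop κnoMok (canon₂ νtop μtop κnoMok) True).HKSmult1 ∧ ¬ (canon₉₀W μtop κnoMok (canon₂ νtop μtop κnoMok) True).HKScoh ∧ ¬ (canon₉₀W μtop κnoMok (canon₂ νtop μtop κnoMok) True).HKScentral ∧ ¬ (canon₉₀W μtop κnoMok (canon₂ νtop μtop κnoMok) True).LLhyp66 ∧ ¬ (canon₉₀W μtop κnoMok (canon₂ νtop μtop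 κnoMok) True).LiLiu17) ∧ ((canon₉₀W μtop κnoMok (canon₂ νtop μtop κnoMok) True).HKSlocal ∧ (canon₉₀W μtop κnoMok (canon₂ νtop μtop κnoMok) True).HKSrestr ∧ (canon₉₀W μtop κnoMok (canon₂ νtop μtop κnoMok) True).RaumKudla ∧ (canon₉₀W μtop κnoMok (canon₂ νtop μtop κnoMok) True).LLmodularityIQ ∧ (canon₉₀W μtop κnoMok (canon₂ νtop μtop κnoMok) True).KSZ) :=
  have ns : ∀ N, ¬ κnoMok.Scope N := κnoMok_facts.2.2.2.2.2.1
  have nf : ∀ N, ¬ κnoMok.Full N := κnoMok_facts.2.2.2.2.2.2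
  ⟨ns, nf, canon_implications₉₀W _ _ _ _,
    ⟨fun h => ns 0 (h.2 0), fun h => ns 0 (h.2 0), fun h => ns 0 (h.1.2 0), fun h => nf 0 (h.2.1 0), fun h => nf 0 (h.1.2.1 0)⟩,
    ⟨True.intro, True.intro, True.intro, True.intro, True.intro⟩⟩

/-- KMSW SIDE, THE SEQUELS: in KMSW's countermodel of ANY leaf `l` that feeds only the starred statements in full (`l.onlyFull = true`: the unwritten sequels `KMS_A`, `KMS_B` and
`AubertSS`; Mok at the top; tranche 2 read over it; `KSZ` granted) every other KMSW leaf holds, `l` fails, the proved scope HOLDS and the full statements FAIL at every rank;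
every edge holds; C228's node, Prop. 1.5 and Theorem 3.7 HOLD (tempered π: the proved scope suffices) while Hypothesis 6.6 and Li – Liu's Theorem 1.7 FAIL (« the full
endoscopic classification for unitary groups »). [cite: HarrisKobayashiSpeh2025Translation, Part 3 §3.4.1 (« tempered locally everywhere [C] »); Raum2026Kudla, Rem. 1; LiLiu2021, Rem. 6.7 (separating models; bookkeeping proved here)] [claim: KalethaMinguezShinWhite2014, under-review] -/
theorem c90_sequel_cm (l : KMSW2014.LeafSupport.Leaf) (h : l.onlyFull = true) :
    (∀ l', l' ≠ l → (KMSW2014.LeafSupport.mkN (KMSW2014.LeafSupport.cm l)).leaf l') ∧ ¬ (KMSW2014.LeafSupport.mkN (KMSW2014.LeafSupport.cm l)).leaf l ∧ (∀ N, (KMSW2014.LeafSupport.mkN (KMSW2014.LeafSupport.cm l)).Scope N) ∧ ¬ (∀ N, (KMSW2014.LeafSupport.mkN (KMSW2014.LeafSupport.cm l)).Full N) ∧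
      Implications90 μtop (KMSW2014.LeafSupport.mkN (KMSW2014.LeafSupport.cm l)) (canon₂ νtop μtop (KMSW2014.LeafSupport.mkN (KMSW2014.LeafSupport.cm l))) (canon₉₀W μtop (KMSW2014.LeafSupport.mkN (KMSW2014.LeafSupport.cm l)) (canon₂ νtop μtop (KMSW2014.LeafSupport.mkN (KMSW2014.LeafSupport.cm l))) True) ∧ ((canon₉₀W μtop (KMSW2014.LeafSupport.mkN (KMSW2014.LeafSupport.cm l)) (canon₂ νtop μtop (KMSW2014.LeafSupport.mkN (KMSW2014.LeafSupport.cm l))) True).HKSmult1 ∧ (canon₉₀W μtop (KMSW2014.LeafSupport.mkN (KMSW2014.LeafSupport.cm l)) (canon₂ νtop μtop (KMSW2014.LeafSupport.mkN (KMSW2014.LeafSupport.cm l))) True).HKScoh ∧ (canon₉₀W μtop (KMSW2014.LeafSupport.mkN (KMSW2014.LeafSupport.cm l)) (canon₂ νtop μtop (KMSW2014.LeafSupport.mkN (KMSW2014.LeafSupport.cm l))) True).HKScentral) ∧ (¬ (canon₉₀W μtop (KMSW2014.LeafSupport.mkN (KMSW2014.LeafSupport.cm l)) (canon₂ νtop μtop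 (KMSW2014.LeafSupport.mkN (KMSW2014.LeafSupport.cm l))) True).LLhyp66 ∧ ¬ (canon₉₀W μtop (KMSW2014.LeafSupport.mkN (KMSW2014.LeafSupport.cm l)) (canon₂ νtop μtop (KMSW2014.LeafSupport.mkN (KMSW2014.LeafSupport.cm l))) True).LiLiu17) :=
  have cmod := KMSW2014.LeafSupport.countermodel l
  have nf : ¬ ∀ N, (KMSW2014.LeafSupport.mkN (KMSW2014.LeafSupport.cm l)).Full N := fun hh => KMSW2014.LeafSupport.not_full_of_noFull (cmod.2.2.2 0) (hh 0)
  have s : ∀ N, (KMSW2014.LeafSupport.mkN (KMSW2014.LeafSupport.cm l)).Scope N := scope_of_onlyFull l h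
  have m : ∀ N, μtop.Everything N := mokInputs_top.everything
  ⟨cmod.2.1, cmod.2.2.1, s, nf, canon_implications₉₀W _ _ _ _, ⟨⟨m, s⟩, ⟨m, s⟩, ⟨⟨m, s⟩, ⟨m, s⟩, ⟨m, s⟩⟩⟩,
    ⟨fun hh => nf hh.2.1, fun hh => nf hh.1.2.1⟩⟩

/-- THE NINETIETH TRANCHE REGRADED, in one statement: (i) at the top all ten hold; (ii) `KSZ` denied: Hypothesis 6.6 and Li – Liu's Thm 1.7 fail, Thm 3.7 holds; (iii) C14 / C26
denied: Thm 3.7 fails, Li – Liu holds; C19 denied: Li – Liu fails, Thm 3.7 holds; (iv) in the Mok countermodel of any leaf and (v) with KMSW's Mok import denied the five unitary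
statements fail, the controls hold; (vi) in KMSW's countermodel of each only-full leaf (the two sequels, `AubertSS`) C228's three statements hold and C229's two KMSW-full
statements fail; no book node occurs in the reading. [cite: HarrisKobayashiSpeh2025Translation, Part 3 Thms 2.1, 3.7, Prop. 1.5; Raum2026Kudla, Thm 1, Cor. 2, Rem. 1; LiLiu2021, Thm 1.7 (bookkeeping proved here)] [claim: KalethaMinguezShinWhite2014, under-review] -/
theorem c90_regraded :
    ((canon₉₀W μtop κtop (canon₂ νtop μtop κtop) True).HKSlocal ∧ (canon₉₀W μtop κtop (canon₂ νtop μtop κtop) True).HKSrestr ∧ (canon₉₀W μtop κtop (canon₂ νtop μtop κtop) True).HKSmult1 ∧ (canon₉₀W μtop κtop (canon₂ νtop μtop κtop) True).HKScoh ∧ (canon₉₀W μtop κtop (canon₂ νtop μtop κtop) True).HKScentral ∧ (canon₉₀W μtop κtop (canon₂ νtop μtop κtop) True).RaumKudla ∧ (canon₉₀W μtop κtop (canon₂ νtop μtop κtop) True).LLmodularityIQ ∧ (canon₉₀W μtop κtop (canon₂ νtop μtop κtop) True).KSZ ∧ (canon₉₀W μtop κtop (canon₂ νtop μtop κtop) True).LLhyp66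 ∧ (canon₉₀W μtop κtop (canon₂ νtop μtop κtop) True).LiLiu17) ∧
      (¬ (canon₉₀W μtop κtop (canon₂ νtop μtop κtop) False).LLhyp66 ∧ ¬ (canon₉₀W μtop κtop (canon₂ νtop μtop κtop) False).LiLiu17 ∧ (canon₉₀W μtop κtop (canon₂ νtop μtop κtop) False).HKScentral) ∧
      (¬ (canon₉₀W μtop κtop c₂noIINH True).HKScentral ∧ (canon₉₀W μtop κtop c₂noIINH True).LiLiu17 ∧ ¬ (canon₉₀W μtop κtop c₂noLiLiu True).LiLiu17 ∧ (canon₉₀W μtop κtop c₂noLiLiu True).HKScentral) ∧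
      (∀ l : Mok2015.LeafSupport.Leaf, (¬ (Mok2015.LeafSupport.mkN (Mok2015.LeafSupport.cm l)).leaf l) ∧ ¬ (canon₉₀W (Mok2015.LeafSupport.mkN (Mok2015.LeafSupport.cm l)) κtop (canon₂ νtop (Mok2015.LeafSupport.mkN (Mok2015.LeafSupport.cm l)) κtop) True).HKSmult1 ∧ ¬ (canon₉₀W (Mok2015.LeafSupport.mkN (Mok2015.LeafSupport.cm l)) κtop (canon₂ νtop (Mok2015.LeafSupport.mkN (Mok2015.LeafSupport.cm l)) κtop) True).HKScentral ∧ ¬ (canon₉₀W (Mok2015.LeafSupport.mkN (Mok2015.LeafSupport.cm l)) κtop (canon₂ νtop (Mok2015.LeafSupport.mkN (Mok2015.LeafSupport.cm l)) κtop) True).LiLiu17 ∧ (canon₉₀W (Mok2015.LeafSupport.mkN (Mok2015.LeafSupport.cm l)) κtop (canon₂ νtop (Mok2015.LeafSupport.mkN (Mok2015.LeafSupport.cm l)) κtop) True).RaumKudla) ∧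
      ((∀ N, ¬ κnoMok.Scope N) ∧ ¬ (canon₉₀W μtop κnoMok (canon₂ νtop μtop κnoMok) True).HKScoh ∧ ¬ (canon₉₀W μtop κnoMok (canon₂ νtop μtop κnoMok) True).LLhyp66) ∧
      (∀ l : KMSW2014.LeafSupport.Leaf, l.onlyFull = true → (¬ (KMSW2014.LeafSupport.mkN (KMSW2014.LeafSupport.cm l)).leaf l) ∧ (canon₉₀W μtop (KMSW2014.LeafSupport.mkN (KMSW2014.LeafSupport.cm l)) (canon₂ νtop μtop (KMSW2014.LeafSupport.mkN (KMSW2014.LeafSupport.cm l))) True).HKSmult1 ∧ (canon₉₀W μtop (KMSW2014.LeafSupport.mkN (KMSW2014.LeafSupport.cm l)) (canon₂ νtop μtop (KMSW2014.LeafSupport.mkN (KMSW2014.LeafSupport.cm l))) True).HKScentral ∧ ¬ (canon₉₀W μtop (KMSW2014.LeafSupport.mkN (KMSW2014.LeafSupport.cm l)) (canon₂ νtop μtop (KMSW2014.LeafSupport.mkN (KMSW2014.LeafSupport.cm l))) True).LLhyp66 ∧ ¬ (canon₉₀W μtop (KMSW2014.LeafSupport.mkN (KMSW2014.LeafSupport.cm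 l)) (canon₂ νtop μtop (KMSW2014.LeafSupport.mkN (KMSW2014.LeafSupport.cm l))) True).LiLiu17) :=
  ⟨ninetieth_holds_top,
    ⟨c90_ksz_denied_top.2.1.2.1, c90_ksz_denied_top.2.1.2.2, c90_ksz_denied_top.2.2.2.2.1⟩,
    ⟨c90_rows_denied_top.1.2.1, c90_rows_denied_top.1.2.2.2, c90_rows_denied_top.2.2.1, c90_rows_denied_top.2.2.2.2⟩,
    fun l => have h := c90_mok_cm l
      ⟨h.1, h.2.2.1.1, h.2.2.1.2.2.1, h.2.2.1.2.2.2.2, h.2.2.2.2.2.1⟩,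
    ⟨c90_kmsw_importDenied.1, c90_kmsw_importDenied.2.2.2.1.2.1, c90_kmsw_importDenied.2.2.2.1.2.2.2.1⟩,
    fun l hl => have h := c90_sequel_cm l hl
      ⟨h.2.1, h.2.2.2.2.2.1.1, h.2.2.2.2.2.1.2.2, h.2.2.2.2.2.2.1, h.2.2.2.2.2.2.2⟩⟩

/-! ## 94. Ninety-first tranche (v3 of this file, after `Downstream26.lean` v2; unit `pub-arthur-down-g36`): supports of NEW row C230 Manji – Thøgersen – Wu —
`MTWlgc` (node, no supplier) / `MTWprop623` / `MTWfs` / `MTWprop723` / `MTWinf`; see the module docstring for the summary. -/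

section Canon91

variable (ν : Nodes)

/-- The parametrised canonical reading of the ninety-first tranche: the assignments `c₁₉`, `c₂₀`, `c₂₈` of tranches 19 / 20 / 28 and the value `lgc` of the node are the parameters; Proposition 6.2.3 := C180 ∧ C182; Theorem 1.3.1 := that ∧ C191; Proposition 7.2.3 := book ∧ C180 ∧ lgc; Theorem 1.3.2 := that ∧ lgc. [cite: ManjiThogersenWu2026Parabolic, Prop. 6.2.3, Thm 1.3.1, Prop. 7.2.3, Thm 1.3.2 (canonical model; bookkeeping)] -/
abbrev canon₉₁W (c₁₉ : Consumers19) (c₂₀ : Consumers20) (c₂₈ : Consumers28) (lgc : Prop) : Consumers91 where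
  MTWlgc := lgc
  MTWprop623 := c₁₉.SchmidtParamodular ∧ c₂₀.SchmidtCAP
  MTWfs := (c₁₉.SchmidtParamodular ∧ c₂₀.SchmidtCAP) ∧ c₂₈.MokGSp4
  MTWprop723 := (∀ N, ν.Everything N) ∧ c₁₉.SchmidtParamodular ∧ lgc
  MTWinf := ((∀ N, ν.Everything N) ∧ c₁₉.SchmidtParamodular ∧ lgc) ∧ lgc

/-- Every ninety-first-tranche edge holds in the parametrised reading, for arbitrary ν and EVERY assignment of tranches 19 / 20 / 28 and of the node. [cite: ManjiThogersenWu2026Parabolic, Prop. 6.2.3, Thm 6.3.4, Cor. 6.3.5, Prop. 7.2.3, Thm 7.3.4, Cor. 7.3.5 (bookkeeping proved here)] -/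
theorem canon_implications₉₁W (c₁₉ : Consumers19) (c₂₀ : Consumers20) (c₂₈ : Consumers28) (lgc : Prop) : Implications91 ν c₁₉ c₂₀ c₂₈ (canon₉₁W ν c₁₉ c₂₀ c₂₈ lgc) where
  prop623 := fun s k => ⟨s, k⟩
  fs := fun h m => ⟨h, m⟩
  prop723 := fun a s g => ⟨a, s, g⟩
  inf := fun h g => ⟨h, g⟩

/-- In the parametrised reading all five statements hold as soon as the book holds at all ranks, rows C180, C182, C191 hold and the node holds — through the tranche's bookkeeping theorems `mtwFs_of_rows`, `mtwInf_of_book_conduit_node`. [cite: ManjiThogersenWu2026Parabolic, Thms 1.3.1, 1.3.2 (bookkeeping proved here)] -/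
theorem c91_all_of (c₁₉ : Consumers19) (c₂₀ : Consumers20) (c₂₈ : Consumers28) (lgc : Prop) (hν : ∀ N, ν.Everything N) (h₁₉ : c₁₉.SchmidtParamodular) (h₂₀ : c₂₀.SchmidtCAP)
    (h₁₉₁ : c₂₈.MokGSp4) (hg : lgc) : ((canon₉₁W ν c₁₉ c₂₀ c₂₈ lgc).MTWlgc ∧ (canon₉₁W ν c₁₉ c₂₀ c₂₈ lgc).MTWprop623 ∧ (canon₉₁W ν c₁₉ c₂₀ c₂₈ lgc).MTWfs ∧ (canon₉₁W ν c₁₉ c₂₀ c₂₈ lgc).MTWprop723 ∧ (canon₉₁W ν c₁₉ c₂₀ c₂₈ lgc).MTWinf) :=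
  have X := canon_implications₉₁W ν c₁₉ c₂₀ c₂₈ lgc
  have h₁ := mtwFs_of_rows X h₁₉ h₂₀ h₁₉₁
  have h₂ := mtwInf_of_book_conduit_node X hν h₁₉ hg
  ⟨hg, h₁.1, h₁.2, h₂.1, h₂.2⟩

end Canon91

/-- At the top (every input of the book; Mok and KMSW at the all-ones assignments, unread by the tranche; tranches 1 / 19 / 20 / 28 read canonically; the node granted) all five
statements hold, through the tranche's own `ninetyfirst_of_leaves`. [cite: ManjiThogersenWu2026Parabolic, Thms 1.3.1, 1.3.2 (bookkeeping proved here)] -/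
theorem ninetyfirst_holds_top : ((canon₉₁W νtop (canon₁₉ νtop μtop κtop) (canon₂₀ νtop μtop κtop) (canon₂₈ νtop μtop κtop) True).MTWlgc ∧ (canon₉₁W νtop (canon₁₉ νtop μtop κtop) (canon₂₀ νtop μtop κtop) (canon₂₈ νtop μtop κtop) True).MTWprop623 ∧ (canon₉₁W νtop (canon₁₉ νtop μtop κtop) (canon₂₀ νtop μtop κtop) (canon₂₈ νtop μtop κtop) True).MTWfs ∧ (canon₉₁W νtop (canon₁₉ νtop μtop κtop) (canon₂₀ νtop μtop κtop) (canon₂₈ νtop μtop κtop) True).MTWprop723 ∧ (canon₉₁W νtop (canon₁₉ νtop μtop κtop) (canon₂₀ νtop μtop κtop) (canon₂₈ νtop μtop κtop) True).MTWinf) :=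
  have h := ninetyfirst_of_leaves (canon_implications₉₁W νtop _ _ _ True) (canon_implications₂₀ νtop μtop κtop) (canon_implications₁₉ νtop μtop κtop)
    (canon_implications₂₈ νtop μtop κtop) (canon_implications νtop μtop κtop) bookInputs_top True.intro
  ⟨True.intro, h.1, h.2.1, h.2.2.1, h.2.2.2⟩

/-- THE NODE IS LOAD-BEARING EXACTLY AS TYPED: at the top with Hypothesis 1 DENIED every edge holds, Proposition 6.2.3 and Theorem 1.3.1 (finite slope) HOLD, Proposition 7.2.3
and Theorem 1.3.2 (infinite slope) FAIL. [cite: ManjiThogersenWu2026Parabolic, §1.3 (« under Hypothesis … SK(f) has two p-stabilisations »), Prop. 7.1.1 (separating model; bookkeeping proved here)] -/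
theorem c91_node_denied_top :
    Implications91 νtop (canon₁₉ νtop μtop κtop) (canon₂₀ νtop μtop κtop) (canon₂₈ νtop μtop κtop) (canon₉₁W νtop (canon₁₉ νtop μtop κtop) (canon₂₀ νtop μtop κtop) (canon₂₈ νtop μtop κtop) False) ∧ ((canon₉₁W νtop (canon₁₉ νtop μtop κtop) (canon₂₀ νtop μtop κtop) (canon₂₈ νtop μtop κtop) False).MTWprop623 ∧ (canon₉₁W νtop (canon₁₉ νtop μtop κtop) (canon₂₀ νtop μtop κtop) (canon₂₈ νtop μtop κtop) False).MTWfs) ∧ (¬ (canon₉₁W νtop (canon₁₉ νtop μtop κtop) (canon₂₀ νtop μtop κtop) (canon₂₈ νtop μtop κtop) False).MTWlgc ∧ ¬ (canon₉₁W νtop (canon₁₉ νtop μtop κtop) (canon₂₀ νtop μtop κtop) (canon₂₈ νtop μtop κtop) False).MTWprop723 ∧ ¬ (canon₉₁W νtop (canon₁₉ νtop μtop κtop) (canon₂₀ νtop μtop κtop) (canon₂₈ νtop μtop κtop) False).MTWinf) :=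
  have b : ∀ N, νtop.Everything N := bookInputs_top.everything
  ⟨canon_implications₉₁W _ _ _ _ _, ⟨⟨b, b, b⟩, ⟨b, b, b⟩, b, b⟩, ⟨fun h => h, fun h => h.2.2, fun h => h.2⟩⟩

/-- BOOK SIDE, EXACT SUPPORT: in each of the 24 book countermodels (book edge systems and every other book leaf hold, the removed leaf fails; Mok and KMSW at the all-ones
assignments; tranches 1 / 19 / 20 / 28 / 91 read canonically over it, ALL their edges valid; the node granted) the four typed statements of row C230 ALL FAIL — every one of
the 24 book leaves is load-bearing, through the three conduits for Theorem 1.3.1 and by name (and through C180) for Theorem 1.3.2 — while the node holds. [cite: ManjiThogersenWu2026Parabolic, Prop. 6.2.3 (« [Schmidt-Packet] and [Schmidt-CAPGSp4] »), §7.2 (« Arthur's classification »), with Arthur2013 §1.5 (bookkeeping proved here)] -/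
theorem c91_book_cm (l : LeafSupport.Leaf) :
    LeafSupport.Systems (LeafSupport.mkN (LeafSupport.cm l)) (LeafSupport.mkW (LeafSupport.cm l)) (LeafSupport.mkG (LeafSupport.cm l)) ∧
      (∀ l', l' ≠ l → (LeafSupport.mkN (LeafSupport.cm l)).leaf l') ∧ ¬ (LeafSupport.mkN (LeafSupport.cm l)).leaf l ∧
      (Implications (LeafSupport.mkN (LeafSupport.cm l)) μtop κtop (canon (LeafSupport.mkN (LeafSupport.cm l)) μtop κtop) ∧ Implications19 (LeafSupport.mkN (LeafSupport.cm l)) μtop κtop (canon₁₉ (LeafSupport.mkN (LeafSupport.cm l)) μtop κtop) ∧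
        Implications20 (LeafSupport.mkN (LeafSupport.cm l)) (canon₁₉ (LeafSupport.mkN (LeafSupport.cm l)) μtop κtop) (canon₂₀ (LeafSupport.mkN (LeafSupport.cm l)) μtop κtop) ∧
        Implications28 (LeafSupport.mkN (LeafSupport.cm l)) μtop κtop (canon (LeafSupport.mkN (LeafSupport.cm l)) μtop κtop) (canon₁₉ (LeafSupport.mkN (LeafSupport.cm l)) μtop κtop) (canon₂₈ (LeafSupport.mkN (LeafSupport.cm l)) μtop κtop) ∧ Implications91 (LeafSupport.mkN (LeafSupport.cm l)) (canon₁₉ (LeafSupport.mkN (LeafSupport.cm l)) μtop κtop) (canon₂₀ (LeafSupport.mkN (LeafSupport.cm l)) μtop κtop) (canon₂₈ (LeafSupport.mkN (LeafSupport.cm l)) μtop κtop) (canon₉₁W (LeafSupport.mkN (LeafSupport.cm l)) (canon₁₉ (LeafSupport.mkN (LeafSupport.cm l)) μtop κtop) (canon₂₀ (LeafSupport.mkN (LeafSupport.cm l)) μtop κtop) (canon₂₈ (LeafSupport.mkN (LeafSupport.cm l)) μtop κtop) True)) ∧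
      (¬ (canon₉₁W (LeafSupport.mkN (LeafSupport.cm l)) (canon₁₉ (LeafSupport.mkN (LeafSupport.cm l)) μtop κtop) (canon₂₀ (LeafSupport.mkN (LeafSupport.cm l)) μtop κtop) (canon₂₈ (LeafSupport.mkN (LeafSupport.cm l)) μtop κtop) True).MTWprop623 ∧ ¬ (canon₉₁W (LeafSupport.mkN (LeafSupport.cm l)) (canon₁₉ (LeafSupport.mkN (LeafSupport.cm l)) μtop κtop) (canon₂₀ (LeafSupport.mkN (LeafSupport.cm l)) μtop κtop) (canon₂₈ (LeafSupport.mkN (LeafSupport.cm l)) μtop κtop) True).MTWfs ∧ ¬ (canon₉₁W (LeafSupport.mkN (LeafSupport.cm l)) (canon₁₉ (LeafSupport.mkN (LeafSupport.cm l)) μtop κtop) (canon₂₀ (LeafSupport.mkN (LeafSupport.cm l)) μtop κtop) (canon₂₈ (LeafSupport.mkN (LeafSupport.cm l)) μtop κtop) True).MTWprop723 ∧ ¬ (canon₉₁W (LeafSupport.mkN (LeafSupport.cm l)) (canon₁₉ (LeafSupport.mkN (LeafSupport.cm l)) μtop κtop) (canon₂₀ (LeafSupport.mkN (LeafSupport.cm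 l)) μtop κtop) (canon₂₈ (LeafSupport.mkN (LeafSupport.cm l)) μtop κtop) True).MTWinf) ∧ (canon₉₁W (LeafSupport.mkN (LeafSupport.cm l)) (canon₁₉ (LeafSupport.mkN (LeafSupport.cm l)) μtop κtop) (canon₂₀ (LeafSupport.mkN (LeafSupport.cm l)) μtop κtop) (canon₂₈ (LeafSupport.mkN (LeafSupport.cm l)) μtop κtop) True).MTWlgc :=
  have cmod := LeafSupport.countermodel l
  have nb := not_B_cm l
  ⟨cmod.1, cmod.2.1, cmod.2.2.1,
    ⟨canon_implications _ _ _, canon_implications₁₉ _ _ _, canon_implications₂₀ _ _ _, canon_implications₂₈ _ _ _, canon_implications₉₁W _ _ _ _ _⟩,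
    ⟨fun h => nb h.1, fun h => nb h.1.1, fun h => nb h.1, fun h => nb h.1.1⟩, True.intro⟩

/-- THE CONDUIT ROWS ARE LOAD-BEARING AS TYPED (reading-level separation at the top, node granted; the tranche-91 edges hold over each denied assignment; the denied readings
are those of `DownstreamSupport2.lean` / `DownstreamSupport3.lean`): (a) C180 DENIED (`canon₁₉noC180`, `canon₂₈noC180`; C182 read at the top) ⇒ all four statements FAIL;
(b) C182 DENIED (`canon₂₀no`) ⇒ Proposition 6.2.3 and Theorem 1.3.1 FAIL, Proposition 7.2.3 and Theorem 1.3.2 HOLD; (c) C191 DENIED (`canon₂₈noC191`) ⇒ Theorem 1.3.1 alone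
FAILS, the three others HOLD. [cite: ManjiThogersenWu2026Parabolic, Prop. 6.2.3, Prop. 6.3.2, §7.2 (separating models; bookkeeping proved here)] -/
theorem c91_conduits_denied_top :
    (Implications91 νtop (canon₁₉noC180 μtop κtop) (canon₂₀ νtop μtop κtop) (canon₂₈noC180 νtop μtop κtop) (canon₉₁W νtop (canon₁₉noC180 μtop κtop) (canon₂₀ νtop μtop κtop) (canon₂₈noC180 νtop μtop κtop) True) ∧
        ¬ (canon₉₁W νtop (canon₁₉noC180 μtop κtop) (canon₂₀ νtop μtop κtop) (canon₂₈noC180 νtop μtop κtop) True).MTWprop623 ∧ ¬ (canon₉₁W νtop (canon₁₉noC180 μtop κtop) (canon₂₀ νtop μtop κtop) (canon₂₈noC180 νtop μtop κtop) True).MTWfs ∧ ¬ (canon₉₁W νtop (canon₁₉noC180 μtop κtop) (canon₂₀ νtop μtop κtop) (canon₂₈noC180 νtop μtop κtop) True).MTWprop723 ∧ ¬ (canon₉₁W νtop (canon₁₉noC180 μtop κtop) (canon₂₀ νtop μtop κtop) (canon₂₈noC180 νtop μtop κtop) True).MTWinf) ∧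
      (Implications91 νtop (canon₁₉ νtop μtop κtop) canon₂₀no (canon₂₈ νtop μtop κtop) (canon₉₁W νtop (canon₁₉ νtop μtop κtop) canon₂₀no (canon₂₈ νtop μtop κtop) True) ∧
        ¬ (canon₉₁W νtop (canon₁₉ νtop μtop κtop) canon₂₀no (canon₂₈ νtop μtop κtop) True).MTWprop623 ∧ ¬ (canon₉₁W νtop (canon₁₉ νtop μtop κtop) canon₂₀no (canon₂₈ νtop μtop κtop) True).MTWfs ∧ (canon₉₁W νtop (canon₁₉ νtop μtop κtop) canon₂₀no (canon₂₈ νtop μtop κtop) True).MTWprop723 ∧ (canon₉₁W νtop (canon₁₉ νtop μtop κtop) canon₂₀no (canon₂₈ νtop μtop κtop) True).MTWinf) ∧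
      (Implications91 νtop (canon₁₉ νtop μtop κtop) (canon₂₀ νtop μtop κtop) (canon₂₈noC191 νtop μtop κtop) (canon₉₁W νtop (canon₁₉ νtop μtop κtop) (canon₂₀ νtop μtop κtop) (canon₂₈noC191 νtop μtop κtop) True) ∧
        ¬ (canon₉₁W νtop (canon₁₉ νtop μtop κtop) (canon₂₀ νtop μtop κtop) (canon₂₈noC191 νtop μtop κtop) True).MTWfs ∧ (canon₉₁W νtop (canon₁₉ νtop μtop κtop) (canon₂₀ νtop μtop κtop) (canon₂₈noC191 νtop μtop κtop) True).MTWprop623 ∧ (canon₉₁W νtop (canon₁₉ νtop μtop κtop) (canon₂₀ νtop μtop κtop) (canon₂₈noC191 νtop μtop κtop) True).MTWprop723 ∧ (canon₉₁W νtop (canon₁₉ νtop μtop κtop) (canon₂₀ νtop μtop κtop) (canon₂₈noC191 νtop μtop κtop) True).MTWinf) :=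
  have b : ∀ N, νtop.Everything N := bookInputs_top.everything
  ⟨⟨canon_implications₉₁W _ _ _ _ _, fun h => h.1, fun h => h.1.1, fun h => h.2.1, fun h => h.1.2.1⟩,
    ⟨canon_implications₉₁W _ _ _ _ _, fun h => h.2, fun h => h.1.2, ⟨b, b, True.intro⟩, ⟨b, b, True.intro⟩, True.intro⟩,
    ⟨canon_implications₉₁W _ _ _ _ _, fun h => h.2, ⟨⟨b, b, b⟩, ⟨b, b, True.intro⟩, ⟨b, b, True.intro⟩, True.intro⟩⟩⟩

/-- UNITARY SIDE: in each of Mok's 29 countermodels (KMSW = `κnoMok`) and in each of KMSW's countermodels, the book at the all-ones assignment (canonical readings over it, node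
granted), all four typed statements HOLD — no statement of Mok 2015 or KMSW occurs in the tranche's edges (the unitary classification is not used by the paper).
[cite: ManjiThogersenWu2026Parabolic, Thms 1.3.1, 1.3.2 (bookkeeping proved here)] -/
theorem c91_unitary_independent (l : Mok2015.LeafSupport.Leaf) (l' : KMSW2014.LeafSupport.Leaf) :
    ((canon₉₁W νtop (canon₁₉ νtop (Mok2015.LeafSupport.mkN (Mok2015.LeafSupport.cm l)) κnoMok) (canon₂₀ νtop (Mok2015.LeafSupport.mkN (Mok2015.LeafSupport.cm l)) κnoMok) (canon₂₈ νtop (Mok2015.LeafSupport.mkN (Mok2015.LeafSupport.cm l)) κnoMok) True).MTWprop623 ∧ (canon₉₁W νtop (canon₁₉ νtop (Mok2015.LeafSupport.mkN (Mok2015.LeafSupport.cm l)) κnoMok) (canon₂₀ νtop (Mok2015.LeafSupport.mkN (Mok2015.LeafSupport.cm l)) κnoMok) (canon₂₈ νtop (Mok2015.LeafSupport.mkN (Mok2015.LeafSupport.cm l)) κnoMok) True).MTWfs ∧ (canon₉₁W νtop (canon₁₉ νtop (Mok2015.LeafSupport.mkN (Mok2015.LeafSupport.cm l)) κnoMok)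 (canon₂₀ νtop (Mok2015.LeafSupport.mkN (Mok2015.LeafSupport.cm l)) κnoMok) (canon₂₈ νtop (Mok2015.LeafSupport.mkN (Mok2015.LeafSupport.cm l)) κnoMok) True).MTWprop723 ∧ (canon₉₁W νtop (canon₁₉ νtop (Mok2015.LeafSupport.mkN (Mok2015.LeafSupport.cm l)) κnoMok) (canon₂₀ νtop (Mok2015.LeafSupport.mkN (Mok2015.LeafSupport.cm l)) κnoMok) (canon₂₈ νtop (Mok2015.LeafSupport.mkN (Mok2015.LeafSupport.cm l)) κnoMok) True).MTWinf) ∧ ((canon₉₁W νtop (canon₁₉ νtop μtop (KMSW2014.LeafSupport.mkN (KMSW2014.LeafSupport.cm l'))) (canon₂₀ νtop μtop (KMSW2014.LeafSupport.mkN (KMSW2014.LeafSupport.cm l'))) (canon₂₈ νtop μtop (KMSW2014.LeafSupport.mkN (KMSW2014.LeafSupport.cm l'))) True).MTWprop623 ∧ (canon₉₁W νtop (canon₁₉ νtop μtop (KMSW2014.LeafSupport.mkN (KMSW2014.LeafSupport.cm l'))) (canon₂₀ νtop μtop (KMSW2014.LeafSupport.mkN (KMSW2014.LeafSupport.cm l')))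 (canon₂₈ νtop μtop (KMSW2014.LeafSupport.mkN (KMSW2014.LeafSupport.cm l'))) True).MTWfs ∧ (canon₉₁W νtop (canon₁₉ νtop μtop (KMSW2014.LeafSupport.mkN (KMSW2014.LeafSupport.cm l'))) (canon₂₀ νtop μtop (KMSW2014.LeafSupport.mkN (KMSW2014.LeafSupport.cm l'))) (canon₂₈ νtop μtop (KMSW2014.LeafSupport.mkN (KMSW2014.LeafSupport.cm l'))) True).MTWprop723 ∧ (canon₉₁W νtop (canon₁₉ νtop μtop (KMSW2014.LeafSupport.mkN (KMSW2014.LeafSupport.cm l'))) (canon₂₀ νtop μtop (KMSW2014.LeafSupport.mkN (KMSW2014.LeafSupport.cm l'))) (canon₂₈ νtop μtop (KMSW2014.LeafSupport.mkN (KMSW2014.LeafSupport.cm l'))) True).MTWinf) :=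
  have b : ∀ N, νtop.Everything N := bookInputs_top.everything
  ⟨⟨⟨b, b, b⟩, ⟨⟨b, b, b⟩, b, b⟩, ⟨b, b, True.intro⟩, ⟨⟨b, b, True.intro⟩, True.intro⟩⟩,
    ⟨⟨b, b, b⟩, ⟨⟨b, b, b⟩, b, b⟩, ⟨b, b, True.intro⟩, ⟨⟨b, b, True.intro⟩, True.intro⟩⟩⟩

/-- THE NINETY-FIRST TRANCHE REGRADED, in one statement: (i) at the top all five hold; (ii) node denied: the finite-slope statements hold, the infinite-slope ones fail; (iii) in
the book countermodel of ANY leaf all four typed statements fail (the node holding); (iv) C180 denied: all four fail; C182 denied: the finite-slope pair fails, the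
infinite-slope pair holds; C191 denied: Theorem 1.3.1 alone fails; (v) in every Mok / KMSW countermodel (book at the top) all four hold.  Supports: book 24 for the finite-slope
pair (through C180, C182, C191), book 24 ∪ {Hypothesis 1} for the infinite-slope pair; nothing of Mok 2015 or KMSW. [cite: ManjiThogersenWu2026Parabolic, Thms 1.3.1, 1.3.2, Props 6.2.3, 7.2.3 (bookkeeping proved here)] -/
theorem c91_regraded :
    ((canon₉₁W νtop (canon₁₉ νtop μtop κtop) (canon₂₀ νtop μtop κtop) (canon₂₈ νtop μtop κtop) True).MTWlgc ∧ (canon₉₁W νtop (canon₁₉ νtop μtop κtop) (canon₂₀ νtop μtop κtop) (canon₂₈ νtop μtop κtop) True).MTWprop623 ∧ (canon₉₁W νtop (canon₁₉ νtop μtop κtop) (canon₂₀ νtop μtop κtop) (canon₂₈ νtop μtop κtop) True).MTWfs ∧ (canon₉₁W νtop (canon₁₉ νtop μtop κtop) (canon₂₀ νtop μtop κtop) (canon₂₈ νtop μtop κtop) True).MTWprop723 ∧ (canon₉₁W νtop (canon₁₉ νtop μtop κtop) (canon₂₀ νtop μtop κtop) (canon₂₈ νtop μtop κtop) True).MTWinf)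 ∧
      ((canon₉₁W νtop (canon₁₉ νtop μtop κtop) (canon₂₀ νtop μtop κtop) (canon₂₈ νtop μtop κtop) False).MTWfs ∧ ¬ (canon₉₁W νtop (canon₁₉ νtop μtop κtop) (canon₂₀ νtop μtop κtop) (canon₂₈ νtop μtop κtop) False).MTWinf) ∧
      (∀ l : LeafSupport.Leaf, ¬ (LeafSupport.mkN (LeafSupport.cm l)).leaf l ∧ ¬ (canon₉₁W (LeafSupport.mkN (LeafSupport.cm l)) (canon₁₉ (LeafSupport.mkN (LeafSupport.cm l)) μtop κtop) (canon₂₀ (LeafSupport.mkN (LeafSupport.cm l)) μtop κtop) (canon₂₈ (LeafSupport.mkN (LeafSupport.cm l)) μtop κtop) True).MTWprop623 ∧ ¬ (canon₉₁W (LeafSupport.mkN (LeafSupport.cm l)) (canon₁₉ (LeafSupport.mkN (LeafSupport.cm l)) μtop κtop) (canon₂₀ (LeafSupport.mkN (LeafSupport.cm l)) μtop κtop) (canon₂₈ (LeafSupport.mkN (LeafSupport.cm l)) μtop κtop) True).MTWfs ∧ ¬ (canon₉₁W (LeafSupport.mkN (LeafSupport.cm l)) (canon₁₉ (LeafSupport.mkN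 (LeafSupport.cm l)) μtop κtop) (canon₂₀ (LeafSupport.mkN (LeafSupport.cm l)) μtop κtop) (canon₂₈ (LeafSupport.mkN (LeafSupport.cm l)) μtop κtop) True).MTWprop723 ∧ ¬ (canon₉₁W (LeafSupport.mkN (LeafSupport.cm l)) (canon₁₉ (LeafSupport.mkN (LeafSupport.cm l)) μtop κtop) (canon₂₀ (LeafSupport.mkN (LeafSupport.cm l)) μtop κtop) (canon₂₈ (LeafSupport.mkN (LeafSupport.cm l)) μtop κtop) True).MTWinf) ∧
      (¬ (canon₉₁W νtop (canon₁₉noC180 μtop κtop) (canon₂₀ νtop μtop κtop) (canon₂₈noC180 νtop μtop κtop) True).MTWfs ∧ ¬ (canon₉₁W νtop (canon₁₉noC180 μtop κtop) (canon₂₀ νtop μtop κtop) (canon₂₈noC180 νtop μtop κtop) True).MTWinf ∧ ¬ (canon₉₁W νtop (canon₁₉ νtop μtop κtop) canon₂₀no (canon₂₈ νtop μtop κtop) True).MTWfs ∧ (canon₉₁W νtop (canon₁₉ νtop μtop κtop) canon₂₀no (canon₂₈ νtop μtop κtop) True).MTWinf ∧ ¬ (canon₉₁W νtop (canon₁₉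 νtop μtop κtop) (canon₂₀ νtop μtop κtop) (canon₂₈noC191 νtop μtop κtop) True).MTWfs ∧ (canon₉₁W νtop (canon₁₉ νtop μtop κtop) (canon₂₀ νtop μtop κtop) (canon₂₈noC191 νtop μtop κtop) True).MTWinf) ∧
      (∀ (l : Mok2015.LeafSupport.Leaf) (l' : KMSW2014.LeafSupport.Leaf), (canon₉₁W νtop (canon₁₉ νtop (Mok2015.LeafSupport.mkN (Mok2015.LeafSupport.cm l)) κnoMok) (canon₂₀ νtop (Mok2015.LeafSupport.mkN (Mok2015.LeafSupport.cm l)) κnoMok) (canon₂₈ νtop (Mok2015.LeafSupport.mkN (Mok2015.LeafSupport.cm l)) κnoMok) True).MTWfs ∧ (canon₉₁W νtop (canon₁₉ νtop (Mok2015.LeafSupport.mkN (Mok2015.LeafSupport.cm l)) κnoMok) (canon₂₀ νtop (Mok2015.LeafSupport.mkN (Mok2015.LeafSupport.cm l)) κnoMok) (canon₂₈ νtop (Mok2015.LeafSupport.mkN (Mok2015.LeafSupport.cm l)) κnoMok) True).MTWinf ∧ (canon₉₁W νtop (canon₁₉ νtop μtop (KMSW2014.LeafSupport.mkN (KMSW2014.LeafSupport.cm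 l'))) (canon₂₀ νtop μtop (KMSW2014.LeafSupport.mkN (KMSW2014.LeafSupport.cm l'))) (canon₂₈ νtop μtop (KMSW2014.LeafSupport.mkN (KMSW2014.LeafSupport.cm l'))) True).MTWfs ∧ (canon₉₁W νtop (canon₁₉ νtop μtop (KMSW2014.LeafSupport.mkN (KMSW2014.LeafSupport.cm l'))) (canon₂₀ νtop μtop (KMSW2014.LeafSupport.mkN (KMSW2014.LeafSupport.cm l'))) (canon₂₈ νtop μtop (KMSW2014.LeafSupport.mkN (KMSW2014.LeafSupport.cm l'))) True).MTWinf) :=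
  ⟨ninetyfirst_holds_top,
    ⟨c91_node_denied_top.2.1.2, c91_node_denied_top.2.2.2.2⟩,
    fun l => have h := c91_book_cm l
      ⟨h.2.2.1, h.2.2.2.2.1⟩,
    ⟨c91_conduits_denied_top.1.2.2.1, c91_conduits_denied_top.1.2.2.2.2, c91_conduits_denied_top.2.1.2.2.1, c91_conduits_denied_top.2.1.2.2.2.2,
      c91_conduits_denied_top.2.2.2.1, c91_conduits_denied_top.2.2.2.2.2.2⟩,
    fun l l' => have h := c91_unitary_independent l l'
      ⟨h.1.2.1, h.1.2.2.2, h.2.2.1, h.2.2.2.2⟩⟩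

/-! ## 95. Ninety-second tranche (v4 of this file, after NEW `Downstream27.lean` v1; unit `pub-arthur-down-g37`): supports of NEW rows C231 `RXmult1` (node) /
`RXperiod` / `RXpadic`, C232 `LZ2coh` / `LZ2padicL` / `LZ2BK`, C233 `GRetale` / `GRpadicL` (second order), C234 `PTresidual` (premise-free) / `PThecke` / `PTpacket`;
see the module docstring for the summary. -/

section Canon92

variable (ν : Nodes) (μ : Mok2015.Nodes) (κ : KMSW2014.Nodes)

/-- The parametrised canonical reading of the ninety-second tranche: the value `gt` of row A4 (`Consumers.GeeTaibi`) is the parameter; C231's node, period formulae and p-adic statements := Mok ∧ KMSW's scope; C232's Proposition 2.7.2, p-adic L-function and Bloch – Kato theorem and C233's two statements := book ∧ gt; C234's Hecke bounds and packet statements := book; C234's control := True. [cite: XuRuichen2024KlingenGGP, Thms 2.7, 5.1, 3.7; LoefflerZerbes2021GSp4GL2, Prop. 2.7.2, Thms 10.7.3, 11.7.1; GrahamRockwood2024NearlyColeman, Thms 1-3; PaniaguaTaboada2011SOeven, Thms 2.8, 4.3, 4.4, 7.1, 7.2 (canonical model; bookkeeping)] [claim: KalethaMinguezShinWhite2014,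 under-review] -/
abbrev canon₉₂W (gt : Prop) : Consumers92 where
  RXmult1 := (∀ N, μ.Everything N) ∧ (∀ N, κ.Scope N)
  RXperiod := (∀ N, μ.Everything N) ∧ (∀ N, κ.Scope N)
  RXpadic := (∀ N, μ.Everything N) ∧ (∀ N, κ.Scope N)
  LZ2coh := (∀ N, ν.Everything N) ∧ gt
  LZ2padicL := (∀ N, ν.Everything N) ∧ gt
  LZ2BK := (∀ N, ν.Everything N) ∧ gt
  GRetale := (∀ N, ν.Everything N) ∧ gt
  GRpadicL := (∀ N, ν.Everything N) ∧ gt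
  PTresidual := True
  PThecke := ∀ N, ν.Everything N
  PTpacket := ∀ N, ν.Everything N

/-- Every ninety-second-tranche edge holds in the parametrised reading, for arbitrary ν, μ, κ and EVERY assignment `c` of tranche 1 (the parameter being `c.GeeTaibi`). [cite: XuRuichen2024KlingenGGP, Thms 2.7, 5.1, 3.7; LoefflerZerbes2021GSp4GL2, Prop. 2.7.2, Thm 11.7.1; GrahamRockwood2024NearlyColeman, Thms 1-3; PaniaguaTaboada2011SOeven, Thms 4.3, 7.2 (bookkeeping proved here)] [claim: KalethaMinguezShinWhite2014, under-review] -/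
theorem canon_implications₉₂W (c : Consumers) : Implications92 ν μ κ c (canon₉₂W ν μ κ c.GeeTaibi) where
  rxMult1 := fun m s => ⟨m, s⟩
  rxPeriod := fun h => h
  rxPadic := fun h _ => h
  lz2Coh := fun b g => ⟨b, g⟩
  lz2PadicL := fun h => h
  lz2BK := fun h _ => h
  grEtale := fun h => h
  grPadicL := fun h => h
  ptResidual := True.intro
  ptHecke := fun b => b
  ptPacket := fun b => b

/-- In the parametrised reading all eleven statements hold as soon as Mok's outputs and KMSW's proved scope hold at all ranks, the book holds at all ranks and row A4 holds. [cite: XuRuichen2024KlingenGGP, Thm 3.7; LoefflerZerbes2021GSp4GL2, Thm 11.7.1; GrahamRockwood2024NearlyColeman, Thm 1; PaniaguaTaboada2011SOeven, Thm 7.2 (bookkeeping proved here)] [claim: KalethaMinguezShinWhite2014, under-review] -/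
theorem c92_all_of (gt : Prop) (hμ : ∀ N, μ.Everything N) (hκ : ∀ N, κ.Scope N) (hν : ∀ N, ν.Everything N) (hg : gt) :
    ((canon₉₂W ν μ κ gt).RXmult1 ∧ (canon₉₂W ν μ κ gt).RXperiod ∧ (canon₉₂W ν μ κ gt).RXpadic ∧ (canon₉₂W ν μ κ gt).LZ2coh ∧ (canon₉₂W ν μ κ gt).LZ2padicL ∧ (canon₉₂W ν μ κ gt).LZ2BK ∧ (canon₉₂W ν μ κ gt).GRetale ∧ (canon₉₂W ν μ κ gt).GRpadicL ∧ (canon₉₂W ν μ κ gt).PTresidual ∧ (canon₉₂W ν μ κ gt).PThecke ∧ (canon₉₂W ν μ κ gt).PTpacket) :=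
  ⟨⟨hμ, hκ⟩, ⟨hμ, hκ⟩, ⟨hμ, hκ⟩, ⟨hν, hg⟩, ⟨hν, hg⟩, ⟨hν, hg⟩, ⟨hν, hg⟩, ⟨hν, hg⟩, True.intro, hν, hν⟩

end Canon92

/-- Row A4 DENIED (`GeeTaibi := False`; the other tranche-1 fields as in `canon` at the top): a reading of `Consumers` used only to deny Gee – Taïbi's classification of GSp_4; no first-tranche edge is claimed for it. [cite: GeeTaibi2019, Thm 7.4.1 (separating model; bookkeeping)] -/
abbrev c₁noA4 : Consumers := { canon νtop μtop κtop with GeeTaibi := False }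

/-- At the top (every input of the book, of Mok and of KMSW — the sequels too —; tranche 1 read canonically) all eleven statements of the tranche hold, through the tranche's
own `ninetysecond_of_leaves`. [cite: XuRuichen2024KlingenGGP, Thm 3.7; LoefflerZerbes2021GSp4GL2, Thm 11.7.1; GrahamRockwood2024NearlyColeman, Thm 1; PaniaguaTaboada2011SOeven, Thm 7.2 (bookkeeping proved here)] [claim: KalethaMinguezShinWhite2014, under-review] -/
theorem ninetysecond_holds_top : ((canon₉₂W νtop μtop κtop (canon νtop μtop κtop).GeeTaibi).RXmult1 ∧ (canon₉₂W νtop μtop κtop (canon νtop μtop κtop).GeeTaibi).RXperiod ∧ (canon₉₂W νtop μtop κtop (canon νtop μtop κtop).GeeTaibi).RXpadic ∧ (canon₉₂W νtop μtop κtop (canon νtop μtop κtop).GeeTaibi).LZ2coh ∧ (canon₉₂W νtop μtop κtop (canon νtop μtop κtop).GeeTaibi).LZ2padicL ∧ (canon₉₂W νtop μtop κtop (canon νtop μtop κtop).GeeTaibi).LZ2BK ∧ (canon₉₂W νtop μtop κtop (canon νtop μtop κtop).GeeTaibi).GRetale ∧ (canon₉₂W νtop μtop κtop (canon νtop μtop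 κtop).GeeTaibi).GRpadicL ∧ (canon₉₂W νtop μtop κtop (canon νtop μtop κtop).GeeTaibi).PTresidual ∧ (canon₉₂W νtop μtop κtop (canon νtop μtop κtop).GeeTaibi).PThecke ∧ (canon₉₂W νtop μtop κtop (canon νtop μtop κtop).GeeTaibi).PTpacket) :=
  ninetysecond_of_leaves (canon_implications₉₂W νtop μtop κtop (canon νtop μtop κtop)) (canon_implications νtop μtop κtop) bookInputs_top mokInputs_top (kmswInputs_top μtop).1

/-- BOOK SIDE, EXACT SUPPORT: in each of the 24 book countermodels (book edge systems and every other book leaf hold, the removed leaf fails; Mok and KMSW at the all-ones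
assignments; tranche 1 read canonically over it, all its edges and all tranche-92 edges valid) the five GSp_4 statements of rows C232 / C233 and the two book statements
of row C234 ALL FAIL, while row C231's three unitary statements and row C234's control HOLD — every one of the 24 book leaves is load-bearing for C232–C234 (directly and
through A4), none for C231. [cite: LoefflerZerbes2021GSp4GL2, Prop. 2.7.2 (« By Arthur's classification »); GrahamRockwood2024NearlyColeman, §8 (« supplemented with [LZBK21] »); PaniaguaTaboada2011SOeven, Thm 7.2 (« the results announced in his article [Ar2] »); XuRuichen2024KlingenGGP, p0014:L46, with Arthur2013 §1.5 (bookkeeping proved here)] [claim: KalethaMinguezShinWhite2014, under-review] -/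
theorem c92_book_cm (l : LeafSupport.Leaf) :
    LeafSupport.Systems (LeafSupport.mkN (LeafSupport.cm l)) (LeafSupport.mkW (LeafSupport.cm l)) (LeafSupport.mkG (LeafSupport.cm l)) ∧
      (∀ l', l' ≠ l → (LeafSupport.mkN (LeafSupport.cm l)).leaf l') ∧ ¬ (LeafSupport.mkN (LeafSupport.cm l)).leaf l ∧
      (Implications (LeafSupport.mkN (LeafSupport.cm l)) μtop κtop (canon (LeafSupport.mkN (LeafSupport.cm l)) μtop κtop) ∧
        Implications92 (LeafSupport.mkN (LeafSupport.cm l)) μtop κtop (canon (LeafSupport.mkN (LeafSupport.cm l)) μtop κtop) (canon₉₂W (LeafSupport.mkN (LeafSupport.cm l)) μtop κtop (canon (LeafSupport.mkN (LeafSupport.cm l)) μtop κtop).GeeTaibi)) ∧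
      (¬ (canon₉₂W (LeafSupport.mkN (LeafSupport.cm l)) μtop κtop (canon (LeafSupport.mkN (LeafSupport.cm l)) μtop κtop).GeeTaibi).LZ2coh ∧ ¬ (canon₉₂W (LeafSupport.mkN (LeafSupport.cm l)) μtop κtop (canon (LeafSupport.mkN (LeafSupport.cm l)) μtop κtop).GeeTaibi).LZ2padicL ∧ ¬ (canon₉₂W (LeafSupport.mkN (LeafSupport.cm l)) μtop κtop (canon (LeafSupport.mkN (LeafSupport.cm l)) μtop κtop).GeeTaibi).LZ2BK ∧ ¬ (canon₉₂W (LeafSupport.mkN (LeafSupport.cm l)) μtop κtop (canon (LeafSupport.mkN (LeafSupport.cm l)) μtop κtop).GeeTaibi).GRetale ∧ ¬ (canon₉₂W (LeafSupport.mkN (LeafSupport.cm l)) μtop κtop (canon (LeafSupport.mkN (LeafSupport.cm l)) μtop κtop).GeeTaibi).GRpadicL ∧ ¬ (canon₉₂W (LeafSupport.mkN (LeafSupport.cm l)) μtop κtop (canon (LeafSupport.mkN (LeafSupport.cm l)) μtop κtop).GeeTaibi).PThecke ∧ ¬ (canon₉₂W (LeafSupport.mkN (LeafSupport.cm l)) μtop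 κtop (canon (LeafSupport.mkN (LeafSupport.cm l)) μtop κtop).GeeTaibi).PTpacket) ∧
      ((canon₉₂W (LeafSupport.mkN (LeafSupport.cm l)) μtop κtop (canon (LeafSupport.mkN (LeafSupport.cm l)) μtop κtop).GeeTaibi).RXmult1 ∧ (canon₉₂W (LeafSupport.mkN (LeafSupport.cm l)) μtop κtop (canon (LeafSupport.mkN (LeafSupport.cm l)) μtop κtop).GeeTaibi).RXperiod ∧ (canon₉₂W (LeafSupport.mkN (LeafSupport.cm l)) μtop κtop (canon (LeafSupport.mkN (LeafSupport.cm l)) μtop κtop).GeeTaibi).RXpadic ∧ (canon₉₂W (LeafSupport.mkN (LeafSupport.cm l)) μtop κtop (canon (LeafSupport.mkN (LeafSupport.cm l)) μtop κtop).GeeTaibi).PTresidual) :=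
  have cmod := LeafSupport.countermodel l
  have nb := not_B_cm l
  have m : ∀ N, μtop.Everything N := mokInputs_top.everything
  have s : ∀ N, κtop.Scope N := (kmswInputs_top μtop).1.scope mokInputs_top
  ⟨cmod.1, cmod.2.1, cmod.2.2.1, ⟨canon_implications _ _ _, canon_implications₉₂W _ _ _ _⟩,
    ⟨fun h => nb h.1, fun h => nb h.1, fun h => nb h.1, fun h => nb h.1, fun h => nb h.1, fun h => nb h, fun h => nb h⟩,
    ⟨⟨m, s⟩, ⟨m, s⟩, ⟨m, s⟩, True.intro⟩⟩

/-- ROW A4 IS LOAD-BEARING EXACTLY AS TYPED (reading-level separation at the top): with Gee – Taïbi's classification DENIED (`c₁noA4`) every tranche-92 edge holds, the five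
GSp_4 statements of C232 / C233 FAIL, and C231's three statements, C234's two book statements and the control HOLD. [cite: LoefflerZerbes2021GSp4GL2, Prop. 2.7.2; GeeTaibi2019, Thm 7.4.1 (separating model; bookkeeping proved here)] [claim: KalethaMinguezShinWhite2014, under-review] -/
theorem c92_A4_denied_top :
    Implications92 νtop μtop κtop c₁noA4 (canon₉₂W νtop μtop κtop c₁noA4.GeeTaibi) ∧
      (¬ (canon₉₂W νtop μtop κtop c₁noA4.GeeTaibi).LZ2coh ∧ ¬ (canon₉₂W νtop μtop κtop c₁noA4.GeeTaibi).LZ2padicL ∧ ¬ (canon₉₂W νtop μtop κtop c₁noA4.GeeTaibi).LZ2BK ∧ ¬ (canon₉₂W νtop μtop κtop c₁noA4.GeeTaibi).GRetale ∧ ¬ (canon₉₂W νtop μtop κtop c₁noA4.GeeTaibi).GRpadicL) ∧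
      ((canon₉₂W νtop μtop κtop c₁noA4.GeeTaibi).RXmult1 ∧ (canon₉₂W νtop μtop κtop c₁noA4.GeeTaibi).PThecke ∧ (canon₉₂W νtop μtop κtop c₁noA4.GeeTaibi).PTpacket ∧ (canon₉₂W νtop μtop κtop c₁noA4.GeeTaibi).PTresidual) :=
  have b : ∀ N, νtop.Everything N := bookInputs_top.everything
  have m : ∀ N, μtop.Everything N := mokInputs_top.everything
  have s : ∀ N, κtop.Scope N := (kmswInputs_top μtop).1.scope mokInputs_top
  ⟨canon_implications₉₂W _ _ _ _, ⟨fun h => h.2, fun h => h.2, fun h => h.2, fun h => h.2, fun h => h.2⟩, ⟨⟨m, s⟩, b, b, True.intro⟩⟩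

/-- MOK SIDE, EXACT SUPPORT AS TYPED: in the Mok countermodel of ANY leaf `l` (book and KMSW at the top; tranche 1 read canonically over it; every edge valid) row C231's three
statements — the multiplicity-one node, the period formulae, the p-adic statements — FAIL, and the eight statements of rows C232 / C233 / C234 HOLD. [cite: XuRuichen2024KlingenGGP, p0014:L46 (« [MR3338302, kaletha2014…] »); Mok2012, Thm 2.5.2 (bookkeeping proved here)] [claim: KalethaMinguezShinWhite2014, under-review] -/
theorem c92_mok_cm (l : Mok2015.LeafSupport.Leaf) :
    ¬ (Mok2015.LeafSupport.mkN (Mok2015.LeafSupport.cm l)).leaf l ∧ Implications92 νtop (Mok2015.LeafSupport.mkN (Mok2015.LeafSupport.cm l)) κtop (canon νtop (Mok2015.LeafSupport.mkN (Mok2015.LeafSupport.cm l)) κtop) (canon₉₂W νtop (Mok2015.LeafSupport.mkN (Mok2015.LeafSupport.cm l)) κtop (canon νtop (Mok2015.LeafSupport.mkN (Mok2015.LeafSupport.cm l)) κtop).GeeTaibi) ∧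
      (¬ (canon₉₂W νtop (Mok2015.LeafSupport.mkN (Mok2015.LeafSupport.cm l)) κtop (canon νtop (Mok2015.LeafSupport.mkN (Mok2015.LeafSupport.cm l)) κtop).GeeTaibi).RXmult1 ∧ ¬ (canon₉₂W νtop (Mok2015.LeafSupport.mkN (Mok2015.LeafSupport.cm l)) κtop (canon νtop (Mok2015.LeafSupport.mkN (Mok2015.LeafSupport.cm l)) κtop).GeeTaibi).RXperiod ∧ ¬ (canon₉₂W νtop (Mok2015.LeafSupport.mkN (Mok2015.LeafSupport.cm l)) κtop (canon νtop (Mok2015.LeafSupport.mkN (Mok2015.LeafSupport.cm l)) κtop).GeeTaibi).RXpadic) ∧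
      ((canon₉₂W νtop (Mok2015.LeafSupport.mkN (Mok2015.LeafSupport.cm l)) κtop (canon νtop (Mok2015.LeafSupport.mkN (Mok2015.LeafSupport.cm l)) κtop).GeeTaibi).LZ2BK ∧ (canon₉₂W νtop (Mok2015.LeafSupport.mkN (Mok2015.LeafSupport.cm l)) κtop (canon νtop (Mok2015.LeafSupport.mkN (Mok2015.LeafSupport.cm l)) κtop).GeeTaibi).GRpadicL ∧ (canon₉₂W νtop (Mok2015.LeafSupport.mkN (Mok2015.LeafSupport.cm l)) κtop (canon νtop (Mok2015.LeafSupport.mkN (Mok2015.LeafSupport.cm l)) κtop).GeeTaibi).PThecke ∧ (canon₉₂W νtop (Mok2015.LeafSupport.mkN (Mok2015.LeafSupport.cm l)) κtop (canon νtop (Mok2015.LeafSupport.mkN (Mok2015.LeafSupport.cm l)) κtop).GeeTaibi).PTpacket ∧ (canon₉₂W νtop (Mok2015.LeafSupport.mkN (Mok2015.LeafSupport.cm l)) κtop (canon νtop (Mok2015.LeafSupport.mkN (Mok2015.LeafSupport.cm l)) κtop).GeeTaibi).PTresidual) :=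
  have cmod := Mok2015.LeafSupport.countermodel l
  have nm := not_M_cm l
  have b : ∀ N, νtop.Everything N := bookInputs_top.everything
  have g : (canon νtop (Mok2015.LeafSupport.mkN (Mok2015.LeafSupport.cm l)) κtop).GeeTaibi := b
  ⟨cmod.2.2.1, canon_implications₉₂W _ _ _ _, ⟨fun h => nm h.1, fun h => nm h.1, fun h => nm h.1⟩, ⟨⟨b, g⟩, ⟨b, g⟩, b, b, True.intro⟩⟩

/-- KMSW SIDE, THE IMPORT: with the book and Mok at the top and KMSW's Mok import DENIED (`κnoMok`: the proved scope fails at every rank) every tranche-92 edge holds, row C231's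
three statements FAIL and the eight others HOLD. [cite: XuRuichen2024KlingenGGP, p0014:L46 (bookkeeping proved here)] [claim: KalethaMinguezShinWhite2014, under-review] -/
theorem c92_kmsw_importDenied :
    (∀ N, ¬ κnoMok.Scope N) ∧ Implications92 νtop μtop κnoMok (canon νtop μtop κnoMok) (canon₉₂W νtop μtop κnoMok (canon νtop μtop κnoMok).GeeTaibi) ∧
      (¬ (canon₉₂W νtop μtop κnoMok (canon νtop μtop κnoMok).GeeTaibi).RXmult1 ∧ ¬ (canon₉₂W νtop μtop κnoMok (canon νtop μtop κnoMok).GeeTaibi).RXperiod ∧ ¬ (canon₉₂W νtop μtop κnoMok (canon νtop μtop κnoMok).GeeTaibi).RXpadic) ∧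
      ((canon₉₂W νtop μtop κnoMok (canon νtop μtop κnoMok).GeeTaibi).LZ2BK ∧ (canon₉₂W νtop μtop κnoMok (canon νtop μtop κnoMok).GeeTaibi).GRpadicL ∧ (canon₉₂W νtop μtop κnoMok (canon νtop μtop κnoMok).GeeTaibi).PTpacket) :=
  have ns : ∀ N, ¬ κnoMok.Scope N := κnoMok_facts.2.2.2.2.2.1
  have b : ∀ N, νtop.Everything N := bookInputs_top.everything
  have g : (canon νtop μtop κnoMok).GeeTaibi := b
  ⟨ns, canon_implications₉₂W _ _ _ _, ⟨fun h => ns 0 (h.2 0), fun h => ns 0 (h.2 0), fun h => ns 0 (h.2 0)⟩, ⟨⟨b, g⟩, ⟨b, g⟩, b⟩⟩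

/-- KMSW SIDE, THE SEQUELS ARE NOT NEEDED: in KMSW's countermodel of ANY leaf `l` that feeds only the starred statements in full (`l.onlyFull = true`: the unwritten sequels
`KMS_A`, `KMS_B` and `AubertSS`; Mok at the top) every other KMSW leaf holds, `l` fails, the proved scope HOLDS at every rank, every tranche-92 edge holds and row C231's
three statements HOLD — cuspidal base change is a generic parameter, inside the proved scope. [cite: XuRuichen2024KlingenGGP, p0014:L42-46 (« (BC) … cuspidal ») (separating models; bookkeeping proved here)] [claim: KalethaMinguezShinWhite2014, under-review] -/
theorem c92_sequel_cm (l : KMSW2014.LeafSupport.Leaf) (h : l.onlyFull = true) :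
    (∀ l', l' ≠ l → (KMSW2014.LeafSupport.mkN (KMSW2014.LeafSupport.cm l)).leaf l') ∧ ¬ (KMSW2014.LeafSupport.mkN (KMSW2014.LeafSupport.cm l)).leaf l ∧ (∀ N, (KMSW2014.LeafSupport.mkN (KMSW2014.LeafSupport.cm l)).Scope N) ∧
      Implications92 νtop μtop (KMSW2014.LeafSupport.mkN (KMSW2014.LeafSupport.cm l)) (canon νtop μtop (KMSW2014.LeafSupport.mkN (KMSW2014.LeafSupport.cm l))) (canon₉₂W νtop μtop (KMSW2014.LeafSupport.mkN (KMSW2014.LeafSupport.cm l)) (canon νtop μtop (KMSW2014.LeafSupport.mkN (KMSW2014.LeafSupport.cm l))).GeeTaibi) ∧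
      ((canon₉₂W νtop μtop (KMSW2014.LeafSupport.mkN (KMSW2014.LeafSupport.cm l)) (canon νtop μtop (KMSW2014.LeafSupport.mkN (KMSW2014.LeafSupport.cm l))).GeeTaibi).RXmult1 ∧ (canon₉₂W νtop μtop (KMSW2014.LeafSupport.mkN (KMSW2014.LeafSupport.cm l)) (canon νtop μtop (KMSW2014.LeafSupport.mkN (KMSW2014.LeafSupport.cm l))).GeeTaibi).RXperiod ∧ (canon₉₂W νtop μtop (KMSW2014.LeafSupport.mkN (KMSW2014.LeafSupport.cm l)) (canon νtop μtop (KMSW2014.LeafSupport.mkN (KMSW2014.LeafSupport.cm l))).GeeTaibi).RXpadic) :=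
  have cmod := KMSW2014.LeafSupport.countermodel l
  have s : ∀ N, (KMSW2014.LeafSupport.mkN (KMSW2014.LeafSupport.cm l)).Scope N := scope_of_onlyFull l h
  have m : ∀ N, μtop.Everything N := mokInputs_top.everything
  ⟨cmod.2.1, cmod.2.2.1, s, canon_implications₉₂W _ _ _ _, ⟨⟨m, s⟩, ⟨m, s⟩, ⟨m, s⟩⟩⟩

/-- THE NINETY-SECOND TRANCHE REGRADED, in one statement: (i) at the top all eleven hold; (ii) in the book countermodel of any leaf the Bloch – Kato theorem (C232), the
four-variable p-adic L-functions (C233) and Paniagua-Taboada's Hecke bounds / packet description (C234) fail while C231's p-adic L-function holds; (iii) with A4 denied the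
GSp_4 line fails and C234 holds; (iv) in the Mok countermodel of any leaf and (v) with KMSW's Mok import denied C231 fails and the GSp_4 / SO_{2n} rows hold; (vi) in
KMSW's countermodel of each only-full leaf C231 holds. [cite: XuRuichen2024KlingenGGP, Thm 3.7; LoefflerZerbes2021GSp4GL2, Thm 11.7.1; GrahamRockwood2024NearlyColeman, Thm 1; PaniaguaTaboada2011SOeven, Thms 4.4, 7.2 (bookkeeping proved here)] [claim: KalethaMinguezShinWhite2014, under-review] -/
theorem c92_regraded :
    ((canon₉₂W νtop μtop κtop (canon νtop μtop κtop).GeeTaibi).RXpadic ∧ (canon₉₂W νtop μtop κtop (canon νtop μtop κtop).GeeTaibi).LZ2BK ∧ (canon₉₂W νtop μtop κtop (canon νtop μtop κtop).GeeTaibi).GRpadicL ∧ (canon₉₂W νtop μtop κtop (canon νtop μtop κtop).GeeTaibi).PThecke ∧ (canon₉₂W νtop μtop κtop (canon νtop μtop κtop).GeeTaibi).PTpacket) ∧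
      (∀ l : LeafSupport.Leaf, (¬ (LeafSupport.mkN (LeafSupport.cm l)).leaf l) ∧ ¬ (canon₉₂W (LeafSupport.mkN (LeafSupport.cm l)) μtop κtop (canon (LeafSupport.mkN (LeafSupport.cm l)) μtop κtop).GeeTaibi).LZ2BK ∧ ¬ (canon₉₂W (LeafSupport.mkN (LeafSupport.cm l)) μtop κtop (canon (LeafSupport.mkN (LeafSupport.cm l)) μtop κtop).GeeTaibi).GRpadicL ∧ ¬ (canon₉₂W (LeafSupport.mkN (LeafSupport.cm l)) μtop κtop (canon (LeafSupport.mkN (LeafSupport.cm l)) μtop κtop).GeeTaibi).PThecke ∧ ¬ (canon₉₂W (LeafSupport.mkN (LeafSupport.cm l)) μtop κtop (canon (LeafSupport.mkN (LeafSupport.cm l)) μtop κtop).GeeTaibi).PTpacket ∧ (canon₉₂W (LeafSupport.mkN (LeafSupport.cm l)) μtop κtop (canon (LeafSupport.mkN (LeafSupport.cm l)) μtop κtop).GeeTaibi).RXpadic) ∧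
      (¬ (canon₉₂W νtop μtop κtop c₁noA4.GeeTaibi).LZ2BK ∧ ¬ (canon₉₂W νtop μtop κtop c₁noA4.GeeTaibi).GRpadicL ∧ (canon₉₂W νtop μtop κtop c₁noA4.GeeTaibi).PTpacket) ∧
      (∀ l : Mok2015.LeafSupport.Leaf, (¬ (Mok2015.LeafSupport.mkN (Mok2015.LeafSupport.cm l)).leaf l) ∧ ¬ (canon₉₂W νtop (Mok2015.LeafSupport.mkN (Mok2015.LeafSupport.cm l)) κtop (canon νtop (Mok2015.LeafSupport.mkN (Mok2015.LeafSupport.cm l)) κtop).GeeTaibi).RXpadic ∧ (canon₉₂W νtop (Mok2015.LeafSupport.mkN (Mok2015.LeafSupport.cm l)) κtop (canon νtop (Mok2015.LeafSupport.mkN (Mok2015.LeafSupport.cm l)) κtop).GeeTaibi).LZ2BK ∧ (canon₉₂W νtop (Mok2015.LeafSupport.mkN (Mok2015.LeafSupport.cm l)) κtop (canon νtop (Mok2015.LeafSupport.mkN (Mok2015.LeafSupport.cm l)) κtop).GeeTaibi).PTpacket) ∧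
      ((∀ N, ¬ κnoMok.Scope N) ∧ ¬ (canon₉₂W νtop μtop κnoMok (canon νtop μtop κnoMok).GeeTaibi).RXpadic ∧ (canon₉₂W νtop μtop κnoMok (canon νtop μtop κnoMok).GeeTaibi).LZ2BK) ∧
      (∀ l : KMSW2014.LeafSupport.Leaf, l.onlyFull = true → (¬ (KMSW2014.LeafSupport.mkN (KMSW2014.LeafSupport.cm l)).leaf l) ∧ (canon₉₂W νtop μtop (KMSW2014.LeafSupport.mkN (KMSW2014.LeafSupport.cm l)) (canon νtop μtop (KMSW2014.LeafSupport.mkN (KMSW2014.LeafSupport.cm l))).GeeTaibi).RXpadic) :=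
  have t := ninetysecond_holds_top
  ⟨⟨t.2.2.1, t.2.2.2.2.2.1, t.2.2.2.2.2.2.2.1, t.2.2.2.2.2.2.2.2.2.1, t.2.2.2.2.2.2.2.2.2.2⟩,
    fun l => have h := c92_book_cm l
      ⟨h.2.2.1, h.2.2.2.2.1.2.2.1, h.2.2.2.2.1.2.2.2.2.1, h.2.2.2.2.1.2.2.2.2.2.1, h.2.2.2.2.1.2.2.2.2.2.2, h.2.2.2.2.2.2.2.1⟩,
    ⟨c92_A4_denied_top.2.1.2.2.1, c92_A4_denied_top.2.1.2.2.2.2, c92_A4_denied_top.2.2.2.2.1⟩,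
    fun l => have h := c92_mok_cm l
      ⟨h.1, h.2.2.1.2.2, h.2.2.2.1, h.2.2.2.2.2.2.1⟩,
    ⟨c92_kmsw_importDenied.1, c92_kmsw_importDenied.2.2.1.2.2, c92_kmsw_importDenied.2.2.2.1⟩,
    fun l hl => have h := c92_sequel_cm l hl
      ⟨h.2.1, h.2.2.2.2.2.2⟩⟩

/-! ## 96. Ninety-third tranche (v5 of this file, after `Downstream27.lean` v2; unit `pub-arthur-down-g37`): supports of NEW rows C235 `BBKeisen` (second order ⇐ C180)
and C236 `ADrank` (⇐ book ∧ C44 ∧ C182 ∧ C49); see the module docstring for the summary. -/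

section Canon93

variable (ν : Nodes)

/-- The parametrised canonical reading of the ninety-third tranche: the assignments `c₁₉`, `c₂₀`, `c₂₁` of tranches 19 / 20 / 21 are the parameters; C235's section 7 := C180's field; C236's rank statement := book ∧ C44 ∧ C182 ∧ C49. [cite: BergerBrownKlosin2025Klingen, Thm 7.2, Cor. 7.3, Cor. 7.5; AnambyDas2024SKlevel, Lemma 4.3, Thm 4.5, Cor. 1.3 (canonical model; bookkeeping)] -/
abbrev canon₉₃W (c₁₉ : Consumers19) (c₂₀ : Consumers20) (c₂₁ : Consumers21) : Consumers93 where
  BBKeisen := c₁₉.SchmidtParamodular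
  ADrank := (∀ N, ν.Everything N) ∧ c₂₁.PaulSaha ∧ c₂₀.SchmidtCAP ∧ c₂₁.RSYCount

/-- Both ninety-third-tranche edges hold in the parametrised reading, for arbitrary ν and EVERY assignment of tranches 19 / 20 / 21. [cite: BergerBrownKlosin2025Klingen, Thm 7.2; AnambyDas2024SKlevel, Lemma 4.3 (bookkeeping proved here)] -/
theorem canon_implications₉₃W (c₁₉ : Consumers19) (c₂₀ : Consumers20) (c₂₁ : Consumers21) : Implications93 ν c₁₉ c₂₀ c₂₁ (canon₉₃W ν c₁₉ c₂₀ c₂₁) where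
  bbk := fun s => s
  ad := fun a p k r => ⟨a, p, k, r⟩

/-- In the parametrised reading both statements hold as soon as the book holds at all ranks and rows C180, C44, C182, C49 hold — through the tranche's bookkeeping theorems `bbkEisen_of_conduit`, `adRank_of_book_and_conduits`. [cite: BergerBrownKlosin2025Klingen, Thm 7.2; AnambyDas2024SKlevel, Thm 1.2 (bookkeeping proved here)] -/
theorem c93_all_of (c₁₉ : Consumers19) (c₂₀ : Consumers20) (c₂₁ : Consumers21) (hν : ∀ N, ν.Everything N) (h₁₉ : c₁₉.SchmidtParamodular) (h₄₄ : c₂₁.PaulSaha)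
    (h₁₈₂ : c₂₀.SchmidtCAP) (h₄₉ : c₂₁.RSYCount) : ((canon₉₃W ν c₁₉ c₂₀ c₂₁).BBKeisen ∧ (canon₉₃W ν c₁₉ c₂₀ c₂₁).ADrank) :=
  have X := canon_implications₉₃W ν c₁₉ c₂₀ c₂₁
  ⟨bbkEisen_of_conduit X h₁₉, adRank_of_book_and_conduits X hν h₄₄ h₁₈₂ h₄₉⟩

end Canon93

/-- At the top (every input of the book; Mok and KMSW at the all-ones assignments, unread by the tranche; tranches 19 / 20 / 21 read canonically) both statements hold,
through the tranche's own `ninetythird_of_leaves`. [cite: BergerBrownKlosin2025Klingen, Thm 7.2; AnambyDas2024SKlevel, Thm 1.2 (bookkeeping proved here)] -/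
theorem ninetythird_holds_top : ((canon₉₃W νtop (canon₁₉ νtop μtop κtop) (canon₂₀ νtop μtop κtop) (canon₂₁ νtop μtop κtop)).BBKeisen ∧ (canon₉₃W νtop (canon₁₉ νtop μtop κtop) (canon₂₀ νtop μtop κtop) (canon₂₁ νtop μtop κtop)).ADrank) :=
  ninetythird_of_leaves (canon_implications₉₃W νtop _ _ _) (canon_implications₂₁ νtop μtop κtop) (canon_implications₂₀ νtop μtop κtop) (canon_implications₁₉ νtop μtop κtop) bookInputs_top

/-- BOOK SIDE, EXACT SUPPORT: in each of the 24 book countermodels (book edge systems and every other book leaf hold, the removed leaf fails; Mok and KMSW at the all-ones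
assignments; tranches 1 / 19 / 20 / 21 / 93 read canonically over it, ALL their edges valid) BOTH typed statements FAIL — every one of the 24 book leaves is load-bearing,
through C180 for row C235's section 7 and by name (and through C44 / C182 / C49) for row C236's rank statement. [cite: BergerBrownKlosin2025Klingen, §7 (« strong multiplicity one holds in the level one case ») with Schmidt2018Packet, Cor. 2.8; AnambyDas2024SKlevel, Lemma 4.3 (« the classification [9] »), with Arthur2013 §1.5 (bookkeeping proved here)] -/
theorem c93_book_cm (l : LeafSupport.Leaf) :
    LeafSupport.Systems (LeafSupport.mkN (LeafSupport.cm l)) (LeafSupport.mkW (LeafSupport.cm l)) (LeafSupport.mkG (LeafSupport.cm l)) ∧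
      (∀ l', l' ≠ l → (LeafSupport.mkN (LeafSupport.cm l)).leaf l') ∧ ¬ (LeafSupport.mkN (LeafSupport.cm l)).leaf l ∧
      (Implications (LeafSupport.mkN (LeafSupport.cm l)) μtop κtop (canon (LeafSupport.mkN (LeafSupport.cm l)) μtop κtop) ∧ Implications19 (LeafSupport.mkN (LeafSupport.cm l)) μtop κtop (canon₁₉ (LeafSupport.mkN (LeafSupport.cm l)) μtop κtop) ∧
        Implications20 (LeafSupport.mkN (LeafSupport.cm l)) (canon₁₉ (LeafSupport.mkN (LeafSupport.cm l)) μtop κtop) (canon₂₀ (LeafSupport.mkN (LeafSupport.cm l)) μtop κtop) ∧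
        Implications21 (LeafSupport.mkN (LeafSupport.cm l)) (canon₁₉ (LeafSupport.mkN (LeafSupport.cm l)) μtop κtop) (canon₂₀ (LeafSupport.mkN (LeafSupport.cm l)) μtop κtop) (canon₂₁ (LeafSupport.mkN (LeafSupport.cm l)) μtop κtop) ∧
        Implications93 (LeafSupport.mkN (LeafSupport.cm l)) (canon₁₉ (LeafSupport.mkN (LeafSupport.cm l)) μtop κtop) (canon₂₀ (LeafSupport.mkN (LeafSupport.cm l)) μtop κtop) (canon₂₁ (LeafSupport.mkN (LeafSupport.cm l)) μtop κtop) (canon₉₃W (LeafSupport.mkN (LeafSupport.cm l)) (canon₁₉ (LeafSupport.mkN (LeafSupport.cm l)) μtop κtop) (canon₂₀ (LeafSupport.mkN (LeafSupport.cm l)) μtop κtop) (canon₂₁ (LeafSupport.mkN (LeafSupport.cm l)) μtop κtop))) ∧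
      (¬ (canon₉₃W (LeafSupport.mkN (LeafSupport.cm l)) (canon₁₉ (LeafSupport.mkN (LeafSupport.cm l)) μtop κtop) (canon₂₀ (LeafSupport.mkN (LeafSupport.cm l)) μtop κtop) (canon₂₁ (LeafSupport.mkN (LeafSupport.cm l)) μtop κtop)).BBKeisen ∧
        ¬ (canon₉₃W (LeafSupport.mkN (LeafSupport.cm l)) (canon₁₉ (LeafSupport.mkN (LeafSupport.cm l)) μtop κtop) (canon₂₀ (LeafSupport.mkN (LeafSupport.cm l)) μtop κtop) (canon₂₁ (LeafSupport.mkN (LeafSupport.cm l)) μtop κtop)).ADrank) :=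
  have cmod := LeafSupport.countermodel l
  have nb := not_B_cm l
  ⟨cmod.1, cmod.2.1, cmod.2.2.1,
    ⟨canon_implications _ _ _, canon_implications₁₉ _ _ _, canon_implications₂₀ _ _ _, canon_implications₂₁ _ _ _, canon_implications₉₃W _ _ _ _⟩,
    ⟨fun h => nb h, fun h => nb h.1⟩⟩

/-- THE CONDUIT ROWS ARE LOAD-BEARING EXACTLY AS TYPED (reading-level separation at the top; the tranche-93 edges hold over each denied assignment; the denied readings are
those of `DownstreamSupport2.lean`): (a) C180 DENIED (`c₁₉noConduit`, with `canon₂₀free` / `canon₂₁noC180`: C182 and C49 free-standing, C44 falling with C180) ⇒ BOTH FAIL;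
(b) C182 DENIED (`canon₂₀noCAP`, `canon₂₁noC182`: C44 and C49 fall with it) ⇒ C235's section 7 HOLDS, C236's rank statement FAILS; (c) C49 DENIED (`canon₂₁noC49`) ⇒ C235
HOLDS, C236 FAILS. [cite: BergerBrownKlosin2025Klingen, §7; AnambyDas2024SKlevel, Lemma 4.3 (« [55, Prop. 2.3.1] », « [61, Table 3] », « [57, Prop. 2.1] ») (separating models; bookkeeping proved here)] -/
theorem c93_conduits_denied_top :
    (Implications93 νtop (c₁₉noConduit μtop κtop) canon₂₀free canon₂₁noC180 (canon₉₃W νtop (c₁₉noConduit μtop κtop) canon₂₀free canon₂₁noC180) ∧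
        ¬ (canon₉₃W νtop (c₁₉noConduit μtop κtop) canon₂₀free canon₂₁noC180).BBKeisen ∧ ¬ (canon₉₃W νtop (c₁₉noConduit μtop κtop) canon₂₀free canon₂₁noC180).ADrank) ∧
      (Implications93 νtop (canon₁₉ νtop μtop κtop) (canon₂₀noCAP νtop μtop κtop) (canon₂₁noC182 νtop μtop κtop) (canon₉₃W νtop (canon₁₉ νtop μtop κtop) (canon₂₀noCAP νtop μtop κtop) (canon₂₁noC182 νtop μtop κtop)) ∧
        (canon₉₃W νtop (canon₁₉ νtop μtop κtop) (canon₂₀noCAP νtop μtop κtop) (canon₂₁noC182 νtop μtop κtop)).BBKeisen ∧ ¬ (canon₉₃W νtop (canon₁₉ νtop μtop κtop) (canon₂₀noCAP νtop μtop κtop) (canon₂₁noC182 νtop μtop κtop)).ADrank) ∧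
      (Implications93 νtop (canon₁₉ νtop μtop κtop) (canon₂₀ νtop μtop κtop) (canon₂₁noC49 νtop μtop κtop) (canon₉₃W νtop (canon₁₉ νtop μtop κtop) (canon₂₀ νtop μtop κtop) (canon₂₁noC49 νtop μtop κtop)) ∧
        (canon₉₃W νtop (canon₁₉ νtop μtop κtop) (canon₂₀ νtop μtop κtop) (canon₂₁noC49 νtop μtop κtop)).BBKeisen ∧ ¬ (canon₉₃W νtop (canon₁₉ νtop μtop κtop) (canon₂₀ νtop μtop κtop) (canon₂₁noC49 νtop μtop κtop)).ADrank) :=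
  have b : ∀ N, νtop.Everything N := bookInputs_top.everything
  ⟨⟨canon_implications₉₃W _ _ _ _, fun h => h, fun h => h.2.1⟩,
    ⟨canon_implications₉₃W _ _ _ _, b, fun h => h.2.2.1⟩,
    ⟨canon_implications₉₃W _ _ _ _, b, fun h => h.2.2.2⟩⟩

/-- UNITARY SIDE: in each of Mok's 29 countermodels (KMSW = `κnoMok`) and in each of KMSW's countermodels, the book at the all-ones assignment (canonical readings over it),
both typed statements HOLD — no statement of Mok 2015 or KMSW occurs in the tranche's edges (neither paper concerns unitary groups). [cite: BergerBrownKlosin2025Klingen, Thm 7.2; AnambyDas2024SKlevel, Thm 1.2 (bookkeeping proved here)] -/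
theorem c93_unitary_independent (l : Mok2015.LeafSupport.Leaf) (l' : KMSW2014.LeafSupport.Leaf) :
    ((canon₉₃W νtop (canon₁₉ νtop (Mok2015.LeafSupport.mkN (Mok2015.LeafSupport.cm l)) κnoMok) (canon₂₀ νtop (Mok2015.LeafSupport.mkN (Mok2015.LeafSupport.cm l)) κnoMok) (canon₂₁ νtop (Mok2015.LeafSupport.mkN (Mok2015.LeafSupport.cm l)) κnoMok)).BBKeisen ∧
        (canon₉₃W νtop (canon₁₉ νtop (Mok2015.LeafSupport.mkN (Mok2015.LeafSupport.cm l)) κnoMok) (canon₂₀ νtop (Mok2015.LeafSupport.mkN (Mok2015.LeafSupport.cm l)) κnoMok) (canon₂₁ νtop (Mok2015.LeafSupport.mkN (Mok2015.LeafSupport.cm l)) κnoMok)).ADrank) ∧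
      ((canon₉₃W νtop (canon₁₉ νtop μtop (KMSW2014.LeafSupport.mkN (KMSW2014.LeafSupport.cm l'))) (canon₂₀ νtop μtop (KMSW2014.LeafSupport.mkN (KMSW2014.LeafSupport.cm l'))) (canon₂₁ νtop μtop (KMSW2014.LeafSupport.mkN (KMSW2014.LeafSupport.cm l')))).BBKeisen ∧
        (canon₉₃W νtop (canon₁₉ νtop μtop (KMSW2014.LeafSupport.mkN (KMSW2014.LeafSupport.cm l'))) (canon₂₀ νtop μtop (KMSW2014.LeafSupport.mkN (KMSW2014.LeafSupport.cm l'))) (canon₂₁ νtop μtop (KMSW2014.LeafSupport.mkN (KMSW2014.LeafSupport.cm l')))).ADrank) :=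
  have b : ∀ N, νtop.Everything N := bookInputs_top.everything
  ⟨⟨b, ⟨b, ⟨b, b, ⟨b, b⟩⟩, ⟨b, b⟩, ⟨b, ⟨b, b⟩⟩⟩⟩, ⟨b, ⟨b, ⟨b, b, ⟨b, b⟩⟩, ⟨b, b⟩, ⟨b, ⟨b, b⟩⟩⟩⟩⟩

/-- THE NINETY-THIRD TRANCHE REGRADED, in one statement: (i) at the top both hold; (ii) in the book countermodel of ANY leaf both fail; (iii) C180 denied: both fail; C182 denied:
C235 holds, C236 fails; C49 denied: C235 holds, C236 fails; (iv) in every Mok / KMSW countermodel (book at the top) both hold.  Supports: book 24 for both (through C180 for C235;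
directly and through C44, C182, C49 for C236); nothing of Mok 2015 or KMSW. [cite: BergerBrownKlosin2025Klingen, Thm 7.2, Cor. 7.5; AnambyDas2024SKlevel, Thm 1.2, Cor. 1.3 (bookkeeping proved here)] -/
theorem c93_regraded :
    ((canon₉₃W νtop (canon₁₉ νtop μtop κtop) (canon₂₀ νtop μtop κtop) (canon₂₁ νtop μtop κtop)).BBKeisen ∧ (canon₉₃W νtop (canon₁₉ νtop μtop κtop) (canon₂₀ νtop μtop κtop) (canon₂₁ νtop μtop κtop)).ADrank) ∧
      (∀ l : LeafSupport.Leaf, ¬ (LeafSupport.mkN (LeafSupport.cm l)).leaf l ∧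
        ¬ (canon₉₃W (LeafSupport.mkN (LeafSupport.cm l)) (canon₁₉ (LeafSupport.mkN (LeafSupport.cm l)) μtop κtop) (canon₂₀ (LeafSupport.mkN (LeafSupport.cm l)) μtop κtop) (canon₂₁ (LeafSupport.mkN (LeafSupport.cm l)) μtop κtop)).BBKeisen ∧
        ¬ (canon₉₃W (LeafSupport.mkN (LeafSupport.cm l)) (canon₁₉ (LeafSupport.mkN (LeafSupport.cm l)) μtop κtop) (canon₂₀ (LeafSupport.mkN (LeafSupport.cm l)) μtop κtop) (canon₂₁ (LeafSupport.mkN (LeafSupport.cm l)) μtop κtop)).ADrank) ∧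
      (¬ (canon₉₃W νtop (c₁₉noConduit μtop κtop) canon₂₀free canon₂₁noC180).BBKeisen ∧ ¬ (canon₉₃W νtop (c₁₉noConduit μtop κtop) canon₂₀free canon₂₁noC180).ADrank ∧
        (canon₉₃W νtop (canon₁₉ νtop μtop κtop) (canon₂₀noCAP νtop μtop κtop) (canon₂₁noC182 νtop μtop κtop)).BBKeisen ∧ ¬ (canon₉₃W νtop (canon₁₉ νtop μtop κtop) (canon₂₀noCAP νtop μtop κtop) (canon₂₁noC182 νtop μtop κtop)).ADrank ∧
        (canon₉₃W νtop (canon₁₉ νtop μtop κtop) (canon₂₀ νtop μtop κtop) (canon₂₁noC49 νtop μtop κtop)).BBKeisen ∧ ¬ (canon₉₃W νtop (canon₁₉ νtop μtop κtop) (canon₂₀ νtop μtop κtop) (canon₂₁noC49 νtop μtop κtop)).ADrank) ∧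
      (∀ (l : Mok2015.LeafSupport.Leaf) (l' : KMSW2014.LeafSupport.Leaf),
        (canon₉₃W νtop (canon₁₉ νtop (Mok2015.LeafSupport.mkN (Mok2015.LeafSupport.cm l)) κnoMok) (canon₂₀ νtop (Mok2015.LeafSupport.mkN (Mok2015.LeafSupport.cm l)) κnoMok) (canon₂₁ νtop (Mok2015.LeafSupport.mkN (Mok2015.LeafSupport.cm l)) κnoMok)).ADrank ∧
        (canon₉₃W νtop (canon₁₉ νtop μtop (KMSW2014.LeafSupport.mkN (KMSW2014.LeafSupport.cm l'))) (canon₂₀ νtop μtop (KMSW2014.LeafSupport.mkN (KMSW2014.LeafSupport.cm l'))) (canon₂₁ νtop μtop (KMSW2014.LeafSupport.mkN (KMSW2014.LeafSupport.cm l')))).ADrank) :=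
  ⟨ninetythird_holds_top,
    fun l => have h := c93_book_cm l
      ⟨h.2.2.1, h.2.2.2.2.1, h.2.2.2.2.2⟩,
    ⟨c93_conduits_denied_top.1.2.1, c93_conduits_denied_top.1.2.2, c93_conduits_denied_top.2.1.2.1, c93_conduits_denied_top.2.1.2.2,
      c93_conduits_denied_top.2.2.2.1, c93_conduits_denied_top.2.2.2.2⟩,
    fun l l' => have h := c93_unitary_independent l l'
      ⟨h.1.2, h.2.2⟩⟩

/-! ## 97. Ninety-fourth tranche (v6 of this file, after NEW `Downstream28.lean` v1; unit `pub-arthur-down-g38`): supports of NEW rows C237 `KYgraph` / `KYsx`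
(through the conduits C90, C182, C180, C112), C238 `HPpacket` (⇐ book ∧ A4) / `HPaction` (⇐ `HPpacket` ∧ C87 ∧ C192) and C239 `VPhida` (premise-free) / `VPeuler`
(⇐ `VPhida` ∧ book ∧ A4); see the module docstring for the summary. -/

section Canon94

variable (ν : Nodes) (μ : Mok2015.Nodes) (κ : KMSW2014.Nodes)

/-- The parametrised canonical reading of the ninety-fourth tranche: the assignments `c`, `c₁₉`, `c₂₀`, `c₂₈`, `c₂₉`, `c₃₀`, `c₃₁` of tranches 1 / 19 / 20 / 28 / 29 / 30 / 31 are the parameters; C237's §4 theorems := C90 ∧ C182, its Theorem 5.1 := C90 ∧ C182 ∧ C180 ∧ C112; C238's Lemma 2.9 := book ∧ A4, its main theorems := (book ∧ A4) ∧ C87 ∧ C192; C239's Theorem 1.1 := True, its Theorem 1.2 := book ∧ A4. [cite: KatsuraYamauchi2026MoretBailly, Thms 4.9, 5.1; HorawaPrasanna2025MotivicAction, Lemma 2.9, Thm 4.21; Pilloni2020, Thms 1.1, 1.2 (canonical model; bookkeeping)] -/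
abbrev canon₉₄W (c : Consumers) (c₁₉ : Consumers19) (c₂₀ : Consumers20) (c₂₈ : Consumers28) (c₂₉ : Consumers29) (c₃₀ : Consumers30) (c₃₁ : Consumers31) :
    Consumers94 where
  KYgraph := c₂₈.VanHoften ∧ c₂₀.SchmidtCAP
  KYsx := c₂₈.VanHoften ∧ c₂₀.SchmidtCAP ∧ c₁₉.SchmidtParamodular ∧ c₃₀.WWYY
  HPpacket := (∀ N, ν.Everything N) ∧ c.GeeTaibi
  HPaction := ((∀ N, ν.Everything N) ∧ c.GeeTaibi) ∧ c₂₉.LPSZ ∧ c₃₁.LZBlochKato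
  VPhida := True
  VPeuler := (∀ N, ν.Everything N) ∧ c.GeeTaibi

/-- The canonical instance: the parametrised reading over the canonical readings `canon`, `canon₁₉`, `canon₂₀`, `canon₂₈`, `canon₂₉`, `canon₃₀`, `canon₃₁` of tranches 1 / 19 / 20 / 28 / 29 / 30 / 31. [cite: KatsuraYamauchi2026MoretBailly, Thm 5.1; HorawaPrasanna2025MotivicAction, Thm 4.21; Pilloni2020, Thm 1.2 (canonical model; bookkeeping)] -/
abbrev canon₉₄ : Consumers94 := canon₉₄W ν (canon ν μ κ) (canon₁₉ ν μ κ) (canon₂₀ ν μ κ) (canon₂₈ ν μ κ) (canon₂₉ ν μ κ) (canon₃₀ ν μ κ) (canon₃₁ ν μ κ)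

/-- Every ninety-fourth-tranche edge holds in the parametrised reading, for arbitrary ν and EVERY assignment of tranches 1 / 19 / 20 / 28 / 29 / 30 / 31. [cite: KatsuraYamauchi2026MoretBailly, Thms 4.9, 5.1; HorawaPrasanna2025MotivicAction, Lemma 2.9, Thm 4.21; Pilloni2020, Thms 1.1, 1.2 (bookkeeping proved here)] -/
theorem canon_implications₉₄W (c : Consumers) (c₁₉ : Consumers19) (c₂₀ : Consumers20) (c₂₈ : Consumers28) (c₂₉ : Consumers29) (c₃₀ : Consumers30) (c₃₁ : Consumers31) :
    Implications94 ν c c₁₉ c₂₀ c₂₈ c₂₉ c₃₀ c₃₁ (canon₉₄W ν c c₁₉ c₂₀ c₂₈ c₂₉ c₃₀ c₃₁) where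
  kyGraph := fun v k => ⟨v, k⟩
  kySX := fun v k s w => ⟨v, k, s, w⟩
  hpPacket := fun b g => ⟨b, g⟩
  hpAction := fun h l z => ⟨h, l, z⟩
  vpHida := True.intro
  vpEuler := fun _ b g => ⟨b, g⟩

/-- Every ninety-fourth-tranche edge holds in the canonical instance, for arbitrary ν, μ, κ. [cite: KatsuraYamauchi2026MoretBailly, Thm 5.1; HorawaPrasanna2025MotivicAction, Thm 4.21; Pilloni2020, Thm 1.2 (bookkeeping proved here)] -/
theorem canon_implications₉₄ :
    Implications94 ν (canon ν μ κ) (canon₁₉ ν μ κ) (canon₂₀ ν μ κ) (canon₂₈ ν μ κ) (canon₂₉ ν μ κ) (canon₃₀ ν μ κ) (canon₃₁ ν μ κ) (canon₉₄ ν μ κ) :=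
  canon_implications₉₄W ν _ _ _ _ _ _ _

/-- In the parametrised reading all six statements hold as soon as the book holds at all ranks and rows A4, C90, C182, C180, C112, C87, C192 hold — through the tranche's bookkeeping theorems `ky_of_conduits`, `hp_of_book_and_rows`, `vp_of_book_and_A4`. [cite: KatsuraYamauchi2026MoretBailly, Thm 5.1; HorawaPrasanna2025MotivicAction, Thm 4.21; Pilloni2020, Thm 1.2 (bookkeeping proved here)] -/
theorem c94_all_of (c : Consumers) (c₁₉ : Consumers19) (c₂₀ : Consumers20) (c₂₈ : Consumers28) (c₂₉ : Consumers29) (c₃₀ : Consumers30) (c₃₁ : Consumers31)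
    (hν : ∀ N, ν.Everything N) (h₄ : c.GeeTaibi) (h₉₀ : c₂₈.VanHoften) (h₁₈₂ : c₂₀.SchmidtCAP) (h₁₈₀ : c₁₉.SchmidtParamodular) (h₁₁₂ : c₃₀.WWYY) (h₈₇ : c₂₉.LPSZ)
    (h₁₉₂ : c₃₁.LZBlochKato) :
    ((canon₉₄W ν c c₁₉ c₂₀ c₂₈ c₂₉ c₃₀ c₃₁).KYgraph ∧ (canon₉₄W ν c c₁₉ c₂₀ c₂₈ c₂₉ c₃₀ c₃₁).KYsx ∧ (canon₉₄W ν c c₁₉ c₂₀ c₂₈ c₂₉ c₃₀ c₃₁).HPpacket ∧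
      (canon₉₄W ν c c₁₉ c₂₀ c₂₈ c₂₉ c₃₀ c₃₁).HPaction ∧ (canon₉₄W ν c c₁₉ c₂₀ c₂₈ c₂₉ c₃₀ c₃₁).VPhida ∧ (canon₉₄W ν c c₁₉ c₂₀ c₂₈ c₂₉ c₃₀ c₃₁).VPeuler) :=
  have X := canon_implications₉₄W ν c c₁₉ c₂₀ c₂₈ c₂₉ c₃₀ c₃₁
  have h1 := ky_of_conduits X h₉₀ h₁₈₂ h₁₈₀ h₁₁₂
  have h2 := hp_of_book_and_rows X hν h₄ h₈₇ h₁₉₂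
  have h3 := vp_of_book_and_A4 X hν h₄
  ⟨h1.1, h1.2, h2.1, h2.2, h3.1, h3.2⟩

end Canon94

/-- Row C90 DENIED (`VanHoften := False`; the other tranche-28 fields as in `canon₂₈` at the top): a reading of `Consumers28` used only to deny van Hoften's Jacquet – Langlands theorem; no twenty-eighth-tranche edge is claimed for it. [cite: Vanhoften2021, Thm 2 (separating model; bookkeeping)] -/
abbrev c₂₈noC90 : Consumers28 := { canon₂₈ νtop μtop κtop with VanHoften := False }

/-- Row C112 DENIED ALONE (`WWYY := False`; the other tranche-30 fields as in `canon₃₀` at the top): a reading of `Consumers30` used only to deny Wang – Wei – Yan – Yi's refined strong multiplicity one; no thirtieth-tranche edge is claimed for it. [cite: WangWeiYanYi2026, Thm 1.1 (separating model; bookkeeping)] -/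
abbrev c₃₀noC112 : Consumers30 := { canon₃₀ νtop μtop κtop with WWYY := False }

/-- At the top (every input of the book; Mok and KMSW at the all-ones assignments, unread by the tranche; tranches 1 / 19 / 20 / 28 / 29 / 30 / 31 read canonically) all six
statements hold, through the tranche's own `ninetyfourth_of_leaves`. [cite: KatsuraYamauchi2026MoretBailly, Thm 5.1; HorawaPrasanna2025MotivicAction, Thm 4.21; Pilloni2020, Thm 1.2 (bookkeeping proved here)] -/
theorem ninetyfourth_holds_top :
    ((canon₉₄ νtop μtop κtop).KYgraph ∧ (canon₉₄ νtop μtop κtop).KYsx ∧ (canon₉₄ νtop μtop κtop).HPpacket ∧ (canon₉₄ νtop μtop κtop).HPaction ∧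
      (canon₉₄ νtop μtop κtop).VPhida ∧ (canon₉₄ νtop μtop κtop).VPeuler) :=
  ninetyfourth_of_leaves (canon_implications₉₄ νtop μtop κtop) (canon_implications₂₈ νtop μtop κtop) (canon_implications₃₁ νtop μtop κtop)
    (canon_implications₂₉ νtop μtop κtop) (canon_implications₃₀ νtop μtop κtop) (canon_implications₂₀ νtop μtop κtop) (canon_implications₁₉ νtop μtop κtop)
    (canon_implications νtop μtop κtop) bookInputs_top

/-- BOOK SIDE, EXACT SUPPORT: in each of the 24 book countermodels (book edge systems and every other book leaf hold, the removed leaf fails; Mok and KMSW at the all-ones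
assignments; tranches 1 / 19 / 20 / 28 / 29 / 30 / 31 / 94 read canonically over it, ALL their edges valid) the FIVE dependent statements FAIL — every one of the 24 book
leaves is load-bearing, through C90 / C182 / C180 / C112 for row C237, by name and through A4 / C87 / C192 for row C238, by name and through A4 for row C239's Theorem 1.2 —
while row C239's Theorem 1.1 HOLDS. [cite: KatsuraYamauchi2026MoretBailly, Thm 4.5 (« proved by van Hoften [vH] ») with Vanhoften2021 §3.1; HorawaPrasanna2025MotivicAction, Lemma 2.9 (« This follows from Arthur's classification »); Pilloni2020, §15.2.4 (« as announced in [1] »), with Arthur2013 §1.5 (bookkeeping proved here)] -/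
theorem c94_book_cm (l : LeafSupport.Leaf) :
    LeafSupport.Systems (LeafSupport.mkN (LeafSupport.cm l)) (LeafSupport.mkW (LeafSupport.cm l)) (LeafSupport.mkG (LeafSupport.cm l)) ∧
      (∀ l', l' ≠ l → (LeafSupport.mkN (LeafSupport.cm l)).leaf l') ∧ ¬ (LeafSupport.mkN (LeafSupport.cm l)).leaf l ∧
      (Implications (LeafSupport.mkN (LeafSupport.cm l)) μtop κtop (canon (LeafSupport.mkN (LeafSupport.cm l)) μtop κtop) ∧
        Implications19 (LeafSupport.mkN (LeafSupport.cm l)) μtop κtop (canon₁₉ (LeafSupport.mkN (LeafSupport.cm l)) μtop κtop) ∧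
        Implications20 (LeafSupport.mkN (LeafSupport.cm l)) (canon₁₉ (LeafSupport.mkN (LeafSupport.cm l)) μtop κtop) (canon₂₀ (LeafSupport.mkN (LeafSupport.cm l)) μtop κtop) ∧
        Implications28 (LeafSupport.mkN (LeafSupport.cm l)) μtop κtop (canon (LeafSupport.mkN (LeafSupport.cm l)) μtop κtop) (canon₁₉ (LeafSupport.mkN (LeafSupport.cm l)) μtop κtop) (canon₂₈ (LeafSupport.mkN (LeafSupport.cm l)) μtop κtop) ∧
        Implications29 (LeafSupport.mkN (LeafSupport.cm l)) (canon (LeafSupport.mkN (LeafSupport.cm l)) μtop κtop) (canon₁₉ (LeafSupport.mkN (LeafSupport.cm l)) μtop κtop) (canon₂₈ (LeafSupport.mkN (LeafSupport.cm l)) μtop κtop) (canon₂₉ (LeafSupport.mkN (LeafSupport.cm l)) μtop κtop) ∧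
        Implications30 (LeafSupport.mkN (LeafSupport.cm l)) μtop (canon (LeafSupport.mkN (LeafSupport.cm l)) μtop κtop) (canon₁₉ (LeafSupport.mkN (LeafSupport.cm l)) μtop κtop) (canon₂₀ (LeafSupport.mkN (LeafSupport.cm l)) μtop κtop) (canon₃₀ (LeafSupport.mkN (LeafSupport.cm l)) μtop κtop) ∧
        Implications31 (LeafSupport.mkN (LeafSupport.cm l)) (canon (LeafSupport.mkN (LeafSupport.cm l)) μtop κtop) (canon₂₉ (LeafSupport.mkN (LeafSupport.cm l)) μtop κtop) (canon₃₁ (LeafSupport.mkN (LeafSupport.cm l)) μtop κtop) ∧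
        Implications94 (LeafSupport.mkN (LeafSupport.cm l)) (canon (LeafSupport.mkN (LeafSupport.cm l)) μtop κtop) (canon₁₉ (LeafSupport.mkN (LeafSupport.cm l)) μtop κtop) (canon₂₀ (LeafSupport.mkN (LeafSupport.cm l)) μtop κtop) (canon₂₈ (LeafSupport.mkN (LeafSupport.cm l)) μtop κtop) (canon₂₉ (LeafSupport.mkN (LeafSupport.cm l)) μtop κtop) (canon₃₀ (LeafSupport.mkN (LeafSupport.cm l)) μtop κtop) (canon₃₁ (LeafSupport.mkN (LeafSupport.cm l)) μtop κtop) (canon₉₄ (LeafSupport.mkN (LeafSupport.cm l)) μtop κtop)) ∧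
      (¬ (canon₉₄ (LeafSupport.mkN (LeafSupport.cm l)) μtop κtop).KYgraph ∧ ¬ (canon₉₄ (LeafSupport.mkN (LeafSupport.cm l)) μtop κtop).KYsx ∧
        ¬ (canon₉₄ (LeafSupport.mkN (LeafSupport.cm l)) μtop κtop).HPpacket ∧ ¬ (canon₉₄ (LeafSupport.mkN (LeafSupport.cm l)) μtop κtop).HPaction ∧
        ¬ (canon₉₄ (LeafSupport.mkN (LeafSupport.cm l)) μtop κtop).VPeuler ∧ (canon₉₄ (LeafSupport.mkN (LeafSupport.cm l)) μtop κtop).VPhida) :=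
  have cmod := LeafSupport.countermodel l
  have nb := not_B_cm l
  ⟨cmod.1, cmod.2.1, cmod.2.2.1,
    ⟨canon_implications _ _ _, canon_implications₁₉ _ _ _, canon_implications₂₀ _ _ _, canon_implications₂₈ _ _ _, canon_implications₂₉ _ _ _, canon_implications₃₀ _ _ _,
      canon_implications₃₁ _ _ _, canon_implications₉₄ _ _ _⟩,
    ⟨fun h => nb h.1.1, fun h => nb h.1.1, fun h => nb h.1, fun h => nb h.1.1, fun h => nb h.1, True.intro⟩⟩

/-- THE CONDUIT ROWS ARE LOAD-BEARING EXACTLY AS TYPED (reading-level separation at the top; the tranche-94 edges hold over each denied assignment; the denied readings are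
those of `DownstreamSupport2.lean` / `DownstreamSupport3.lean`, `c₁noA4` of section 95, and `c₂₈noC90` / `c₃₀noC112` above): (a) C90 DENIED ⇒ both C237 statements FAIL,
C238 / C239 HOLD; (b) C182 DENIED (`canon₂₀noCAP`, with `canon₃₀noC182`: C112 falls with it) ⇒ both C237 statements FAIL; (c) C180 DENIED (`c₁₉noConduit`, with
`canon₂₀free` — C182 free-standing — and `canon₃₀noC180`: C112 falls with C180) ⇒ C237's §4 theorems HOLD, its Theorem 5.1 FAILS; (d) C112 ALONE DENIED ⇒ §4 HOLDS,
Theorem 5.1 FAILS; (e) C87 DENIED (`canon₂₉noC87`, with `canon₃₁no`: C192 falls with C87) ⇒ C238's Lemma 2.9 HOLDS, its main theorems FAIL, C237 / C239 HOLD; (f) A4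
DENIED (`c₁noA4`) ⇒ C238's two statements and C239's Theorem 1.2 FAIL, C239's Theorem 1.1 HOLDS (C237's dependence on A4 runs inside row C90's own reading, section 29
of `DownstreamSupport3.lean`, and is not re-tested here). [cite: KatsuraYamauchi2026MoretBailly, Thm 4.5, p0016:L110, p0020:L4-5 (« [vH] », « [Schmidt] », « (cf. [Schmidt18], [WWYY]) »); HorawaPrasanna2025MotivicAction, Lemma 2.9, Thm 5.1 (« Proposition 10.3 in [LPSZ] », « [Loeffler2020bloch] »); Pilloni2020, Prop. 15.2.4.1 (separating models; bookkeeping proved here)] -/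
theorem c94_conduits_denied_top :
    (Implications94 νtop (canon νtop μtop κtop) (canon₁₉ νtop μtop κtop) (canon₂₀ νtop μtop κtop) c₂₈noC90 (canon₂₉ νtop μtop κtop) (canon₃₀ νtop μtop κtop) (canon₃₁ νtop μtop κtop)
          (canon₉₄W νtop (canon νtop μtop κtop) (canon₁₉ νtop μtop κtop) (canon₂₀ νtop μtop κtop) c₂₈noC90 (canon₂₉ νtop μtop κtop) (canon₃₀ νtop μtop κtop) (canon₃₁ νtop μtop κtop)) ∧
        ¬ (canon₉₄W νtop (canon νtop μtop κtop) (canon₁₉ νtop μtop κtop) (canon₂₀ νtop μtop κtop) c₂₈noC90 (canon₂₉ νtop μtop κtop) (canon₃₀ νtop μtop κtop) (canon₃₁ νtop μtop κtop)).KYgraph ∧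
        ¬ (canon₉₄W νtop (canon νtop μtop κtop) (canon₁₉ νtop μtop κtop) (canon₂₀ νtop μtop κtop) c₂₈noC90 (canon₂₉ νtop μtop κtop) (canon₃₀ νtop μtop κtop) (canon₃₁ νtop μtop κtop)).KYsx ∧
        (canon₉₄W νtop (canon νtop μtop κtop) (canon₁₉ νtop μtop κtop) (canon₂₀ νtop μtop κtop) c₂₈noC90 (canon₂₉ νtop μtop κtop) (canon₃₀ νtop μtop κtop) (canon₃₁ νtop μtop κtop)).HPaction ∧
        (canon₉₄W νtop (canon νtop μtop κtop) (canon₁₉ νtop μtop κtop) (canon₂₀ νtop μtop κtop) c₂₈noC90 (canon₂₉ νtop μtop κtop) (canon₃₀ νtop μtop κtop) (canon₃₁ νtop μtop κtop)).VPeuler) ∧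
      (Implications94 νtop (canon νtop μtop κtop) (canon₁₉ νtop μtop κtop) (canon₂₀noCAP νtop μtop κtop) (canon₂₈ νtop μtop κtop) (canon₂₉ νtop μtop κtop) (canon₃₀noC182 νtop μtop κtop) (canon₃₁ νtop μtop κtop)
          (canon₉₄W νtop (canon νtop μtop κtop) (canon₁₉ νtop μtop κtop) (canon₂₀noCAP νtop μtop κtop) (canon₂₈ νtop μtop κtop) (canon₂₉ νtop μtop κtop) (canon₃₀noC182 νtop μtop κtop) (canon₃₁ νtop μtop κtop)) ∧
        ¬ (canon₉₄W νtop (canon νtop μtop κtop) (canon₁₉ νtop μtop κtop) (canon₂₀noCAP νtop μtop κtop) (canon₂₈ νtop μtop κtop) (canon₂₉ νtop μtop κtop) (canon₃₀noC182 νtop μtop κtop) (canon₃₁ νtop μtop κtop)).KYgraph ∧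
        ¬ (canon₉₄W νtop (canon νtop μtop κtop) (canon₁₉ νtop μtop κtop) (canon₂₀noCAP νtop μtop κtop) (canon₂₈ νtop μtop κtop) (canon₂₉ νtop μtop κtop) (canon₃₀noC182 νtop μtop κtop) (canon₃₁ νtop μtop κtop)).KYsx) ∧
      (Implications94 νtop (canon νtop μtop κtop) (c₁₉noConduit μtop κtop) canon₂₀free (canon₂₈ νtop μtop κtop) (canon₂₉ νtop μtop κtop) (canon₃₀noC180 νtop μtop κtop) (canon₃₁ νtop μtop κtop)
          (canon₉₄W νtop (canon νtop μtop κtop) (c₁₉noConduit μtop κtop) canon₂₀free (canon₂₈ νtop μtop κtop) (canon₂₉ νtop μtop κtop) (canon₃₀noC180 νtop μtop κtop) (canon₃₁ νtop μtop κtop)) ∧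
        (canon₉₄W νtop (canon νtop μtop κtop) (c₁₉noConduit μtop κtop) canon₂₀free (canon₂₈ νtop μtop κtop) (canon₂₉ νtop μtop κtop) (canon₃₀noC180 νtop μtop κtop) (canon₃₁ νtop μtop κtop)).KYgraph ∧
        ¬ (canon₉₄W νtop (canon νtop μtop κtop) (c₁₉noConduit μtop κtop) canon₂₀free (canon₂₈ νtop μtop κtop) (canon₂₉ νtop μtop κtop) (canon₃₀noC180 νtop μtop κtop) (canon₃₁ νtop μtop κtop)).KYsx) ∧
      (Implications94 νtop (canon νtop μtop κtop) (canon₁₉ νtop μtop κtop) (canon₂₀ νtop μtop κtop) (canon₂₈ νtop μtop κtop) (canon₂₉ νtop μtop κtop) c₃₀noC112 (canon₃₁ νtop μtop κtop)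
          (canon₉₄W νtop (canon νtop μtop κtop) (canon₁₉ νtop μtop κtop) (canon₂₀ νtop μtop κtop) (canon₂₈ νtop μtop κtop) (canon₂₉ νtop μtop κtop) c₃₀noC112 (canon₃₁ νtop μtop κtop)) ∧
        (canon₉₄W νtop (canon νtop μtop κtop) (canon₁₉ νtop μtop κtop) (canon₂₀ νtop μtop κtop) (canon₂₈ νtop μtop κtop) (canon₂₉ νtop μtop κtop) c₃₀noC112 (canon₃₁ νtop μtop κtop)).KYgraph ∧
        ¬ (canon₉₄W νtop (canon νtop μtop κtop) (canon₁₉ νtop μtop κtop) (canon₂₀ νtop μtop κtop) (canon₂₈ νtop μtop κtop) (canon₂₉ νtop μtop κtop) c₃₀noC112 (canon₃₁ νtop μtop κtop)).KYsx) ∧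
      (Implications94 νtop (canon νtop μtop κtop) (canon₁₉ νtop μtop κtop) (canon₂₀ νtop μtop κtop) (canon₂₈ νtop μtop κtop) (canon₂₉noC87 νtop μtop κtop) (canon₃₀ νtop μtop κtop) canon₃₁no
          (canon₉₄W νtop (canon νtop μtop κtop) (canon₁₉ νtop μtop κtop) (canon₂₀ νtop μtop κtop) (canon₂₈ νtop μtop κtop) (canon₂₉noC87 νtop μtop κtop) (canon₃₀ νtop μtop κtop) canon₃₁no) ∧
        (canon₉₄W νtop (canon νtop μtop κtop) (canon₁₉ νtop μtop κtop) (canon₂₀ νtop μtop κtop) (canon₂₈ νtop μtop κtop) (canon₂₉noC87 νtop μtop κtop) (canon₃₀ νtop μtop κtop) canon₃₁no).HPpacket ∧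
        ¬ (canon₉₄W νtop (canon νtop μtop κtop) (canon₁₉ νtop μtop κtop) (canon₂₀ νtop μtop κtop) (canon₂₈ νtop μtop κtop) (canon₂₉noC87 νtop μtop κtop) (canon₃₀ νtop μtop κtop) canon₃₁no).HPaction ∧
        (canon₉₄W νtop (canon νtop μtop κtop) (canon₁₉ νtop μtop κtop) (canon₂₀ νtop μtop κtop) (canon₂₈ νtop μtop κtop) (canon₂₉noC87 νtop μtop κtop) (canon₃₀ νtop μtop κtop) canon₃₁no).KYsx ∧
        (canon₉₄W νtop (canon νtop μtop κtop) (canon₁₉ νtop μtop κtop) (canon₂₀ νtop μtop κtop) (canon₂₈ νtop μtop κtop) (canon₂₉noC87 νtop μtop κtop) (canon₃₀ νtop μtop κtop) canon₃₁no).VPeuler) ∧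
      (Implications94 νtop c₁noA4 (canon₁₉ νtop μtop κtop) (canon₂₀ νtop μtop κtop) (canon₂₈ νtop μtop κtop) (canon₂₉ νtop μtop κtop) (canon₃₀ νtop μtop κtop) (canon₃₁ νtop μtop κtop)
          (canon₉₄W νtop c₁noA4 (canon₁₉ νtop μtop κtop) (canon₂₀ νtop μtop κtop) (canon₂₈ νtop μtop κtop) (canon₂₉ νtop μtop κtop) (canon₃₀ νtop μtop κtop) (canon₃₁ νtop μtop κtop)) ∧
        ¬ (canon₉₄W νtop c₁noA4 (canon₁₉ νtop μtop κtop) (canon₂₀ νtop μtop κtop) (canon₂₈ νtop μtop κtop) (canon₂₉ νtop μtop κtop) (canon₃₀ νtop μtop κtop) (canon₃₁ νtop μtop κtop)).HPpacket ∧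
        ¬ (canon₉₄W νtop c₁noA4 (canon₁₉ νtop μtop κtop) (canon₂₀ νtop μtop κtop) (canon₂₈ νtop μtop κtop) (canon₂₉ νtop μtop κtop) (canon₃₀ νtop μtop κtop) (canon₃₁ νtop μtop κtop)).HPaction ∧
        ¬ (canon₉₄W νtop c₁noA4 (canon₁₉ νtop μtop κtop) (canon₂₀ νtop μtop κtop) (canon₂₈ νtop μtop κtop) (canon₂₉ νtop μtop κtop) (canon₃₀ νtop μtop κtop) (canon₃₁ νtop μtop κtop)).VPeuler ∧
        (canon₉₄W νtop c₁noA4 (canon₁₉ νtop μtop κtop) (canon₂₀ νtop μtop κtop) (canon₂₈ νtop μtop κtop) (canon₂₉ νtop μtop κtop) (canon₃₀ νtop μtop κtop) (canon₃₁ νtop μtop κtop)).VPhida) :=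
  have b : ∀ N, νtop.Everything N := bookInputs_top.everything
  ⟨⟨canon_implications₉₄W _ _ _ _ _ _ _ _, fun h => h.1, fun h => h.1, ⟨⟨b, b⟩, ⟨b, b⟩, ⟨⟨b, b⟩, ⟨b, b⟩⟩⟩, ⟨b, b⟩⟩,
    ⟨canon_implications₉₄W _ _ _ _ _ _ _ _, fun h => h.2, fun h => h.2.1⟩,
    ⟨canon_implications₉₄W _ _ _ _ _ _ _ _, ⟨⟨b, b⟩, True.intro⟩, fun h => h.2.2.1⟩,
    ⟨canon_implications₉₄W _ _ _ _ _ _ _ _, ⟨⟨b, b⟩, ⟨b, b⟩⟩, fun h => h.2.2.2⟩,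
    ⟨canon_implications₉₄W _ _ _ _ _ _ _ _, ⟨b, b⟩, fun h => h.2.1, ⟨⟨b, b⟩, ⟨b, b⟩, b, ⟨b, b, ⟨b, b⟩⟩⟩, ⟨b, b⟩⟩,
    ⟨canon_implications₉₄W _ _ _ _ _ _ _ _, fun h => h.2, fun h => h.1.2, fun h => h.2, True.intro⟩⟩

/-- UNITARY SIDE: in each of Mok's 29 countermodels (KMSW = `κnoMok`) and in each of KMSW's countermodels, the book at the all-ones assignment (canonical readings over it),
ALL SIX typed statements HOLD — no statement of Mok 2015 or KMSW occurs in the tranche's edges (GSp_4 / Siegel modular forms throughout). [cite: KatsuraYamauchi2026MoretBailly, Thm 5.1; HorawaPrasanna2025MotivicAction, Thm 4.21; Pilloni2020, Thm 1.2 (bookkeeping proved here)] -/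
theorem c94_unitary_independent (l : Mok2015.LeafSupport.Leaf) (l' : KMSW2014.LeafSupport.Leaf) :
    ((canon₉₄ νtop (Mok2015.LeafSupport.mkN (Mok2015.LeafSupport.cm l)) κnoMok).KYgraph ∧ (canon₉₄ νtop (Mok2015.LeafSupport.mkN (Mok2015.LeafSupport.cm l)) κnoMok).KYsx ∧
        (canon₉₄ νtop (Mok2015.LeafSupport.mkN (Mok2015.LeafSupport.cm l)) κnoMok).HPpacket ∧ (canon₉₄ νtop (Mok2015.LeafSupport.mkN (Mok2015.LeafSupport.cm l)) κnoMok).HPaction ∧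
        (canon₉₄ νtop (Mok2015.LeafSupport.mkN (Mok2015.LeafSupport.cm l)) κnoMok).VPhida ∧ (canon₉₄ νtop (Mok2015.LeafSupport.mkN (Mok2015.LeafSupport.cm l)) κnoMok).VPeuler) ∧
      ((canon₉₄ νtop μtop (KMSW2014.LeafSupport.mkN (KMSW2014.LeafSupport.cm l'))).KYgraph ∧ (canon₉₄ νtop μtop (KMSW2014.LeafSupport.mkN (KMSW2014.LeafSupport.cm l'))).KYsx ∧
        (canon₉₄ νtop μtop (KMSW2014.LeafSupport.mkN (KMSW2014.LeafSupport.cm l'))).HPpacket ∧ (canon₉₄ νtop μtop (KMSW2014.LeafSupport.mkN (KMSW2014.LeafSupport.cm l'))).HPaction ∧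
        (canon₉₄ νtop μtop (KMSW2014.LeafSupport.mkN (KMSW2014.LeafSupport.cm l'))).VPhida ∧ (canon₉₄ νtop μtop (KMSW2014.LeafSupport.mkN (KMSW2014.LeafSupport.cm l'))).VPeuler) :=
  have b : ∀ N, νtop.Everything N := bookInputs_top.everything
  ⟨⟨⟨⟨b, b⟩, ⟨b, b⟩⟩, ⟨⟨b, b⟩, ⟨b, b⟩, b, ⟨b, b, ⟨b, b⟩⟩⟩, ⟨b, b⟩, ⟨⟨b, b⟩, ⟨b, b⟩, ⟨⟨b, b⟩, ⟨b, b⟩⟩⟩, True.intro, ⟨b, b⟩⟩,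
    ⟨⟨⟨b, b⟩, ⟨b, b⟩⟩, ⟨⟨b, b⟩, ⟨b, b⟩, b, ⟨b, b, ⟨b, b⟩⟩⟩, ⟨b, b⟩, ⟨⟨b, b⟩, ⟨b, b⟩, ⟨⟨b, b⟩, ⟨b, b⟩⟩⟩, True.intro, ⟨b, b⟩⟩⟩

/-- THE NINETY-FOURTH TRANCHE REGRADED, in one statement: (i) at the top all six hold; (ii) in the book countermodel of ANY leaf the five dependent statements fail and the
control holds; (iii) C90 denied: both C237 statements fail; C180 denied: C237's §4 holds, Theorem 5.1 fails; C87 denied: C238's Lemma 2.9 holds, main theorems fail; A4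
denied: C238's statements and C239's Theorem 1.2 fail; (iv) in every Mok / KMSW countermodel (book at the top) all six hold.  Supports: book 24 for the five dependent
statements (through C90 / C182 / C180 / C112; through A4 / C87 / C192; through A4), ∅ for C239's Theorem 1.1; nothing of Mok 2015 or KMSW. [cite: KatsuraYamauchi2026MoretBailly, Thms 4.9, 5.1; HorawaPrasanna2025MotivicAction, Thms 4.21, 6.2, 7.1; Pilloni2020, Thms 1.1, 1.2 (bookkeeping proved here)] -/
theorem c94_regraded :
    ((canon₉₄ νtop μtop κtop).KYgraph ∧ (canon₉₄ νtop μtop κtop).KYsx ∧ (canon₉₄ νtop μtop κtop).HPpacket ∧ (canon₉₄ νtop μtop κtop).HPaction ∧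
        (canon₉₄ νtop μtop κtop).VPhida ∧ (canon₉₄ νtop μtop κtop).VPeuler) ∧
      (∀ l : LeafSupport.Leaf, ¬ (LeafSupport.mkN (LeafSupport.cm l)).leaf l ∧
        ¬ (canon₉₄ (LeafSupport.mkN (LeafSupport.cm l)) μtop κtop).KYgraph ∧ ¬ (canon₉₄ (LeafSupport.mkN (LeafSupport.cm l)) μtop κtop).KYsx ∧
        ¬ (canon₉₄ (LeafSupport.mkN (LeafSupport.cm l)) μtop κtop).HPpacket ∧ ¬ (canon₉₄ (LeafSupport.mkN (LeafSupport.cm l)) μtop κtop).HPaction ∧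
        ¬ (canon₉₄ (LeafSupport.mkN (LeafSupport.cm l)) μtop κtop).VPeuler ∧ (canon₉₄ (LeafSupport.mkN (LeafSupport.cm l)) μtop κtop).VPhida) ∧
      (¬ (canon₉₄W νtop (canon νtop μtop κtop) (canon₁₉ νtop μtop κtop) (canon₂₀ νtop μtop κtop) c₂₈noC90 (canon₂₉ νtop μtop κtop) (canon₃₀ νtop μtop κtop) (canon₃₁ νtop μtop κtop)).KYgraph ∧
        ¬ (canon₉₄W νtop (canon νtop μtop κtop) (canon₁₉ νtop μtop κtop) (canon₂₀ νtop μtop κtop) c₂₈noC90 (canon₂₉ νtop μtop κtop) (canon₃₀ νtop μtop κtop) (canon₃₁ νtop μtop κtop)).KYsx ∧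
        (canon₉₄W νtop (canon νtop μtop κtop) (c₁₉noConduit μtop κtop) canon₂₀free (canon₂₈ νtop μtop κtop) (canon₂₉ νtop μtop κtop) (canon₃₀noC180 νtop μtop κtop) (canon₃₁ νtop μtop κtop)).KYgraph ∧
        ¬ (canon₉₄W νtop (canon νtop μtop κtop) (c₁₉noConduit μtop κtop) canon₂₀free (canon₂₈ νtop μtop κtop) (canon₂₉ νtop μtop κtop) (canon₃₀noC180 νtop μtop κtop) (canon₃₁ νtop μtop κtop)).KYsx ∧
        (canon₉₄W νtop (canon νtop μtop κtop) (canon₁₉ νtop μtop κtop) (canon₂₀ νtop μtop κtop) (canon₂₈ νtop μtop κtop) (canon₂₉noC87 νtop μtop κtop) (canon₃₀ νtop μtop κtop) canon₃₁no).HPpacket ∧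
        ¬ (canon₉₄W νtop (canon νtop μtop κtop) (canon₁₉ νtop μtop κtop) (canon₂₀ νtop μtop κtop) (canon₂₈ νtop μtop κtop) (canon₂₉noC87 νtop μtop κtop) (canon₃₀ νtop μtop κtop) canon₃₁no).HPaction ∧
        ¬ (canon₉₄W νtop c₁noA4 (canon₁₉ νtop μtop κtop) (canon₂₀ νtop μtop κtop) (canon₂₈ νtop μtop κtop) (canon₂₉ νtop μtop κtop) (canon₃₀ νtop μtop κtop) (canon₃₁ νtop μtop κtop)).HPaction ∧
        ¬ (canon₉₄W νtop c₁noA4 (canon₁₉ νtop μtop κtop) (canon₂₀ νtop μtop κtop) (canon₂₈ νtop μtop κtop) (canon₂₉ νtop μtop κtop) (canon₃₀ νtop μtop κtop) (canon₃₁ νtop μtop κtop)).VPeuler) ∧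
      (∀ (l : Mok2015.LeafSupport.Leaf) (l' : KMSW2014.LeafSupport.Leaf),
        (canon₉₄ νtop (Mok2015.LeafSupport.mkN (Mok2015.LeafSupport.cm l)) κnoMok).KYsx ∧ (canon₉₄ νtop (Mok2015.LeafSupport.mkN (Mok2015.LeafSupport.cm l)) κnoMok).HPaction ∧
        (canon₉₄ νtop μtop (KMSW2014.LeafSupport.mkN (KMSW2014.LeafSupport.cm l'))).KYsx ∧ (canon₉₄ νtop μtop (KMSW2014.LeafSupport.mkN (KMSW2014.LeafSupport.cm l'))).HPaction) :=
  ⟨ninetyfourth_holds_top,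
    fun l => have h := c94_book_cm l
      ⟨h.2.2.1, h.2.2.2.2.1, h.2.2.2.2.2.1, h.2.2.2.2.2.2.1, h.2.2.2.2.2.2.2.1, h.2.2.2.2.2.2.2.2.1, h.2.2.2.2.2.2.2.2.2⟩,
    ⟨c94_conduits_denied_top.1.2.1, c94_conduits_denied_top.1.2.2.1, c94_conduits_denied_top.2.2.1.2.1, c94_conduits_denied_top.2.2.1.2.2,
      c94_conduits_denied_top.2.2.2.2.1.2.1, c94_conduits_denied_top.2.2.2.2.1.2.2.1, c94_conduits_denied_top.2.2.2.2.2.2.2.1, c94_conduits_denied_top.2.2.2.2.2.2.2.2.1⟩,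
    fun l l' => have h := c94_unitary_independent l l'
      ⟨h.1.2.1, h.1.2.2.2.1, h.2.2.1, h.2.2.2.2.1⟩⟩

/-! ## 98. Ninety-fifth tranche (v7 of this file, after `Downstream28.lean` v2; unit `pub-arthur-down-g38`): supports of NEW row C240 `LSZ4galois` (⇐ row A7
`Consumers.XuGSp`) / `LSZ4euler` (⇐ `LSZ4galois`); see the module docstring for the summary. -/

section Canon95

variable (ν : Nodes) (μ : Mok2015.Nodes) (κ : KMSW2014.Nodes)

/-- The parametrised canonical reading of the ninety-fifth tranche: the assignment `c` of tranche 1 is the parameter; C240's Theorem 10.1.3 := row A7's node, its Euler-system theorems := the same. [cite: LoefflerSkinnerZerbes2022GSp4Euler, Thm 10.1.3, Thm 11.2.3 (canonical model; bookkeeping)] -/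
abbrev canon₉₅W (c : Consumers) : Consumers95 where
  LSZ4galois := c.XuGSp
  LSZ4euler := c.XuGSp

/-- The canonical instance: the parametrised reading over the canonical reading `canon` of tranche 1 (there `XuGSp := ∀ N, ν.Everything N`). [cite: LoefflerSkinnerZerbes2022GSp4Euler, Thm 10.1.3 (canonical model; bookkeeping)] -/
abbrev canon₉₅ : Consumers95 := canon₉₅W (canon ν μ κ)

/-- Every ninety-fifth-tranche edge holds in the parametrised reading, for EVERY assignment of tranche 1. [cite: LoefflerSkinnerZerbes2022GSp4Euler, Thms 10.1.3, 11.2.3 (bookkeeping proved here)] -/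
theorem canon_implications₉₅W (c : Consumers) : Implications95 c (canon₉₅W c) where
  lsz4Galois := fun x => x
  lsz4Euler := fun x => x

/-- Every ninety-fifth-tranche edge holds in the canonical instance, for arbitrary ν, μ, κ. [cite: LoefflerSkinnerZerbes2022GSp4Euler, Thm 10.1.3 (bookkeeping proved here)] -/
theorem canon_implications₉₅ : Implications95 (canon ν μ κ) (canon₉₅ ν μ κ) :=
  canon_implications₉₅W _

/-- In the parametrised reading both statements hold as soon as row A7 holds — through the tranche's bookkeeping theorem `lsz4_of_A7`. [cite: LoefflerSkinnerZerbes2022GSp4Euler, Thms 10.1.3, 11.2.3 (bookkeeping proved here)] -/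
theorem c95_all_of (c : Consumers) (h₇ : c.XuGSp) : (canon₉₅W c).LSZ4galois ∧ (canon₉₅W c).LSZ4euler :=
  lsz4_of_A7 (canon_implications₉₅W c) h₇

end Canon95

/-- Row A7 DENIED (`XuGSp := False`; the other tranche-1 fields as in `canon` at the top): a reading of `Consumers` used only to deny B. Xu's theorem; no first-tranche edge is claimed for it. [cite: Xu2017, main theorems (separating model; bookkeeping)] -/
abbrev c₁noA7 : Consumers := { canon νtop μtop κtop with XuGSp := False }

/-- At the top (every input of the book; Mok and KMSW at the all-ones assignments, unread by the tranche; tranche 1 read canonically) both statements hold, through the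
tranche's own `ninetyfifth_of_leaves`. [cite: LoefflerSkinnerZerbes2022GSp4Euler, Thms 10.1.3, 11.2.3 (bookkeeping proved here)] -/
theorem ninetyfifth_holds_top : (canon₉₅ νtop μtop κtop).LSZ4galois ∧ (canon₉₅ νtop μtop κtop).LSZ4euler :=
  ninetyfifth_of_leaves (canon_implications₉₅ νtop μtop κtop) (canon_implications νtop μtop κtop) bookInputs_top

/-- BOOK SIDE, EXACT SUPPORT: in each of the 24 book countermodels (book edge systems and every other book leaf hold, the removed leaf fails; Mok and KMSW at the all-ones
assignments; tranches 1 / 95 read canonically over it, ALL their edges valid) BOTH statements FAIL — every one of the 24 book leaves is load-bearing, through row A7.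
[cite: LoefflerSkinnerZerbes2022GSp4Euler, Thm 10.1.3, proof (« Xu has shown in [xu18] »), with Xu2017 §5.2 and Arthur2013 §1.5 (bookkeeping proved here)] -/
theorem c95_book_cm (l : LeafSupport.Leaf) :
    LeafSupport.Systems (LeafSupport.mkN (LeafSupport.cm l)) (LeafSupport.mkW (LeafSupport.cm l)) (LeafSupport.mkG (LeafSupport.cm l)) ∧
      (∀ l', l' ≠ l → (LeafSupport.mkN (LeafSupport.cm l)).leaf l') ∧ ¬ (LeafSupport.mkN (LeafSupport.cm l)).leaf l ∧
      (Implications (LeafSupport.mkN (LeafSupport.cm l)) μtop κtop (canon (LeafSupport.mkN (LeafSupport.cm l)) μtop κtop) ∧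
        Implications95 (canon (LeafSupport.mkN (LeafSupport.cm l)) μtop κtop) (canon₉₅ (LeafSupport.mkN (LeafSupport.cm l)) μtop κtop)) ∧
      (¬ (canon₉₅ (LeafSupport.mkN (LeafSupport.cm l)) μtop κtop).LSZ4galois ∧ ¬ (canon₉₅ (LeafSupport.mkN (LeafSupport.cm l)) μtop κtop).LSZ4euler) :=
  have cmod := LeafSupport.countermodel l
  have nb := not_B_cm l
  ⟨cmod.1, cmod.2.1, cmod.2.2.1, ⟨canon_implications _ _ _, canon_implications₉₅ _ _ _⟩, ⟨fun h => nb h, fun h => nb h⟩⟩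

/-- THE TWO ROUTES TO THE MULTIPLICITY-ONE CLAUSE SEPARATE AT THE READING LEVEL (top book; the tranche-95 and tranche-94 edges hold over each denied assignment): (a) row A7
DENIED (`c₁noA7`) ⇒ both C240 statements FAIL, while row C238's packet statement `HPpacket` — typed in tranche 94 ⇐ book ∧ A4, as Horawa – Prasanna print it, although
their clause (1) cites C240's Theorem 10.1.3 — HOLDS; (b) row A4 DENIED (`c₁noA4` of section 95) ⇒ both C240 statements HOLD while `HPpacket` FAILS. [cite: LoefflerSkinnerZerbes2022GSp4Euler, Thm 10.1.3 (1); HorawaPrasanna2025MotivicAction, Lemma 2.9 (1) (« [LSZ17] for (1) »); Xu2017; GeeTaibi2019, Thm 7.4.1 (separating models; bookkeeping proved here)] -/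
theorem c95_A7_denied_top :
    (Implications95 c₁noA7 (canon₉₅W c₁noA7) ∧ ¬ (canon₉₅W c₁noA7).LSZ4galois ∧ ¬ (canon₉₅W c₁noA7).LSZ4euler ∧
        Implications94 νtop c₁noA7 (canon₁₉ νtop μtop κtop) (canon₂₀ νtop μtop κtop) (canon₂₈ νtop μtop κtop) (canon₂₉ νtop μtop κtop) (canon₃₀ νtop μtop κtop) (canon₃₁ νtop μtop κtop)
          (canon₉₄W νtop c₁noA7 (canon₁₉ νtop μtop κtop) (canon₂₀ νtop μtop κtop) (canon₂₈ νtop μtop κtop) (canon₂₉ νtop μtop κtop) (canon₃₀ νtop μtop κtop) (canon₃₁ νtop μtop κtop)) ∧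
        (canon₉₄W νtop c₁noA7 (canon₁₉ νtop μtop κtop) (canon₂₀ νtop μtop κtop) (canon₂₈ νtop μtop κtop) (canon₂₉ νtop μtop κtop) (canon₃₀ νtop μtop κtop) (canon₃₁ νtop μtop κtop)).HPpacket) ∧
      (Implications95 c₁noA4 (canon₉₅W c₁noA4) ∧ (canon₉₅W c₁noA4).LSZ4galois ∧ (canon₉₅W c₁noA4).LSZ4euler ∧
        Implications94 νtop c₁noA4 (canon₁₉ νtop μtop κtop) (canon₂₀ νtop μtop κtop) (canon₂₈ νtop μtop κtop) (canon₂₉ νtop μtop κtop) (canon₃₀ νtop μtop κtop) (canon₃₁ νtop μtop κtop)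
          (canon₉₄W νtop c₁noA4 (canon₁₉ νtop μtop κtop) (canon₂₀ νtop μtop κtop) (canon₂₈ νtop μtop κtop) (canon₂₉ νtop μtop κtop) (canon₃₀ νtop μtop κtop) (canon₃₁ νtop μtop κtop)) ∧
        ¬ (canon₉₄W νtop c₁noA4 (canon₁₉ νtop μtop κtop) (canon₂₀ νtop μtop κtop) (canon₂₈ νtop μtop κtop) (canon₂₉ νtop μtop κtop) (canon₃₀ νtop μtop κtop) (canon₃₁ νtop μtop κtop)).HPpacket) :=
  have b : ∀ N, νtop.Everything N := bookInputs_top.everything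
  ⟨⟨canon_implications₉₅W _, fun h => h, fun h => h, canon_implications₉₄W _ _ _ _ _ _ _ _, ⟨b, b⟩⟩,
    ⟨canon_implications₉₅W _, b, b, canon_implications₉₄W _ _ _ _ _ _ _ _, fun h => h.2⟩⟩

/-- UNITARY SIDE: in each of Mok's 29 countermodels (KMSW = `κnoMok`) and in each of KMSW's countermodels, the book at the all-ones assignment (canonical readings over it),
BOTH typed statements HOLD — no statement of Mok 2015 or KMSW occurs in the tranche's edges (GSp_4 over ℚ throughout). [cite: LoefflerSkinnerZerbes2022GSp4Euler, Thms 10.1.3, 11.2.3 (bookkeeping proved here)] -/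
theorem c95_unitary_independent (l : Mok2015.LeafSupport.Leaf) (l' : KMSW2014.LeafSupport.Leaf) :
    ((canon₉₅ νtop (Mok2015.LeafSupport.mkN (Mok2015.LeafSupport.cm l)) κnoMok).LSZ4galois ∧ (canon₉₅ νtop (Mok2015.LeafSupport.mkN (Mok2015.LeafSupport.cm l)) κnoMok).LSZ4euler) ∧
      ((canon₉₅ νtop μtop (KMSW2014.LeafSupport.mkN (KMSW2014.LeafSupport.cm l'))).LSZ4galois ∧ (canon₉₅ νtop μtop (KMSW2014.LeafSupport.mkN (KMSW2014.LeafSupport.cm l'))).LSZ4euler) :=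
  have b : ∀ N, νtop.Everything N := bookInputs_top.everything
  ⟨⟨b, b⟩, ⟨b, b⟩⟩

/-- THE NINETY-FIFTH TRANCHE REGRADED, in one statement: (i) at the top both hold; (ii) in the book countermodel of ANY leaf both fail; (iii) A7 denied: both fail while C238's
`HPpacket` holds; A4 denied: both hold while `HPpacket` fails; (iv) in every Mok / KMSW countermodel (book at the top) both hold.  Supports: book 24 for both statements
(through A7); nothing of Mok 2015 or KMSW. [cite: LoefflerSkinnerZerbes2022GSp4Euler, Thms 10.1.3, 10.5.5 (v2) = 10.5.4 (v4), 11.2.3, 11.3.2, Cor. 11.2.4 (bookkeeping proved here)] -/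
theorem c95_regraded :
    ((canon₉₅ νtop μtop κtop).LSZ4galois ∧ (canon₉₅ νtop μtop κtop).LSZ4euler) ∧
      (∀ l : LeafSupport.Leaf, ¬ (LeafSupport.mkN (LeafSupport.cm l)).leaf l ∧
        ¬ (canon₉₅ (LeafSupport.mkN (LeafSupport.cm l)) μtop κtop).LSZ4galois ∧ ¬ (canon₉₅ (LeafSupport.mkN (LeafSupport.cm l)) μtop κtop).LSZ4euler) ∧
      (¬ (canon₉₅W c₁noA7).LSZ4galois ∧ ¬ (canon₉₅W c₁noA7).LSZ4euler ∧
        (canon₉₄W νtop c₁noA7 (canon₁₉ νtop μtop κtop) (canon₂₀ νtop μtop κtop) (canon₂₈ νtop μtop κtop) (canon₂₉ νtop μtop κtop) (canon₃₀ νtop μtop κtop) (canon₃₁ νtop μtop κtop)).HPpacket ∧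
        (canon₉₅W c₁noA4).LSZ4galois ∧ (canon₉₅W c₁noA4).LSZ4euler ∧
        ¬ (canon₉₄W νtop c₁noA4 (canon₁₉ νtop μtop κtop) (canon₂₀ νtop μtop κtop) (canon₂₈ νtop μtop κtop) (canon₂₉ νtop μtop κtop) (canon₃₀ νtop μtop κtop) (canon₃₁ νtop μtop κtop)).HPpacket) ∧
      (∀ (l : Mok2015.LeafSupport.Leaf) (l' : KMSW2014.LeafSupport.Leaf),
        (canon₉₅ νtop (Mok2015.LeafSupport.mkN (Mok2015.LeafSupport.cm l)) κnoMok).LSZ4euler ∧ (canon₉₅ νtop μtop (KMSW2014.LeafSupport.mkN (KMSW2014.LeafSupport.cm l'))).LSZ4euler) :=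
  ⟨ninetyfifth_holds_top,
    fun l => have h := c95_book_cm l
      ⟨h.2.2.1, h.2.2.2.2.1, h.2.2.2.2.2⟩,
    ⟨c95_A7_denied_top.1.2.1, c95_A7_denied_top.1.2.2.1, c95_A7_denied_top.1.2.2.2.2, c95_A7_denied_top.2.2.1, c95_A7_denied_top.2.2.2.1,
      c95_A7_denied_top.2.2.2.2.2⟩,
    fun l l' => have h := c95_unitary_independent l l'
      ⟨h.1.2, h.2.2⟩⟩

end Support

end Downstream

end Literature.NumberTheory.Automorphic.Arthur2013
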